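import Summits.FinalStateConjecture.FinalStateConjecture.Theses.EIHFluxBalance
import Summits.FinalStateConjecture.FinalStateConjecture.Theorems.EIHFluxBalanceInertialRecessionStubRechart11Orient
import Summits.FinalStateConjecture.FinalStateConjecture.Theorems.EIHFluxBalanceInertialRecessionRechartOfut
import Summits.FinalStateConjecture.FinalStateConjecture.Theorems.EIHFluxBalanceInertialRecessionStubEndgameToyFrozen

/-!
# Disproof work file for the crux `InertialRecession` — item stmt-FinalStateConjecture-17403 (E′, the
rev-6 RESTATEMENT of stmt-10166, route EIHFluxBalance) — standing disprover
`refuter-cdisprove-stmt-FinalStateConjecture-17403-0`, cycle 1 (2026-08-17): §0′, §A′/§B′, §J, §K; the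
material of the three earlier generations on item 10166 (§C–§I, §E) is kept verbatim below and still
applies clause for clause (the restatement only APPENDED four antecedent conjuncts and two conclusion
conjuncts).

Everything below is `lean check`ed (rc 0, NO `sorry`: the one near-miss of cycle 3, the frozen
`N`-body toy, is now a theorem at the crux's exponent `p = 3/2`, cited from the lead's landed
`…StubEndgameToyFrozen`). Prose lives in docstrings. LANDED in the tree (importable, namespace
`…Theorems.InertialRecession.Negative`): `Negative/KinematicShadow.lean` (p73795), `Negative/CesaroShadow.lean`
(p76105), `Negative/CleanScale{Cesaro,Sharpness,TwoBody,Encounters,Frozen}.lean`, `Negative/CesaroTauberian.lean`,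
`Negative/ExpandingCharge{Witness,LoadBearing,Binary,Additivity}.lean`, `Negative/PaintingRigidityStabiliser.lean`
(gens 1–3 / drefute g2–g4, all on item 10166), and — THIS cycle, on item 17403 —
`Negative/KinematicShadowRates.lean` (p133268 ACCEPTED: the (QS)-RATED kinematic shadows are false) and
`Negative/KinematicShadowBorderline.lean` (p133634 ACCEPTED: even the borderline rate `t ξ'' → 0` does not
freeze the velocity — log-log witness). Index:

* §0′ VERDICT for the restated crux (cycle 1 on 17403) — **no kill; none feasible by junk; the
  restatement made the crux EASIER, not harder.** The antecedent still quantifies over honest MGHDs of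
  admissible data (`IsMaximal`, `Fact`-guarded Levi-Civita, honest `ℝ≥0∞` sups), so `¬ InertialRecession`
  needs a genuine non-settling multi-Kerr-tracking vacuum development; the four APPENDED antecedent
  conjuncts (T) lab-time causality, (O) orthochronous frames, (R) `RaysStayInClosure 𝒟 O`, (QS) weighted
  quasi-stationarity only shrink the class of developments to be settled, and the two new CONCLUSION
  conjuncts are paid for by them one-for-one: `RaysStayInClosure 𝒟 O′` by (R) with `O′ = O` (§B′: the
  re-charting keeps `O`), `IsFutureOriented d` by (T) + `C⁰` closeness (§B′ uses the lead's landed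
  `isFutureDirected_mfderiv_of_labTimeCausality` / `eventually_isFutureDirected_flatChart`), honest radii by
  `Rᵢ → ∞`. Degenerate instance `N = 0`: NOT a counterexample (`conclusion_of_antecedent_zero`, now for the
  re-typed conclusion, modulo push-up only). Junk values at `N = 0` (§J): the cone weight is `1`
  (`⨅ over Fin 0 = 0`) and (QS) holds AUTOMATICALLY (its constraint set is eventually empty) — so (QS) adds
  nothing at `N = 0`, consistent with `N = 0` being bookkeeping.
* §J LOAD-BEARING UPDATE for the new clauses: (QS) is a RATE on the painted moduli (`t^{3/4}‖(Λᵢe₀)˙‖ → 0`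
  for an isolated slaved hole — the route's own necessity theorem), but rates short of integrability
  freeze nothing: the KinematicShadow witness has `|ξ''| ≤ κ²/t`, `|ξ'''| ≤ 2κ²/t`, hence satisfies
  `t^s ξ'' → 0`, `t^s ξ''' → 0` for EVERY `s < 1` and still has no Cesàro velocity
  (`inertialRecession_false_without_fieldEquations_rated[_frozen]`, landed as `Negative/KinematicShadowRates.lean`);
  the BORDERLINE `s = 1` (`t ξ'' → 0`, `t ξ''' → 0`) fails too, by the log-log-phase witness `centre₂` of
  `Negative/KinematicShadowBorderline.lean` (`inertialRecession_false_without_fieldEquations_borderline`), so the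
  freezing threshold is exactly SUMMABILITY of the force bound (`tendsto_of_integrableOn_deriv`).
  So after the restatement the field equations (an INTEGRABLE balance, `tendsto_of_integrableOn_deriv`)
  remain exactly as load-bearing as before; (T)/(O)/(R) have no kinematic shadow at all (they constrain
  the chart, not the moduli) and are consumed only by the re-charting.
* §K WHY IT RESISTS after rev 6 (docstring `regimes_note_rev6`): the census' two "planner-level" inputs
  ((T)/(O) and QS) are now hypotheses; the feared slow/parabolic-cluster regime is, by the antecedent's
  own `m = 0` weighted clause at `d ≍ t` (binding-energy defect `MᵢMⱼ t^{3/4}/D ↛ 0` unless `D ≫ t^{3/4}`),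
  outside the antecedent — vacuous for E′; every adversarial schedule of the charge toy dies on the landed
  all-`N` frozen toy; Newtonian/PN final-motion theory (Chazy, Marchal–Saari, Saari) has no bounded-speed,
  all-distances-diverging, non-Cesàro family; exhaustion + (T) force the painted horizons to be one-way at
  all late lab times (theorem `not_mem_exterior_of_paintedInterior`; a constraint on H′, a gift to E′). What is
  left for the provers is the lead's list
  (general-`|S|` increment oracle, COER/slaving assembly, the `a ≠ 0` causal clauses of the re-charting,
  the `O′ = O` push-up and the common-`τ₁` exhaustion transfer) — none of which has a counterexample
  candidate.

INDEX OF THE EARLIER GENERATIONS (item 10166; unchanged, still valid for 17403):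

* §0 VERDICT (revised in cycle 2, confirmed in cycle 3) — **no kill, and none is feasible by junk**: the crux
  quantifies over `D ∈ admissibleVacuumData X` and MGHDs (`IsMaximal` = Choquet-Bruhat–Geroch maximality,
  `HasLeviCivita` an honest `Fact`, `deviationCk` an honest `ℝ≥0∞` sup, `exteriorOf ⊆ J⁺(ιX)`), so any
  `¬ InertialRecession` needs a GENUINE MGHD tracking a non-settling multi-Kerr ansatz — not constructible
  here, and (below) not even plausible. WHAT THE CRUX REALLY ASKS (cycle 2, agreeing with card
  `Ideas/cesaro-velocities-suffice.md` and the prover analysis on the item): the typed conclusion —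
  `FinalStateDecomposition … 2` with CONSTANT motions, SUBLINEAR excision tubes around STRAIGHT world-lines,
  ANY smooth open embeddings as hole charts — needs per hole only (i) adiabaticity `|Λ̇ᵢ| → 0` (the hole
  chart absorbs the modulation; forced by `Ric = 0` + `C³` closeness) and (ii) a CESÀRO velocity
  `ξᵢ(t)/t → Vᵢ` (the flat chart pins one global inertial frame; a hole must stay inside an `o(t)`-tube
  around a straight line). It does NOT need instantaneous velocity convergence — but (cycle 3, §I) the
  toy mechanism the hypothesis feeds DELIVERS instantaneous convergence anyway once h₄ is used, so the two
  leads' endgames (`stub_cesaroEndgame`, Cesàro; `stub_expandingChargeKinematics`, instantaneous) are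
  equally plausible real-variable statements, and neither has a toy counterexample for `N ≤ 2`.
* §A/§B (superseded by §A′/§B′ above for the restated decl; the old 10166 versions are deleted): faithful
  split `inertialRecession_iff` (`Iff.rfl`) and `N = 0` IS NOT A COUNTEREXAMPLE
  (`conclusion_of_antecedent_zero`, shift `d.τ₀ := τ₀ + 1`, one push-up `I(J S) = I S`). [The prover landed
  the old decl's `N = 0` case as `inertialRecession_noHoles`, p68340.]
* §C LOAD-BEARING = THE FIELD EQUATIONS: `inertialRecession_false_without_fieldEquations` — the kinematic
  shadow (smooth centre in the cone, speed `≤ κ²`, second and third derivatives `→ 0`) does not freeze the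
  velocity; witness `ξ = κ² ∫₀ᵗ cos(log(1+s²)/2)`.
* §D TIGHTNESS OF THE INTEGRABLE-FORCE ROUTE: integrable force ⇒ frozen momentum
  (`tendsto_of_integrableOn_deriv`) vs the `O(1/t)` force of the witness; route numbers
  (`linearRemainder_integrable` 21/20, `quadraticRemainder_not_integrable` `t^{-b}`, `b ≤ 1`,
  `quadraticRemainder_integrable_of_rate`, `weight_window` `3/2 < p < 2`).
* §F MUTATION h₄ (pairwise separation) probably REDUNDANT (Brill–Lindquist superposition defect `≥ 12ab`).
* §G (cycle 2) THE KINEMATICS DO NOT EVEN GIVE CESÀRO VELOCITIES: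
  `inertialRecession_false_without_fieldEquations_cesaro : ¬ (∀ κ ξ, KinematicShadow κ ξ → CesaroShadow ξ)`
  with the SAME witness (its Cesàro mean is `(cos log t + sin log t)/2 + O(1/t)`:
  `tendsto_centre_one_div_sub`, `not_tendsto_centre_div`); `frozenShadow_imp_cesaroShadow` (frozen ⇒
  Cesàro) makes this a STRENGTHENING of §C. So the transfer target `CesaroVelocities` of the crux chain is
  genuinely dynamical (conservation laws of the development), not kinematic.
* §H (cycle 2) THE RATE-FREE CLEAN-SCALE MECHANISM AND ITS SHARPNESS. What the weighted clause
  (`(1 + d^{7/4}) |∂^m h| → 0` in `|x̲| ≤ κt`) offers is a momentum balance on every CLEAN sphere (distance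
  `≍ d` from all centres) with flux `O((ε d^{-7/4})² d²) = O(ε² d^{-3/2})`: a force law `K d^{-p}`,
  `p = 3/2`, with NO sign, NO potential, NO rate (`K := sup ε²`). Toy theorem
  `tendsto_div_of_abs_deriv2_le_rpow`: `|s''| ≤ K|s|^{-p}` wherever `s ≠ 0`, `|s'| ≤ v`, `p > 1` ⇒ `s(t)/t`
  converges — by the CROSSING LEMMA `no_crossing_of_abs_deriv2_le` (between an up-crossing of `βt` and the
  next down-crossing of `αt` the trajectory is in `{s ≥ αt}`, where the force is `≤ K(αt)^{-p}`,
  integrable IN THAT REGION; first hitting times + monotonicity of `s' - (K/(p-1))t^{1-p}`); no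
  integrability along the trajectory, no energy. SHARP at `p = 1`: `not_tendsto_div_at_exponent_one`
  (`s = t(2 + sin log log t)`, `|s''| ≤ 9|s|^{-1}`, `|s'| ≤ 4`, `s/t` wanders forever). In crux units
  `p = 2w - 2` (`cesaro_exponent_window`): the typed weight `w = 7/4` gives `p = 3/2 > 1`; at `w = 3/2` the
  mechanism is dead — the margin is load-bearing even for Cesàro velocities. With total-momentum
  convergence at scale `t` (fluxes `ε² t^{-3/2}`, integrable with no rate) this settles the `N = 2` toy;
  the `N ≥ 3` toy (clean-cluster balance at every scale `r ≤ t`) is argued TRUE in `regimes_note` but not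
  formalised.
* §I (cycle 3) SEPARATION FREEZES INSTANTANEOUS VELOCITIES: h₄ + `|s''| ≤ K s^{-p}` (`p > 1`) ⇒ `s'`
  converges (`tendsto_deriv_of_abs_deriv2_le_rpow_of_tendsto_atTop`: turnaround lemma for descents,
  energy monotonicity `ascent_persists` for ascents, then integrability); the pair in `ℝⁿ`:
  `toy_two_body_frozen` (escape lemma `escape_of_deriv_ge` in the sup-norm coordinate). This CORRECTS §E's
  cycle-2 Tauberian remark (no sub-parabolic wandering is possible under h₄) and makes the FROZEN `N`-body toy
  `ToyCleanScaleFrozenMotion` the honest target (cycle 3: one `sorry`; NOW a theorem at `p = 3/2` for all `N`,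
  `toyCleanScaleFrozenMotion_three_halves`, citing the lead's landed `toy_frozen_three_halves`; its `N = 2` case
  `toyCleanScaleFrozenMotion_two` is proved here, bookkeeping `min(d,t) ≥ d/C` and the `C = univ` balance included).
* §E OPEN REGIMES / WHY IT RESISTS (docstring of `regimes_note`, rewritten in cycle 2, amended in cycle 3): the crux as typed is
  Marchal–Saari's theorem (`R = O(t) ⇒ rᵢ = Aᵢt + O(t^{2/3})`, i.e. CESÀRO velocities) transplanted to GR
  with the cone weight supplying an effective `d^{-3/2}` coupling; no Newtonian, post-Newtonian or toy
  family with all `r_ij → ∞`, bounded speeds and a NON-convergent `ξᵢ(t)/t` is known; the remaining risks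
  are bookkeeping (painted `λ̇` terms in sup-norm flux identities — triage F2; the lab-slab/boosted-slab
  exhaustion transfer; `|Λ̇ᵢ| → 0` from `Ric = 0`), not the mechanism.
-/

set_option linter.dupNamespace false

noncomputable section

namespace Summit.FinalStateConjecture.FinalStateConjecture.Cruxes.InertialRecession.Disproof

open scoped BigOperators Topology Manifold Classical MeasureTheory Matrix InnerProductSpace ContDiff
open Filter Set Function TopologicalSpace MeasureTheory intervalIntegral Literature.Geometry.Lorentzian
open Summit.FinalStateConjecture.FinalStateConjecture.Theses.EIHFluxBalance

/-! ## §A′ Faithful split of the RESTATED crux (item 17403) and §B′ the degenerate instance `N = 0` -/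

section Decomposition

variable {X : Type} [TopologicalSpace X] [ChartedSpace E3 X] [IsManifold (𝓡 3) ((⊤ : ℕ∞) : WithTop ℕ∞) X]
  [T2Space X] [SecondCountableTopology X] [ConnectedSpace X] {D : InitialDataSet (𝓡 3) X}

/-- The ANTECEDENT of the restated crux for a fixed number `N` of modulated holes (verbatim the crux
text with `∃ N` pulled out): the twelve modulated-ansatz clauses of item 10166 followed — inside the
`let B := …` body — by the four appended handoff conjuncts (T) eventual lab-time causality on the
guaranteed late region, (O) orthochronous painted frames, (R) `RaysStayInClosure 𝒟 O`, (QS) weighted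
quasi-stationarity of the painted background. -/
def Antecedent (𝒟 : VacuumCauchyDevelopment D) (N : ℕ) : Prop :=
  ∃ (M a rin : Fin N → ℝ) (Λ : Fin N → ℝ → lorentzGroup) (ξ : Fin N → ℝ → E3) (γ κ τ₀ : ℝ) (U : Opens E4) (Φ : U → 𝒟.carrier) (O : Set 𝒟.carrier), (∀ i, Kerr.IsSubextremal (M i) (a i) ∧ Kerr.rMinus (M i) (a i) < rin i ∧ rin i < Kerr.rPlus (M i) (a i)) ∧ (∀ i t, |((Λ i t : E4 ≃L[ℝ] E4) (E4.basisVector 0)) 0| ≤ γ) ∧ (∀ i, ContDiff ℝ ((⊤ : ℕ∞) : WithTop ℕ∞) (ξ i) ∧ ContDiff ℝ ((⊤ : ℕ∞) : WithTop ℕ∞) (fun t ↦ ((Λ i t : E4 ≃L[ℝ] E4) : E4 →L[ℝ] E4))) ∧ (∀ i j, i ≠ j → Tendsto (fun t ↦ ‖ξ i t - ξ j t‖) atTop atTop) ∧ (0 < κ ∧ κ < 1 ∧ ∀ i, ∀ᶠ t in atTop, ‖ξ i t‖ ≤ κ ^ 2 * t) ∧ ({x : E4 | τ₀ < x 0 ∧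 ∀ i, rin i < Kerr.radius (a i) (poincareInv (Λ i (x 0)) (E4.ofTimeSpace (x 0) (ξ i (x 0))) x)} ⊆ (U : Set E4)) ∧ let B : ModelBackground := ⟨U, fun x ↦ Minkowski.bilin + ∑ i, (boostedKerrBilin (Λ i (x 0)) (E4.ofTimeSpace (x 0) (ξ i (x 0))) (M i) (a i) x - Minkowski.bilin), fun x ↦ x 0, E4.spatialNorm⟩; ContMDiff 𝓘(ℝ, E4) (𝓡 4) ((⊤ : ℕ∞) : WithTop ℕ∞) Φ ∧ Topology.IsOpenEmbedding ((B.lateRegion τ₀).restrict Φ) ∧ Φ '' {x : U | τ₀ < x.1 0 ∧ ∀ i, Kerr.rPlus (M i) (a i) < Kerr.radius (a i) (poincareInv (Λ i (x.1 0)) (E4.ofTimeSpace (x.1 0) (ξ i (x.1 0))) x.1)} ⊆ O ∧ Tendsto (fun t ↦ 𝒟.toSpacetime.deviationCk B Φ 3 t) atTop (𝓝 0) ∧ Tendsto (fun t : ℝ ↦ ⨆ x ∈ {x : U | x.1 0 = t ∧ E4.spatialNorm x.1 ≤ κ * t}, ⨆ (m : ℕ) (_ : m ≤ 3), ENNReal.ofReal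 (1 + √(√((⨅ i, ‖E4.spatial x.1 - ξ i t‖) ^ 7))) * ‖iteratedFDeriv ℝ m (𝒟.toSpacetime.deviationExtend B Φ) x.1‖ₑ) atTop (𝓝 0) ∧ O = Summit.FinalStateConjecture.exteriorOf 𝒟.toCauchyDevelopment (Φ '' {x : U | τ₀ < x.1 0 ∧ ∀ i, Kerr.rPlus (M i) (a i) < Kerr.radius (a i) (poincareInv (Λ i (x.1 0)) (E4.ofTimeSpace (x.1 0) (ξ i (x.1 0))) x.1)}) ∧ (∀ t₁ : ℝ, τ₀ < t₁ → O \ Φ '' {x : U | t₁ < x.1 0 ∧ ∀ i, Kerr.rPlus (M i) (a i) < Kerr.radius (a i) (poincareInv (Λ i (x.1 0)) (E4.ofTimeSpace (x.1 0) (ξ i (x.1 0))) x.1)} ⊆ 𝒟.metric.causalPast 𝒟.timeOrientation (Φ '' {x : U | x.1 0 = t₁ ∧ ∀ i, Kerr.rPlus (M i) (a i) < Kerr.radius (a i) (poincareInv (Λ i (x.1 0)) (E4.ofTimeSpace (x.1 0) (ξ i (x.1 0))) x.1)})) ∧ (∃ τ₁ : ℝ, ∀ x y : U, (τ₁ < x.1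 0 ∧ ∀ i, rin i < Kerr.radius (a i) (poincareInv (Λ i (x.1 0)) (E4.ofTimeSpace (x.1 0) (ξ i (x.1 0))) x.1)) → (τ₁ < y.1 0 ∧ ∀ i, rin i < Kerr.radius (a i) (poincareInv (Λ i (y.1 0)) (E4.ofTimeSpace (y.1 0) (ξ i (y.1 0))) y.1)) → Φ y ∈ 𝒟.metric.causalFuture 𝒟.timeOrientation {Φ x} → x.1 0 ≤ y.1 0) ∧ (∀ (i : Fin N) (t : ℝ), 0 < (((Λ i t : lorentzGroup) : E4 ≃L[ℝ] E4) (E4.basisVector 0)) 0) ∧ Summit.FinalStateConjecture.RaysStayInClosure 𝒟.toCauchyDevelopment O ∧ (∀ ρ : ℝ → ℝ, Tendsto ρ atTop atTop → Tendsto (fun t : ℝ ↦ ⨆ x ∈ {x : E4 | x 0 = t ∧ E4.spatialNorm x ≤ κ * t ∧ ρ t ≤ ⨅ i, ‖E4.spatial x - ξ i t‖}, ENNReal.ofReal (1 + √(√((⨅ i, ‖E4.spatial x - ξ i t‖) ^ 7))) * ‖fderiv ℝ (fun y : E4 ↦ Minkowski.bilin + ∑ i, (boostedKerrBilin (Λ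 i (y 0)) (E4.ofTimeSpace (y 0) (ξ i (y 0))) (M i) (a i) y - Minkowski.bilin)) x (E4.basisVector 0)‖ₑ) atTop (𝓝 0))

/-- The CONCLUSION of the restated crux (verbatim = the re-typed Statement's settled clause): a `C²`
final-state decomposition with sub-extremal holes, self-determined exterior, rays staying in its
closure, exhaustive honest charts, future-oriented chart times. -/
def Conclusion (𝒟 : VacuumCauchyDevelopment D) : Prop :=
  ∃ (O : Set 𝒟.carrier) (d : FinalStateDecomposition 𝒟.toSpacetime O 2), (∀ i, Kerr.IsSubextremal (d.mass i) (d.spin i)) ∧ O = Summit.FinalStateConjecture.exteriorOf 𝒟.toCauchyDevelopment d.charted ∧ Summit.FinalStateConjecture.RaysStayInClosure 𝒟.toCauchyDevelopment O ∧ Summit.FinalStateConjecture.HasExhaustiveCharts d ∧ Summit.FinalStateConjecture.IsFutureOriented d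

end Decomposition

/-- Faithfulness of the split: the restated crux is literally `∀ …, (∃ N, Antecedent 𝒟 N) → Conclusion 𝒟`. -/
theorem inertialRecession_iff :
    InertialRecession ↔
      ∀ (X : Type) [TopologicalSpace X] [ChartedSpace E3 X]
        [IsManifold (𝓡 3) ((⊤ : ℕ∞) : WithTop ℕ∞) X] [T2Space X] [SecondCountableTopology X]
        [ConnectedSpace X], ∀ D ∈ admissibleVacuumData X, ∀ 𝒟 : VacuumCauchyDevelopment D,
        𝒟.IsMaximal → (∃ N, Antecedent 𝒟 N) → Conclusion 𝒟 :=
  Iff.rfl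

section CaseN0

variable {X : Type} [TopologicalSpace X] [ChartedSpace E3 X] [IsManifold (𝓡 3) ((⊤ : ℕ∞) : WithTop ℕ∞) X]
  [T2Space X] [SecondCountableTopology X] [ConnectedSpace X] {D : InitialDataSet (𝓡 3) X}

omit [T2Space X] [SecondCountableTopology X] in
/-- `N = 0` BOOKKEEPING for the re-typed conclusion, clean form: an asymptotically Minkowskian lab chart on
the late half-space with the crux's exterior/exhaustion clauses, the rays clause (R) for its own `O` and an
eventually future-directed `dΦ e₀` on the flat slabs yields the Conclusion (a hole-free `C²` decomposition
with `d.τ₀ := τ₀ + 1`, `flatDomain := U`, `flatChart := Φ`, `O′ := O`), MODULO push-up `I⁻(J⁻ S) = I⁻ S`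
for the development (hypothesis `hpush`, the tree's parametrised predicate
`LorentzianMetric.chronologicalFuture_causalFuture` at the reversed time orientation; true on spacetimes,
O'Neill 1983 Cor. 14.1, not yet proved in the tree). The shift `τ₀ ↦ τ₀ + 1` is forced: the crux's
exhaustion clause is only asserted for `t₁ > τ₀` and the slab `{x⁰ = τ₀}` need not lie in `U`. The two new
conclusion conjuncts cost nothing here: `RaysStayInClosure` is (R) verbatim because `O′ = O`, and
`IsFutureOriented` reduces to its flat conjunct (iii). -/
theorem conclusion_of_flatLateChart (𝒟 : VacuumCauchyDevelopment D)
    (hpush : 𝒟.metric.chronologicalFuture_causalFuture 𝒟.timeOrientation.reverse)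
    {τ₀ : ℝ} {U : Opens E4} {Φ : U → 𝒟.carrier} {O : Set 𝒟.carrier}
    (hU : {x : E4 | τ₀ < x 0} ⊆ (U : Set E4))
    (hsmooth : ContMDiff 𝓘(ℝ, E4) (𝓡 4) ((⊤ : ℕ∞) : WithTop ℕ∞) Φ)
    (hemb : Topology.IsOpenEmbedding (((Minkowski.backgroundOn U).lateRegion τ₀).restrict Φ))
    (hsub : Φ '' (Minkowski.backgroundOn U).lateRegion τ₀ ⊆ O)
    (hdev : Tendsto (fun t ↦ 𝒟.toSpacetime.deviationCk (Minkowski.backgroundOn U) Φ 2 t)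
      atTop (𝓝 0))
    (hO : O = Summit.FinalStateConjecture.exteriorOf 𝒟.toCauchyDevelopment
      (Φ '' (Minkowski.backgroundOn U).lateRegion τ₀))
    (hexh : ∀ t₁ : ℝ, τ₀ < t₁ → O \ Φ '' (Minkowski.backgroundOn U).lateRegion t₁ ⊆
      𝒟.metric.causalPast 𝒟.timeOrientation (Φ '' (Minkowski.backgroundOn U).timeSlab t₁))
    (hR : Summit.FinalStateConjecture.RaysStayInClosure 𝒟.toCauchyDevelopment O)
    (hfut : ∀ᶠ τ in atTop, ∀ x ∈ (Minkowski.backgroundOn U).timeSlab τ,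
      𝒟.timeOrientation.IsFutureDirected (mfderiv 𝓘(ℝ, E4) (𝓡 4) Φ x (E4.basisVector 0))) :
    Conclusion 𝒟 := by
  have hlate : ∀ {s t : ℝ}, s ≤ t →
      (Minkowski.backgroundOn U).lateRegion t ⊆ (Minkowski.backgroundOn U).lateRegion s :=
    fun h ↦ ModelBackground.lateRegion_mono _ h
  have hopen : IsOpen ((Subtype.val ⁻¹' (Minkowski.backgroundOn U).lateRegion (τ₀ + 1) :
      Set ((Minkowski.backgroundOn U).lateRegion τ₀))) :=
    isOpen_lt continuous_const ((EuclideanSpace.proj (0 : Fin 4)).continuous.comp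
      (continuous_subtype_val.comp continuous_subtype_val))
  refine ⟨O,
    { N := 0
      mass := Fin.elim0
      spin := Fin.elim0
      mass_pos := fun i ↦ i.elim0
      abs_spin_le_mass := fun i ↦ i.elim0
      motion := Fin.elim0
      τ₀ := τ₀ + 1
      chart := fun i ↦ i.elim0
      isLateChart := fun i ↦ i.elim0
      tendsto_truncDeviationCk := fun i ↦ i.elim0
      exists_pairwise_disjoint := fun _ ↦ ⟨0, fun i ↦ i.elim0⟩
      excision := Fin.elim0
      tendsto_excision_div := fun i ↦ i.elim0
      flatDomain := U
      setOf_lt_excision_subset_flatDomain := fun x hx ↦ hU (show τ₀ < x 0 by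
        have := hx.1; linarith)
      flatChart := Φ
      isLateChart_flat :=
        { contMDiff := hsmooth
          isOpenEmbedding := hemb.comp (Topology.IsOpenEmbedding.inclusion
            (hlate (by linarith)) hopen)
          image_subset := (image_mono (hlate (by linarith))).trans hsub }
      tendsto_deviationCk_flat := hdev
      diff_subset_causalPast := by
        rw [Set.iUnion_of_empty, Set.empty_union, Set.iUnion_of_empty, Set.empty_union]
        exact hexh (τ₀ + 1) (by linarith) }, fun i ↦ i.elim0, ?_, hR, ?_, ?_⟩
  · -- the self-determined exterior is unchanged by the shift `τ₀ ↦ τ₀ + 1` (push-up)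
    simp only [FinalStateDecomposition.charted, FinalStateDecomposition.radiationZone,
      Set.iUnion_of_empty, Set.union_empty]
    change O = Summit.FinalStateConjecture.exteriorOf 𝒟.toCauchyDevelopment
      (Φ '' (Minkowski.backgroundOn U).lateRegion (τ₀ + 1))
    apply Set.Subset.antisymm
    · intro p hp
      have hp' := hp
      rw [hO] at hp'
      obtain ⟨hpJ, hpI⟩ := hp'
      refine ⟨hpJ, ?_⟩
      simp only [LorentzianMetric.chronologicalPast,
        LorentzianMetric.mem_chronologicalFuture_iff] at hpI
      obtain ⟨q, hqA, γc, sa, sb, hab, hγ, hγa, hγb⟩ := hpI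
      have hqO : q ∈ O := hsub hqA
      have hpq : p ∈ 𝒟.metric.chronologicalFuture 𝒟.timeOrientation.reverse {q} :=
        ⟨q, rfl, γc, sa, sb, hab, hγ, hγa, hγb⟩
      by_cases hq2 : q ∈ Φ '' (Minkowski.backgroundOn U).lateRegion (τ₀ + 2)
      · exact LorentzianMetric.chronologicalFuture_mono (singleton_subset_iff.mpr
          (image_mono (hlate (by linarith)) hq2)) hpq
      · have hqJ : q ∈ 𝒟.metric.causalPast 𝒟.timeOrientation
            (Φ '' (Minkowski.backgroundOn U).timeSlab (τ₀ + 2)) :=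
          hexh (τ₀ + 2) (by linarith) ⟨hqO, hq2⟩
        have hS : Φ '' (Minkowski.backgroundOn U).timeSlab (τ₀ + 2) ⊆
            Φ '' (Minkowski.backgroundOn U).lateRegion (τ₀ + 1) :=
          image_mono (ModelBackground.timeSlab_subset_lateRegion _ (by linarith))
        have hpJ' := LorentzianMetric.chronologicalFuture_mono (singleton_subset_iff.mpr hqJ) hpq
        change p ∈ 𝒟.metric.chronologicalFuture 𝒟.timeOrientation.reverse
          (𝒟.metric.causalFuture 𝒟.timeOrientation.reverse _) at hpJ'
        rw [hpush ENat.LEInfty.out] at hpJ'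
        exact LorentzianMetric.chronologicalFuture_mono hS hpJ'
    · rw [hO]
      exact inter_subset_inter_right _
        (LorentzianMetric.chronologicalFuture_mono (image_mono (hlate (by linarith))))
  · -- exhaustive charts with honest radii: no hole, and the crux's exhaustion clause, verbatim, for
    -- every `τ₁ > τ₀ + 1`
    refine ⟨Fin.elim0, fun i ↦ i.elim0, fun i ↦ i.elim0, fun τ₁ hτ₁ ↦ ?_⟩
    have hτ₁' : τ₀ + 1 < τ₁ := hτ₁
    simp only [Summit.FinalStateConjecture.certifiedLate, Summit.FinalStateConjecture.certifiedSlab,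
      Set.iUnion_of_empty, Set.union_empty]
    exact hexh τ₁ (by linarith)
  · -- future orientation: no hole, and the flat conjunct (iii) is `hfut`
    exact ⟨fun i ↦ i.elim0, fun i ↦ i.elim0, hfut⟩

omit [T2Space X] [SecondCountableTopology X] in
/-- The flat conjunct (iii) of `IsFutureOriented` for a lab chart on the late half-space, FROM (T):
eventual lab-time causality on `{x⁰ > τ₁}` makes `dΦ w` future-directed whenever `w⁰ > 0` and `dΦ w` is
timelike (the lead's landed cone argument `isFutureDirected_mfderiv_of_labTimeCausality`, …RechartOfut),
and `C⁰` convergence to `η` on the flat slabs makes `dΦ e₀` eventually timelike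
(`eventually_isFutureDirected_flatChart`, …StubRechart11Orient). So at `N = 0` the new conclusion conjunct
`IsFutureOriented` is exactly paid for by the new antecedent conjunct (T). -/
theorem flat_isFutureOriented_of_labTime (𝒟 : VacuumCauchyDevelopment D) {τ₀ τ₁ : ℝ} {U : Opens E4}
    {Φ : U → 𝒟.carrier} (hU : {x : E4 | τ₀ < x 0} ⊆ (U : Set E4))
    (hsmooth : ContMDiff 𝓘(ℝ, E4) (𝓡 4) ((⊤ : ℕ∞) : WithTop ℕ∞) Φ)
    (hdev : Tendsto (fun t ↦ 𝒟.toSpacetime.deviationCk (Minkowski.backgroundOn U) Φ 3 t)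
      atTop (𝓝 0))
    (hT : ∀ x y : U, τ₁ < x.1 0 → τ₁ < y.1 0 →
      Φ y ∈ 𝒟.metric.causalFuture 𝒟.timeOrientation {Φ x} → x.1 0 ≤ y.1 0) :
    ∀ᶠ τ in atTop, ∀ x ∈ (Minkowski.backgroundOn U).timeSlab τ,
      𝒟.timeOrientation.IsFutureDirected (mfderiv 𝓘(ℝ, E4) (𝓡 4) Φ x (E4.basisVector 0)) := by
  set T : ℝ := max τ₀ τ₁ with hTdef
  have hS : IsOpen {z : E4 | T < z 0} :=
    isOpen_lt continuous_const (EuclideanSpace.proj (0 : Fin 4)).continuous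
  have hSU : {z : E4 | T < z 0} ⊆ (U : Set E4) := fun z hz ↦
    hU (show τ₀ < z 0 from (le_max_left τ₀ τ₁).trans_lt hz)
  have hOfut : ∀ x : U, T < x.1 0 → ∀ w : E4, 0 < w 0 →
      𝒟.metric.val (Φ x) (mfderiv 𝓘(ℝ, E4) (𝓡 4) Φ x w) (mfderiv 𝓘(ℝ, E4) (𝓡 4) Φ x w) < 0 →
        𝒟.timeOrientation.IsFutureDirected (mfderiv 𝓘(ℝ, E4) (𝓡 4) Φ x w) :=
    fun x hx w hw htl ↦
      Summit.FinalStateConjecture.FinalStateConjecture.Theorems.isFutureDirected_mfderiv_of_labTimeCausality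
        (𝓢 := 𝒟.toSpacetime) hsmooth hS hSU
        (fun x y hx hy h ↦ hT x y ((le_max_right _ _).trans_lt hx) ((le_max_right _ _).trans_lt hy) h)
        x hx hw htl
  have h := Summit.FinalStateConjecture.FinalStateConjecture.Theorems.eventually_isFutureDirected_flatChart
    (𝓢 := 𝒟.toSpacetime) U Φ (fun x ↦ T < x.1 0) hsmooth hOfut U le_rfl (TQ := T) (fun x hx ↦ hx)
    (k := 3) hdev
  exact h

omit [T2Space X] [SecondCountableTopology X] in
set_option synthInstance.maxHeartbeats 400000 in
/-- `N = 0` CASE OF THE RESTATED CRUX, modulo push-up: the antecedent with no hole (an MGHD which is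
`C³`-asymptotically Minkowskian on late lab slabs, with the exterior/exhaustion clauses, (T), (R); (O) and
(QS) are vacuous resp. automatic at `N = 0`, §J) implies the re-typed Conclusion. Hence the degenerate
instance `N = 0` is NOT a counterexample to the restated `InertialRecession` either; beyond bookkeeping
the inputs are push-up and the lead's landed orientation lemmas. -/
theorem conclusion_of_antecedent_zero (𝒟 : VacuumCauchyDevelopment D)
    (hpush : 𝒟.metric.chronologicalFuture_causalFuture 𝒟.timeOrientation.reverse)
    (h : Antecedent 𝒟 0) : Conclusion 𝒟 := by
  obtain ⟨M, a, rin, Λ, ξ, γ, κ, τ₀, U, Φ, O, -, -, -, -, -, hU, hsmooth, hemb, hsub, hdev, -, hO,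
    hexh, ⟨τ₁, hT⟩, -, hR, -⟩ := h
  have hset1 : ∀ s : ℝ, {x : U | s < x.1 0 ∧ ∀ i, Kerr.rPlus (M i) (a i) < Kerr.radius (a i)
      (poincareInv (Λ i (x.1 0)) (E4.ofTimeSpace (x.1 0) (ξ i (x.1 0))) x.1)} =
      (Minkowski.backgroundOn U).lateRegion s := fun s ↦ by
    ext x; simp [ModelBackground.lateRegion, Minkowski.backgroundOn]
  have hset2 : ∀ s : ℝ, {x : U | x.1 0 = s ∧ ∀ i, Kerr.rPlus (M i) (a i) < Kerr.radius (a i)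
      (poincareInv (Λ i (x.1 0)) (E4.ofTimeSpace (x.1 0) (ξ i (x.1 0))) x.1)} =
      (Minkowski.backgroundOn U).timeSlab s := fun s ↦ by
    ext x; simp [ModelBackground.timeSlab, Minkowski.backgroundOn]
  simp only [hset1, hset2] at hsub hO hexh
  have hU' : {x : E4 | τ₀ < x 0} ⊆ (U : Set E4) := fun x hx ↦ hU ⟨hx, fun i ↦ i.elim0⟩
  have hdev' : Tendsto (fun t ↦ 𝒟.toSpacetime.deviationCk (Minkowski.backgroundOn U) Φ 3 t)
      atTop (𝓝 0) := by
    convert hdev using 3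
    all_goals first | rfl | simp [Minkowski.backgroundOn]
  refine conclusion_of_flatLateChart 𝒟 hpush hU' hsmooth hemb hsub ?_ hO hexh hR ?_
  · exact tendsto_of_tendsto_of_tendsto_of_le_of_le tendsto_const_nhds hdev' (fun _ ↦ zero_le)
      fun t ↦ Spacetime.deviationCk_mono _ _ _ (by norm_num) t
  · exact flat_isFutureOriented_of_labTime 𝒟 hU' hsmooth hdev'
      (fun x y hx hy hxy ↦ hT x y ⟨hx, fun i ↦ i.elim0⟩ ⟨hy, fun i ↦ i.elim0⟩ hxy)

end CaseN0

/-! ## §C Load-bearing analysis: the field equations, not the kinematics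

The KINEMATIC SHADOW keeps, for one centre along one axis, every clause of the antecedent that speaks
about the moduli (`ContDiff ℝ ∞ ξ`, cone `|ξ t| ≤ κ² t` eventually, `0 < κ < 1`, speed `≤ κ² < 1` —
bounded Lorentz factor) and ADDS the decay of the second and third derivatives (what `C³`-convergence
of the modulated ansatz to an inertial truth would give); the FROZEN SHADOW is the weakest consequence
of the conclusion for that centre (a `FinalStateDecomposition` has constant motions `(Λᵢ, cᵢ)` and
truncated `C²` convergence in free charts, which forces the lab velocity to converge). -/

section Kinematic


/-- Slow phase `u(t) = log(1 + t²)/2 ∼ log t`. -/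
def phase (t : ℝ) : ℝ := Real.log (1 + t ^ 2) / 2

/-- Velocity profile `v = cos ∘ u`: bounded by `1`, equal to `1` and to `-1` at arbitrarily late
times, with derivative `O(1/t)`. -/
def vel (t : ℝ) : ℝ := Real.cos (phase t)

/-- Acceleration profile `v' = -sin(u) u'`, `u' = t/(1+t²)`. -/
def acc (t : ℝ) : ℝ := -(Real.sin (phase t) * (t / (1 + t ^ 2)))

/-- Jerk profile `v''`. -/
def jerk (t : ℝ) : ℝ :=
  -(Real.cos (phase t) * (t / (1 + t ^ 2)) * (t / (1 + t ^ 2)) +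
    Real.sin (phase t) * ((1 - t ^ 2) / (1 + t ^ 2) ^ 2))

/-- The witness centre `ξ_c(t) = c ∫₀ᵗ cos(u(s)) ds`. -/
def centre (c : ℝ) (t : ℝ) : ℝ := c * ∫ s in (0 : ℝ)..t, vel s

lemma one_add_sq_pos (t : ℝ) : 0 < 1 + t ^ 2 := by positivity

lemma hasDerivAt_phase (t : ℝ) : HasDerivAt phase (t / (1 + t ^ 2)) t := by
  have h1 : HasDerivAt (fun t : ℝ ↦ 1 + t ^ 2) (2 * t) t := by
    simpa using ((hasDerivAt_id' t).pow 2).const_add 1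
  exact ((h1.log (one_add_sq_pos t).ne').div_const 2).congr_deriv (by field_simp)

lemma hasDerivAt_w (t : ℝ) :
    HasDerivAt (fun t : ℝ ↦ t / (1 + t ^ 2)) ((1 - t ^ 2) / (1 + t ^ 2) ^ 2) t := by
  have h1 : HasDerivAt (fun t : ℝ ↦ 1 + t ^ 2) (2 * t) t := by
    simpa using ((hasDerivAt_id' t).pow 2).const_add 1
  exact ((hasDerivAt_id' t).div h1 (one_add_sq_pos t).ne').congr_deriv (by field_simp; ring)

lemma contDiff_phase : ContDiff ℝ ((⊤ : ℕ∞) : WithTop ℕ∞) phase :=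
  ((contDiff_const.add (contDiff_id.pow 2)).log fun t ↦ (one_add_sq_pos t).ne').div_const 2

lemma contDiff_vel : ContDiff ℝ ((⊤ : ℕ∞) : WithTop ℕ∞) vel :=
  Real.contDiff_cos.comp contDiff_phase

lemma continuous_vel : Continuous vel := contDiff_vel.continuous

lemma hasDerivAt_vel (t : ℝ) : HasDerivAt vel (acc t) t :=
  (hasDerivAt_phase t).cos.congr_deriv (neg_mul _ _)

lemma hasDerivAt_acc (t : ℝ) : HasDerivAt acc (jerk t) t := by
  have hs : HasDerivAt (fun t ↦ Real.sin (phase t)) (Real.cos (phase t) * (t / (1 + t ^ 2))) t :=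
    (hasDerivAt_phase t).sin
  exact (hs.mul (hasDerivAt_w t)).neg

lemma hasDerivAt_centre (c t : ℝ) : HasDerivAt (centre c) (c * vel t) t :=
  ((continuous_vel.integral_hasStrictDerivAt 0 t).hasDerivAt).const_mul c

lemma deriv_centre (c : ℝ) : deriv (centre c) = fun t ↦ c * vel t :=
  funext fun t ↦ (hasDerivAt_centre c t).deriv

lemma deriv2_centre (c : ℝ) : deriv^[2] (centre c) = fun t ↦ c * acc t := by
  show deriv (deriv (centre c)) = _
  rw [deriv_centre]
  exact funext fun t ↦ ((hasDerivAt_vel t).const_mul c).deriv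

lemma deriv3_centre (c : ℝ) : deriv^[3] (centre c) = fun t ↦ c * jerk t := by
  show deriv (deriv^[2] (centre c)) = _
  rw [deriv2_centre]
  exact funext fun t ↦ ((hasDerivAt_acc t).const_mul c).deriv

lemma contDiff_centre (c : ℝ) : ContDiff ℝ ((⊤ : ℕ∞) : WithTop ℕ∞) (centre c) := by
  rw [contDiff_infty_iff_deriv, deriv_centre]
  exact ⟨fun t ↦ (hasDerivAt_centre c t).differentiableAt, contDiff_const.mul contDiff_vel⟩

lemma abs_vel_le (t : ℝ) : |vel t| ≤ 1 := Real.abs_cos_le_one _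

lemma abs_centre_le (c t : ℝ) : |centre c t| ≤ |c| * |t| := by
  unfold centre
  rw [abs_mul]
  refine mul_le_mul_of_nonneg_left ?_ (abs_nonneg c)
  have h := norm_integral_le_of_norm_le_const (a := 0) (b := t) (C := 1) (f := vel)
    fun x _ ↦ by simpa using abs_vel_le x
  simpa using h

lemma w_le_inv {t : ℝ} (ht : 0 < t) : t / (1 + t ^ 2) ≤ t⁻¹ := by
  rw [div_le_iff₀ (one_add_sq_pos t)]
  have : t⁻¹ * (1 + t ^ 2) = t⁻¹ + t := by field_simp
  rw [this]
  linarith [inv_pos.mpr ht]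

lemma w_nonneg {t : ℝ} (ht : 0 < t) : 0 ≤ t / (1 + t ^ 2) := by positivity

lemma w_le_one (t : ℝ) : t / (1 + t ^ 2) ≤ 1 := by
  rw [div_le_one (one_add_sq_pos t)]
  nlinarith [sq_nonneg (t - 1)]

lemma inv_one_add_sq_le {t : ℝ} (ht : 1 ≤ t) : (1 + t ^ 2)⁻¹ ≤ t⁻¹ := by
  rw [inv_le_inv₀ (one_add_sq_pos t) (by linarith)]
  nlinarith

lemma abs_acc_le {t : ℝ} (ht : 0 < t) : |acc t| ≤ t⁻¹ := by
  unfold acc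
  rw [abs_neg, abs_mul]
  calc |Real.sin (phase t)| * |t / (1 + t ^ 2)| ≤ 1 * t⁻¹ :=
        mul_le_mul (Real.abs_sin_le_one _) (by rw [abs_of_nonneg (w_nonneg ht)]; exact w_le_inv ht)
          (abs_nonneg _) zero_le_one
    _ = t⁻¹ := one_mul _

lemma abs_jerk_le {t : ℝ} (ht : 1 ≤ t) : |jerk t| ≤ 2 * t⁻¹ := by
  have ht0 : 0 < t := by linarith
  unfold jerk
  rw [abs_neg]
  refine (abs_add_le _ _).trans ?_
  have h1 : |Real.cos (phase t) * (t / (1 + t ^ 2)) * (t / (1 + t ^ 2))| ≤ t⁻¹ := by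
    rw [abs_mul, abs_mul, abs_of_nonneg (w_nonneg ht0)]
    calc |Real.cos (phase t)| * (t / (1 + t ^ 2)) * (t / (1 + t ^ 2))
        ≤ 1 * 1 * t⁻¹ := by
          refine mul_le_mul (mul_le_mul (Real.abs_cos_le_one _) (w_le_one t) (w_nonneg ht0)
            zero_le_one) (w_le_inv ht0) (w_nonneg ht0) (by positivity)
      _ = t⁻¹ := by ring
  have h2 : |Real.sin (phase t) * ((1 - t ^ 2) / (1 + t ^ 2) ^ 2)| ≤ t⁻¹ := by
    rw [abs_mul]
    have hq : |(1 - t ^ 2) / (1 + t ^ 2) ^ 2| ≤ (1 + t ^ 2)⁻¹ := by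
      rw [abs_div, abs_of_pos (by positivity : (0 : ℝ) < (1 + t ^ 2) ^ 2),
        div_le_iff₀ (by positivity)]
      have : (1 + t ^ 2)⁻¹ * (1 + t ^ 2) ^ 2 = 1 + t ^ 2 := by
        field_simp
      rw [this]
      exact (abs_sub _ _).trans (by rw [abs_one, abs_of_nonneg (sq_nonneg t)])
    calc |Real.sin (phase t)| * |(1 - t ^ 2) / (1 + t ^ 2) ^ 2| ≤ 1 * t⁻¹ :=
          mul_le_mul (Real.abs_sin_le_one _) (hq.trans (inv_one_add_sq_le ht)) (abs_nonneg _)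
            zero_le_one
      _ = t⁻¹ := one_mul _
  linarith

lemma tendsto_deriv2_centre (c : ℝ) : Tendsto (deriv^[2] (centre c)) atTop (𝓝 0) := by
  rw [deriv2_centre]
  refine squeeze_zero_norm' ?_ ((tendsto_inv_atTop_zero.const_mul |c|).trans_eq (by simp))
  filter_upwards [eventually_gt_atTop 0] with t ht
  rw [Real.norm_eq_abs, abs_mul]
  exact mul_le_mul_of_nonneg_left (abs_acc_le ht) (abs_nonneg c)

lemma tendsto_deriv3_centre (c : ℝ) : Tendsto (deriv^[3] (centre c)) atTop (𝓝 0) := by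
  rw [deriv3_centre]
  refine squeeze_zero_norm' ?_
    ((tendsto_inv_atTop_zero.const_mul (|c| * 2)).trans_eq (by simp))
  filter_upwards [eventually_ge_atTop 1] with t ht
  rw [Real.norm_eq_abs, abs_mul, mul_assoc]
  exact mul_le_mul_of_nonneg_left (abs_jerk_le ht) (abs_nonneg c)

lemma vel_eq_one (n : ℕ) : vel (Real.sqrt (Real.exp (n * (2 * Real.pi) * 2) - 1)) = 1 := by
  unfold vel phase
  rw [Real.sq_sqrt (sub_nonneg.mpr (Real.one_le_exp (by positivity))), add_sub_cancel,
    Real.log_exp, mul_div_cancel_right₀ _ two_ne_zero, Real.cos_nat_mul_two_pi]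

lemma vel_eq_neg_one (n : ℕ) :
    vel (Real.sqrt (Real.exp ((n * (2 * Real.pi) + Real.pi) * 2) - 1)) = -1 := by
  unfold vel phase
  rw [Real.sq_sqrt (sub_nonneg.mpr (Real.one_le_exp (by positivity))), add_sub_cancel,
    Real.log_exp, mul_div_cancel_right₀ _ two_ne_zero, Real.cos_nat_mul_two_pi_add_pi]

lemma le_sqrt_exp_sub_one {a x : ℝ} (hx : a ^ 2 + 1 ≤ x) : a ≤ Real.sqrt (Real.exp x - 1) := by
  rcases le_or_gt a 0 with ha | ha
  · exact ha.trans (Real.sqrt_nonneg _)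
  · rw [Real.le_sqrt' ha]
    linarith [Real.add_one_le_exp x]

lemma frequently_vel_eq_one : ∃ᶠ t in atTop, vel t = 1 := by
  rw [frequently_atTop]
  intro a
  obtain ⟨n, hn⟩ := exists_nat_ge (a ^ 2 + 1)
  refine ⟨_, le_sqrt_exp_sub_one ?_, vel_eq_one n⟩
  nlinarith [Real.pi_gt_three]

lemma frequently_vel_eq_neg_one : ∃ᶠ t in atTop, vel t = -1 := by
  rw [frequently_atTop]
  intro a
  obtain ⟨n, hn⟩ := exists_nat_ge (a ^ 2 + 1)
  refine ⟨_, le_sqrt_exp_sub_one ?_, vel_eq_neg_one n⟩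
  nlinarith [Real.pi_gt_three]

theorem not_tendsto_deriv_centre {c : ℝ} (hc : c ≠ 0) :
    ¬ ∃ v : ℝ, Tendsto (deriv (centre c)) atTop (𝓝 v) := by
  rintro ⟨v, hv⟩
  rw [deriv_centre] at hv
  have h1 : v = c * 1 := tendsto_nhds_unique_of_frequently_eq hv tendsto_const_nhds
    (frequently_vel_eq_one.mono fun t ht ↦ by rw [ht])
  have h2 : v = c * (-1) := tendsto_nhds_unique_of_frequently_eq hv tendsto_const_nhds
    (frequently_vel_eq_neg_one.mono fun t ht ↦ by rw [ht])
  exact hc (by linarith)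


/-- The KINEMATIC SHADOW of the crux's antecedent for one centre along one axis, strengthened by the
decay of the second and third derivatives. -/
def KinematicShadow (κ : ℝ) (ξ : ℝ → ℝ) : Prop :=
  ContDiff ℝ ((⊤ : ℕ∞) : WithTop ℕ∞) ξ ∧ 0 < κ ∧ κ < 1 ∧ (∀ᶠ t in atTop, |ξ t| ≤ κ ^ 2 * t) ∧
    (∀ t, |deriv ξ t| ≤ κ ^ 2) ∧ Tendsto (deriv^[2] ξ) atTop (𝓝 0) ∧
      Tendsto (deriv^[3] ξ) atTop (𝓝 0)

/-- The FROZEN SHADOW of the crux's conclusion for that centre: its lab velocity converges. -/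
def FrozenShadow (ξ : ℝ → ℝ) : Prop :=
  ∃ v : ℝ, Tendsto (deriv ξ) atTop (𝓝 v)

/-- `InertialRecession` with the field equations (MGHD, `Ric = 0`, hence any flux balance) DROPPED and
only the kinematics of the moduli kept. -/
def InertialRecessionWithoutFieldEquations : Prop :=
  ∀ (κ : ℝ) (ξ : ℝ → ℝ), KinematicShadow κ ξ → FrozenShadow ξ

/-- The witness satisfies the kinematic shadow with `κ = 1/2` (`c = κ² = 1/4`). [folklore] -/
theorem kinematicShadow_centre : KinematicShadow (1 / 2) (centre (1 / 4)) := by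
  refine ⟨contDiff_centre _, by norm_num, by norm_num, ?_, fun t ↦ ?_, tendsto_deriv2_centre _,
    tendsto_deriv3_centre _⟩
  · filter_upwards [eventually_ge_atTop 0] with t ht
    calc |centre (1 / 4) t| ≤ |(1 / 4 : ℝ)| * |t| := abs_centre_le _ _
      _ = (1 / 2) ^ 2 * t := by rw [abs_of_nonneg ht]; norm_num
  · rw [deriv_centre, abs_mul]
    calc |(1 / 4 : ℝ)| * |vel t| ≤ |(1 / 4 : ℝ)| * 1 :=
        mul_le_mul_of_nonneg_left (abs_vel_le t) (abs_nonneg _)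
      _ = (1 / 2) ^ 2 := by norm_num

/-- **Any proof of the crux must use the field equations**: the kinematic shadow does not freeze the
velocity (witness `centre (1/4)`, velocity `cos(log(1+t²)/2)/4`). [folklore] -/
theorem inertialRecession_false_without_fieldEquations : ¬ InertialRecessionWithoutFieldEquations :=
  fun h ↦ not_tendsto_deriv_centre (by norm_num : (1 / 4 : ℝ) ≠ 0) (h _ _ kinematicShadow_centre)

end Kinematic

/-! ## §D Tightness of the integrability threshold and the route's exponent bookkeeping -/

section Integrability

/-- THE FREEZING MECHANISM the route must realise (positive helper, last step of `EIHFluxLaw →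
FinalMotions`): a momentum `P` with `P' = F` on `[t₀, ∞)` and `F` INTEGRABLE there converges.
[folklore] -/
theorem tendsto_of_integrableOn_deriv {P F : ℝ → ℝ} {t₀ : ℝ}
    (hP : ∀ t, t₀ ≤ t → HasDerivAt P (F t) t) (hF : IntegrableOn F (Ioi t₀)) :
    Tendsto P atTop (𝓝 (P t₀ + ∫ t in Ioi t₀, F t)) := by
  have key : ∀ b, t₀ ≤ b → P b = P t₀ + ∫ t in t₀..b, F t := by
    intro b hb
    have hderiv : ∀ x ∈ uIcc t₀ b, HasDerivAt P (F x) x := fun x hx ↦ by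
      rw [uIcc_of_le hb] at hx
      exact hP x hx.1
    have hint : IntervalIntegrable F volume t₀ b :=
      intervalIntegrable_iff.mpr (hF.mono_set (by rw [uIoc_of_le hb]; exact Ioc_subset_Ioi_self))
    rw [integral_eq_sub_of_hasDerivAt hderiv hint]
    ring
  have h2 : Tendsto (fun b ↦ P t₀ + ∫ t in t₀..b, F t) atTop (𝓝 (P t₀ + ∫ t in Ioi t₀, F t)) :=
    (intervalIntegral_tendsto_integral_Ioi t₀ hF tendsto_id).const_add _
  refine h2.congr' ?_
  filter_upwards [eventually_ge_atTop t₀] with b hb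
  exact (key b hb).symm

/-- …whereas the §C witness is driven by a force of size `O(1/t)` — decaying but not integrable:
the second derivative of the witness centre is at most `|c|/t` for `t > 0`. [folklore] -/
theorem abs_deriv2_centre_le (c : ℝ) {t : ℝ} (ht : 0 < t) :
    |deriv^[2] (centre c) t| ≤ |c| * t⁻¹ := by
  rw [deriv2_centre, abs_mul]
  exact mul_le_mul_of_nonneg_left (abs_acc_le ht) (abs_nonneg c)

/-- `1/t` is not integrable at infinity (so §C and `tendsto_of_integrableOn_deriv` are consistent and
the threshold is sharp: decay of the force is not enough, integrability is). [folklore] -/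
theorem not_integrable_inv : ¬ IntegrableOn (fun t : ℝ ↦ t ^ (-1 : ℝ)) (Ioi 1) := fun h ↦ by
  have := (integrableOn_Ioi_rpow_iff zero_lt_one).mp h
  norm_num at this

/-- Route NUMBERS (linear remainder): weight `p = 7/4`, buffer radius `r_b = D^{9/10}`, parabolic
separation `D ∼ t^{2/3}` ⇒ the linear flux remainder `o(r_b^{-p})` decays like `t^{-21/20}`,
integrable. [folklore] -/
theorem linearRemainder_integrable :
    IntegrableOn (fun t : ℝ ↦ t ^ (-(9 / 10 * (7 / 4) * (2 / 3)) : ℝ)) (Ioi 1) :=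
  (integrableOn_Ioi_rpow_iff zero_lt_one).mpr (by norm_num)

/-- The item's WHY-MIGHT-FAIL as a lemma: the quadratic `(∂h)²` Landau–Lifshitz momentum flux through
a buffer sphere `r_b = D^b` is `O(ε² r_b^{-3/2}) = O(ε² t^{-(3/2)·b·(2/3)}) = O(ε² t^{-b})` at
parabolic separation; a buffer sphere sits between the holes, `b ≤ 1`, and `t^{-b}` is then NOT
integrable: with `ε(t) → 0` at no rate, NO buffer exponent closes the balance law in the parabolic
regime. [folklore] -/
theorem quadraticRemainder_not_integrable {b : ℝ} (hb : b ≤ 1) :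
    ¬ IntegrableOn (fun t : ℝ ↦ t ^ (-(3 / 2 * b * (2 / 3)) : ℝ)) (Ioi 1) := fun h ↦ by
  have := (integrableOn_Ioi_rpow_iff zero_lt_one).mp h
  nlinarith

/-- …and what repairs it: a RATE `ε(t) = O(t^{-δ})` makes the quadratic remainder `O(t^{-2δ-b})`,
integrable as soon as `b + 2δ > 1` — the quantitative content of "closing needs global Bondi-energy
bounds or perturbed final-motion asymptotics". [folklore] -/
theorem quadraticRemainder_integrable_of_rate {b δ : ℝ} (h : 1 < b + 2 * δ) :
    IntegrableOn (fun t : ℝ ↦ t ^ (-(2 * δ) - 3 / 2 * b * (2 / 3) : ℝ)) (Ioi 1) :=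
  (integrableOn_Ioi_rpow_iff zero_lt_one).mpr (by linarith)

/-- Route NUMBERS (weight window): with buffer exponent `b < 1`, integrability of the linear remainder
`b·p·(2/3) > 1` forces `p > 3/2`; and the missed 1PN cross term `4MᵢMⱼ/(rᵢrⱼ)` weighted by `d^p` on
`d ≤ D` is `D^{p-2}`, small iff `p < 2`. Both as real-arithmetic facts. [folklore] -/
theorem weight_window {p b : ℝ} (hb : b < 1) (hp : 0 ≤ p) (h : 1 < b * p * (2 / 3)) :
    3 / 2 < p ∧ (Tendsto (fun D : ℝ ↦ D ^ (p - 2)) atTop (𝓝 0) ↔ p < 2) := by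
  refine ⟨by nlinarith, ?_⟩
  constructor
  · intro hT
    by_contra hp2
    push Not at hp2
    have h1 : ∀ᶠ D : ℝ in atTop, 1 ≤ D ^ (p - 2) := by
      filter_upwards [eventually_ge_atTop 1] with D hD
      exact Real.one_le_rpow hD (by linarith)
    have h2 : ∀ᶠ D : ℝ in atTop, D ^ (p - 2) < 1 := hT.eventually (gt_mem_nhds zero_lt_one)
    obtain ⟨D, hD1, hD2⟩ := (h1.and h2).exists
    linarith
  · intro hp2
    have : Tendsto (fun D : ℝ ↦ D ^ (-(2 - p))) atTop (𝓝 0) :=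
      tendsto_rpow_neg_atTop (by linarith)
    refine this.congr' ?_
    filter_upwards with D
    ring_nf

end Integrability


/-! ## §F Mutation of the separation clause: `deviation → 0` already forces `D_ij → ∞`

Dropping "pairwise separating" (h₄) should change nothing: a superposition ansatz carries an
irreducible cross-term defect of relative size `O(M_j/D_ij)` in the near zone of hole `i`, which no
modulus (fixed `Mᵢ`, Lorentz `Λᵢ`, centre `ξᵢ`) and no asymptotically Minkowskian lab chart can absorb
(constant rescalings are not Lorentz), so `C⁰` deviation `→ 0` near the horizons forces
`M_j/D_ij → 0`. Checked here only in the simplest exact model — time-symmetric conformally flat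
two-centre (Brill–Lindquist) data `h = ψ⁴ δ`, `ψ = 1 + a + b`, `a = M₁/(2r₁)`, `b = M₂/(2r₂)`:
the superposition `1 + (ψ₁⁴ - 1) + (ψ₂⁴ - 1)` of the two single-hole metrics misses
`ψ⁴ - ψ₁⁴ - ψ₂⁴ + 1 ≥ 12ab`, i.e. `≳ M₂/D` at `r₁ ∼ M₁`. Information for provers/planner:
h₄ is probably derivable inside the crux; conversely the antecedent can only hold along `D_ij → ∞`. -/

section Separation

/-- Brill–Lindquist superposition defect, exact polynomial identity. [folklore] -/
theorem twoCentre_superposition_defect (a b : ℝ) :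
    (1 + a + b) ^ 4 - ((1 + a) ^ 4 + (1 + b) ^ 4 - 1) =
      a * b * (12 + 12 * a + 12 * b + 4 * a ^ 2 + 6 * a * b + 4 * b ^ 2) := by
  ring

/-- The defect is bounded below by `12ab > 0` for positive masses: at `r₁ ∼ M₁` (`a ∼ 1`) it is
`≳ M₂/D`, so it tends to `0` only if `D → ∞`. [folklore] -/
theorem twoCentre_superposition_defect_ge {a b : ℝ} (ha : 0 ≤ a) (hb : 0 ≤ b) :
    12 * a * b ≤ (1 + a + b) ^ 4 - ((1 + a) ^ 4 + (1 + b) ^ 4 - 1) := by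
  rw [twoCentre_superposition_defect]
  have h1 : 0 ≤ a * b := mul_nonneg ha hb
  nlinarith [mul_nonneg h1 ha, mul_nonneg h1 hb, mul_nonneg h1 (mul_nonneg ha ha),
    mul_nonneg h1 h1, mul_nonneg h1 (mul_nonneg hb hb)]

end Separation

/-! ## §G (cycle 2) The typed conclusion needs only CESÀRO velocities — and the kinematics do not
give even those

Correction of §C's framing: a `FinalStateDecomposition` with constant motions does NOT force the lab
velocity of a hole to converge — hole charts are arbitrary smooth open embeddings of the boosted-Kerr
late region and absorb any modulation with `|Λ̇ᵢ| → 0` at cost `O(|Λ̇ᵢ| R)` on near zones of size `R`;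
what IS forced (flat chart `C²`-close to `η` on whole slabs ⇒ one global inertial frame; sublinear tubes
`tendsto_excision_div` around STRAIGHT world-lines) is `ξᵢ(t)/t → Vᵢ` (card `cesaro-velocities-suffice`,
prover analysis on the item). The honest shadow of the conclusion is therefore `CesaroShadow`, weaker
than `FrozenShadow`; the §C witness kills it too. -/

section Cesaro

/-- CESÀRO SHADOW of the crux's conclusion for one centre: `ξ(t)/t` converges (the one asymptotic datum
per hole that the typed `FinalStateDecomposition` needs). -/
def CesaroShadow (ξ : ℝ → ℝ) : Prop :=
  ∃ V : ℝ, Tendsto (fun t ↦ ξ t / t) atTop (𝓝 V)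

/-- FROZEN ⇒ CESÀRO: if `ξ' → v` then `ξ(t)/t → v`. [folklore] -/
theorem tendsto_div_of_tendsto_deriv {ξ ξ' : ℝ → ℝ} {v : ℝ} (hξ : ∀ t, HasDerivAt ξ (ξ' t) t)
    (h : Tendsto ξ' atTop (𝓝 v)) : Tendsto (fun t ↦ ξ t / t) atTop (𝓝 v) := by
  rw [Metric.tendsto_atTop]
  intro ε hε
  have hε2 : 0 < ε / 2 := by positivity
  obtain ⟨T, hT⟩ := (Metric.tendsto_atTop.mp h) (ε / 2) hε2
  -- after `T` the velocity is within `ε/2` of `v`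
  set T' := max T 1 with hT'
  have hT'1 : 1 ≤ T' := le_max_right _ _
  have hT'T : T ≤ T' := le_max_left _ _
  -- the constant `C := |ξ T' - v T'|`
  set C := |ξ T' - v * T'| with hC
  obtain ⟨N, hN⟩ := exists_nat_gt (max T' (2 * C / ε))
  refine ⟨N, fun t ht ↦ ?_⟩
  have htT' : T' ≤ t := le_trans (le_max_left _ _) (le_of_lt (lt_of_lt_of_le hN ht))
  have ht0 : 0 < t := by linarith
  have htC : 2 * C / ε < t := lt_of_le_of_lt (le_max_right _ _) (lt_of_lt_of_le hN ht)
  -- mean value bound for `f s = ξ s - v s` on `[T', t]`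
  have hf : ∀ s ∈ Icc T' t, HasDerivWithinAt (fun s ↦ ξ s - v * s) (ξ' s - v) (Icc T' t) s :=
    fun s _ ↦ ((hξ s).sub ((hasDerivAt_id s).const_mul v)).hasDerivWithinAt.congr_deriv (by ring)
  have hbound : ∀ s ∈ Ico T' t, ‖ξ' s - v‖ ≤ ε / 2 := fun s hs ↦ by
    have := hT s (le_trans hT'T hs.1)
    rw [Real.dist_eq] at this
    exact (Real.norm_eq_abs _).le.trans this.le
  have hmv := norm_image_sub_le_of_norm_deriv_le_segment' hf hbound t (right_mem_Icc.mpr htT')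
  rw [Real.norm_eq_abs] at hmv
  rw [Real.dist_eq]
  have key : ξ t / t - v = ((ξ t - v * t) - (ξ T' - v * T')) / t + (ξ T' - v * T') / t := by
    field_simp
    ring
  rw [key]
  calc |((ξ t - v * t) - (ξ T' - v * T')) / t + (ξ T' - v * T') / t|
      ≤ |((ξ t - v * t) - (ξ T' - v * T')) / t| + |(ξ T' - v * T') / t| := abs_add_le _ _
    _ = |(ξ t - v * t) - (ξ T' - v * T')| / t + C / t := by
        rw [abs_div, abs_div, abs_of_pos ht0]
    _ ≤ (ε / 2 * (t - T')) / t + C / t := by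
        gcongr
    _ < ε / 2 + ε / 2 := by
        apply add_lt_add_of_le_of_lt
        · rw [div_le_iff₀ ht0]
          nlinarith
        · rw [div_lt_iff₀ ht0]
          rw [div_lt_iff₀ hε] at htC
          linarith
    _ = ε := by ring


/-- Frozen ⇒ Cesàro for differentiable centres: `CesaroShadow` is the weaker shadow. [folklore] -/
theorem frozenShadow_imp_cesaroShadow {ξ : ℝ → ℝ} (hξ : Differentiable ℝ ξ) :
    FrozenShadow ξ → CesaroShadow ξ := fun ⟨v, hv⟩ ↦
  ⟨v, tendsto_div_of_tendsto_deriv (fun t ↦ (hξ t).hasDerivAt) hv⟩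

/-- The exact antiderivative of `cos ∘ log` on `(0, ∞)`: `t (cos (log t) + sin (log t)) / 2`. [folklore] -/
def cesaroModel (t : ℝ) : ℝ := t * (Real.cos (Real.log t) + Real.sin (Real.log t)) / 2

/-- `cesaroModel' = cos ∘ log` on `(0, ∞)`. [folklore] -/
lemma hasDerivAt_cesaroModel {t : ℝ} (ht : 0 < t) :
    HasDerivAt cesaroModel (Real.cos (Real.log t)) t := by
  have hl : HasDerivAt Real.log t⁻¹ t := Real.hasDerivAt_log ht.ne'
  have h1 : HasDerivAt (fun t ↦ Real.cos (Real.log t) + Real.sin (Real.log t))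
      (-Real.sin (Real.log t) * t⁻¹ + Real.cos (Real.log t) * t⁻¹) t := hl.cos.add hl.sin
  have h2 := ((hasDerivAt_id t).mul h1).div_const 2
  refine h2.congr_deriv ?_
  simp only [id]
  field_simp
  ring

/-- `|cos (log (1 + t²) / 2) - cos (log t)| ≤ t⁻² / 2` for `t ≥ 1`. [folklore] -/
lemma abs_vel_sub_cos_log_le {t : ℝ} (ht : 1 ≤ t) :
    |vel t - Real.cos (Real.log t)| ≤ t⁻¹ ^ 2 / 2 := by
  have ht0 : 0 < t := by linarith
  unfold vel phase
  refine (Real.abs_cos_sub_cos_le _ _).trans ?_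
  have hlog : Real.log (1 + t ^ 2) / 2 - Real.log t = Real.log (1 + t⁻¹ ^ 2) / 2 := by
    have h1 : (1 + t ^ 2) = t ^ 2 * (1 + t⁻¹ ^ 2) := by field_simp; ring
    rw [h1, Real.log_mul (by positivity) (by positivity), Real.log_pow]
    push_cast
    ring
  rw [hlog]
  have hpos : 0 < 1 + t⁻¹ ^ 2 := by positivity
  have hle : Real.log (1 + t⁻¹ ^ 2) ≤ t⁻¹ ^ 2 := by
    have := Real.log_le_sub_one_of_pos hpos
    linarith
  have hge : 0 ≤ Real.log (1 + t⁻¹ ^ 2) := Real.log_nonneg (by nlinarith [sq_nonneg t⁻¹])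
  rw [abs_of_nonneg (by linarith)]
  linarith

/-- The remainder `H t = ∫₀ᵗ vel - cesaroModel t` stays within `1/2` of `H 1` on `[1, ∞)`. [folklore] -/
lemma abs_centre_one_sub_cesaroModel_sub_le {t : ℝ} (ht : 1 ≤ t) :
    |(centre 1 t - cesaroModel t) - (centre 1 1 - cesaroModel 1)| ≤ 1 / 2 := by
  -- `K s = H s + s⁻¹/2` is antitone and `L s = H s - s⁻¹/2` is monotone on `[1, ∞)`
  have hH : ∀ s, 0 < s → HasDerivAt (fun s ↦ centre 1 s - cesaroModel s)
      (vel s - Real.cos (Real.log s)) s := fun s hs ↦ by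
    exact ((hasDerivAt_centre 1 s).sub (hasDerivAt_cesaroModel hs)).congr_deriv (by rw [one_mul])
  have hinv : ∀ s, 0 < s → HasDerivAt (fun s : ℝ ↦ s⁻¹ / 2) (-(s ^ 2)⁻¹ / 2) s := fun s hs ↦ by
    simpa using (hasDerivAt_inv hs.ne').div_const 2
  have hcont : ∀ {f f' : ℝ → ℝ}, (∀ s, 0 < s → HasDerivAt f (f' s) s) → ContinuousOn f (Ici 1) :=
    fun h ↦ fun s hs ↦ (h s (by simpa using lt_of_lt_of_le one_pos hs)).continuousAt.continuousWithinAt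
  have hK : AntitoneOn (fun s ↦ (centre 1 s - cesaroModel s) + s⁻¹ / 2) (Ici 1) := by
    refine antitoneOn_of_hasDerivWithinAt_nonpos (convex_Ici 1) (hcont fun s hs ↦ (hH s hs).add
      (hinv s hs)) (fun s hs ↦ ((hH s ?_).add (hinv s ?_)).hasDerivWithinAt) fun s hs ↦ ?_
    · simpa using lt_trans one_pos (by simpa using hs)
    · simpa using lt_trans one_pos (by simpa using hs)
    · rw [interior_Ici] at hs
      have hs1 : 1 ≤ s := le_of_lt hs
      have := abs_vel_sub_cos_log_le hs1
      have h' : (s ^ 2)⁻¹ = s⁻¹ ^ 2 := by rw [inv_pow]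
      rw [h']
      linarith [le_abs_self (vel s - Real.cos (Real.log s))]
  have hL : MonotoneOn (fun s ↦ (centre 1 s - cesaroModel s) - s⁻¹ / 2) (Ici 1) := by
    refine monotoneOn_of_hasDerivWithinAt_nonneg (convex_Ici 1) (hcont fun s hs ↦ (hH s hs).sub
      (hinv s hs)) (fun s hs ↦ ((hH s ?_).sub (hinv s ?_)).hasDerivWithinAt) fun s hs ↦ ?_
    · simpa using lt_trans one_pos (by simpa using hs)
    · simpa using lt_trans one_pos (by simpa using hs)
    · rw [interior_Ici] at hs
      have hs1 : 1 ≤ s := le_of_lt hs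
      have := abs_vel_sub_cos_log_le hs1
      have h' : (s ^ 2)⁻¹ = s⁻¹ ^ 2 := by rw [inv_pow]
      rw [h']
      linarith [neg_abs_le (vel s - Real.cos (Real.log s))]
  have h1 := hK (self_mem_Ici) (ht) ht
  have h2 := hL (self_mem_Ici) (ht) ht
  simp only [inv_one] at h1 h2
  have hti : 0 ≤ t⁻¹ := inv_nonneg.mpr (by linarith)
  have hti' : t⁻¹ ≤ 1 := inv_le_one_of_one_le₀ ht
  rw [abs_le]
  constructor <;> linarith

/-- The Cesàro mean of the witness: `(∫₀ᵗ vel) / t - (cos (log t) + sin (log t)) / 2 → 0`. [folklore] -/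
theorem tendsto_centre_one_div_sub :
    Tendsto (fun t ↦ centre 1 t / t - (Real.cos (Real.log t) + Real.sin (Real.log t)) / 2)
      atTop (𝓝 0) := by
  set C := |centre 1 1 - cesaroModel 1| + 1 / 2 with hC
  refine squeeze_zero_norm' ?_ ((tendsto_inv_atTop_zero.const_mul C).trans_eq (by simp))
  filter_upwards [eventually_ge_atTop 1] with t ht
  have ht0 : 0 < t := by linarith
  have key : centre 1 t / t - (Real.cos (Real.log t) + Real.sin (Real.log t)) / 2 =
      (centre 1 t - cesaroModel t) / t := by
    unfold cesaroModel
    field_simp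
  rw [key, Real.norm_eq_abs, abs_div, abs_of_pos ht0, div_eq_mul_inv]
  refine mul_le_mul_of_nonneg_right ?_ (inv_nonneg.mpr ht0.le)
  have := abs_centre_one_sub_cesaroModel_sub_le ht
  have htri := abs_sub_abs_le_abs_sub (centre 1 t - cesaroModel t) (centre 1 1 - cesaroModel 1)
  linarith

/-- `cos (log t) + sin (log t) = 1` at `t = exp (2πn)`, arbitrarily late. [folklore] -/
lemma frequently_cos_log_add_sin_log_eq_one :
    ∃ᶠ t in atTop, Real.cos (Real.log t) + Real.sin (Real.log t) = 1 := by
  rw [frequently_atTop]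
  intro a
  obtain ⟨n, hn⟩ := exists_nat_ge a
  refine ⟨Real.exp (n * (2 * Real.pi)), ?_, ?_⟩
  · refine hn.trans ((le_trans ?_ (Real.add_one_le_exp _)))
    nlinarith [Real.pi_gt_three, (Nat.cast_nonneg n : (0 : ℝ) ≤ n), sq_nonneg (n : ℝ)]
  · rw [Real.log_exp, Real.cos_nat_mul_two_pi, Real.sin_periodic.nat_mul_eq, Real.sin_zero]
    ring

/-- `cos (log t) + sin (log t) = -1` at `t = exp (2πn + π)`, arbitrarily late. [folklore] -/
lemma frequently_cos_log_add_sin_log_eq_neg_one :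
    ∃ᶠ t in atTop, Real.cos (Real.log t) + Real.sin (Real.log t) = -1 := by
  rw [frequently_atTop]
  intro a
  obtain ⟨n, hn⟩ := exists_nat_ge a
  refine ⟨Real.exp (n * (2 * Real.pi) + Real.pi), ?_, ?_⟩
  · refine hn.trans ((le_trans ?_ (Real.add_one_le_exp _)))
    nlinarith [Real.pi_gt_three, (Nat.cast_nonneg n : (0 : ℝ) ≤ n), sq_nonneg (n : ℝ)]
  · rw [Real.log_exp, Real.cos_nat_mul_two_pi_add_pi, Real.sin_add_pi,
      Real.sin_periodic.nat_mul_eq, Real.sin_zero]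
    ring

/-- **The witness has no Cesàro velocity**: `centre c t / t` does not converge (`c ≠ 0`). [folklore] -/
theorem not_tendsto_centre_div {c : ℝ} (hc : c ≠ 0) :
    ¬ ∃ V : ℝ, Tendsto (fun t ↦ centre c t / t) atTop (𝓝 V) := by
  rintro ⟨V, hV⟩
  have hc1 : ∀ t, centre c t = c * centre 1 t := fun t ↦ by simp [centre]
  have h1 : Tendsto (fun t ↦ centre 1 t / t) atTop (𝓝 (V / c)) := by
    have := hV.div_const c
    refine this.congr' (Eventually.of_forall fun t ↦ ?_)
    rw [hc1]
    field_simp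
  -- `Q t := centre 1 t / t - (centre 1 t / t - trig) = trig → V/c`, but `Q` is frequently `± 1/2`
  have hQ : Tendsto (fun t ↦ centre 1 t / t -
      (centre 1 t / t - (Real.cos (Real.log t) + Real.sin (Real.log t)) / 2)) atTop
      (𝓝 (V / c - 0)) := h1.sub tendsto_centre_one_div_sub
  have hQ' : Tendsto (fun t ↦ (Real.cos (Real.log t) + Real.sin (Real.log t)) / 2) atTop
      (𝓝 (V / c)) := by
    rw [sub_zero] at hQ
    exact hQ.congr' (Eventually.of_forall fun t ↦ by ring)
  have e1 : V / c = 1 / 2 := tendsto_nhds_unique_of_frequently_eq hQ' tendsto_const_nhds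
    (frequently_cos_log_add_sin_log_eq_one.mono fun t ht ↦ by rw [ht])
  have e2 : V / c = -1 / 2 := tendsto_nhds_unique_of_frequently_eq hQ' tendsto_const_nhds
    (frequently_cos_log_add_sin_log_eq_neg_one.mono fun t ht ↦ by rw [ht])
  linarith

/-- `InertialRecession` with the field equations DROPPED, kinematics kept, conclusion weakened to its
CESÀRO shadow. Refuted below; since frozen ⇒ Cesàro this strengthens §C. -/
def InertialRecessionWithoutFieldEquationsCesaro : Prop :=
  ∀ (κ : ℝ) (ξ : ℝ → ℝ), KinematicShadow κ ξ → CesaroShadow ξ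

/-- The Cesàro-shadow statement is implied by the frozen-shadow statement of §C. [folklore] -/
theorem withoutFieldEquationsCesaro_of (h : InertialRecessionWithoutFieldEquations) :
    InertialRecessionWithoutFieldEquationsCesaro := fun κ ξ hk ↦
  frozenShadow_imp_cesaroShadow (hk.1.differentiable (by simp)) (h κ ξ hk)

/-- **The kinematic shadow does not even give Cesàro velocities** (witness `centre (1/4)`: Cesàro mean
`(cos (log t) + sin (log t))/8 + o(1)`, frequently `1/8 + o(1)` and `-1/8 + o(1)`). The transfer target
"Cesàro velocities" of the crux chain is genuinely dynamical. [folklore] -/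
theorem inertialRecession_false_without_fieldEquations_cesaro :
    ¬ InertialRecessionWithoutFieldEquationsCesaro := fun h ↦
  not_tendsto_centre_div (by norm_num : (1 / 4 : ℝ) ≠ 0) (h _ _ kinematicShadow_centre)

/-- Sanity: §G recovers §C. -/
example : ¬ InertialRecessionWithoutFieldEquations :=
  fun h ↦ inertialRecession_false_without_fieldEquations_cesaro (withoutFieldEquationsCesaro_of h)

end Cesaro

/-! ## §H (cycle 2) Cesàro velocities from RATE-FREE balance at CLEAN scales: the toy mechanism
(`p > 1`) and its sharpness (`p = 1`)

What the typed antecedent offers, through the cone weight `(1 + d^{7/4})` on `|∂^m h|` inside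
`|x̲| ≤ κ t` (`d` = distance to the nearest centre), is a momentum balance on every CLEAN sphere (one at
distance `≍ d` from all centres): flux `O((ε d^{-7/4})² · d²) = O(ε² d^{-3/2})`. Between two holes (or two
clusters) this is a relative force law of size `K d^{-p}`, `p = 3/2`, with NO sign, NO potential and NO
rate — `ε → 0` arbitrarily slowly, so only `K := sup ε²` may be used, and `K d(t)^{-p}` need not be
integrable in `t` (`d → ∞` at no rate either). The toy question "does relative position `/ t` still
converge?" is answered YES for `p > 1` by the crossing lemma and NO at `p = 1`; cone weight `w` gives
`p = 2w - 2`, so the typed `7/4 > 3/2` is exactly what keeps the toy alive. Two-body use: apply the scalar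
theorem to each coordinate `wₖ` of `ξ₁ - ξ₂` (`|wₖ''| ≤ ‖w''‖ ≤ K‖w‖^{-p} ≤ K|wₖ|^{-p}`), and get the
centre of energy from total-momentum convergence at scale `t` (fluxes `ε² t^{-3/2}`, integrable without a
rate); `N ≥ 3` needs the cluster induction of `regimes_note`. -/

section CleanScale

/-! ### One-sided derivative signs at first hitting times -/

/-- If `h < 0` on `[a, b)` and `h b ≥ 0` then `h' b ≥ 0`. [folklore] -/
lemma deriv_nonneg_of_neg_on_Ico {h : ℝ → ℝ} {h' a b : ℝ} (hab : a < b) (hd : HasDerivAt h h' b)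
    (hneg : ∀ t ∈ Ico a b, h t < 0) (hb : 0 ≤ h b) : 0 ≤ h' := by
  have ht : Tendsto (slope h b) (𝓝[<] b) (𝓝 h') :=
    (hasDerivAt_iff_tendsto_slope.mp hd).mono_left (nhdsLT_le_nhdsNE b)
  refine ge_of_tendsto ht ?_
  filter_upwards [Ico_mem_nhdsLT hab] with t ht
  rw [slope_def_field]
  have h1 : h t - h b < 0 := by linarith [hneg t ht]
  have h2 : t - b < 0 := by linarith [ht.2]
  exact (div_pos_of_neg_of_neg h1 h2).le

/-- If `0 < h` on `[a, b)` and `h b ≤ 0` then `h' b ≤ 0`. [folklore] -/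
lemma deriv_nonpos_of_pos_on_Ico {h : ℝ → ℝ} {h' a b : ℝ} (hab : a < b) (hd : HasDerivAt h h' b)
    (hpos : ∀ t ∈ Ico a b, 0 < h t) (hb : h b ≤ 0) : h' ≤ 0 := by
  have := deriv_nonneg_of_neg_on_Ico hab hd.neg (fun t ht ↦ by simpa using hpos t ht)
    (by simpa using hb)
  linarith

/-- First hitting time of a closed condition on `[a, b]`: if `P` fails at `a` and holds at `b`, there is
a first `c ∈ (a, b]` where it holds. [folklore] -/
lemma exists_first_hit {P : ℝ → Prop} {a b : ℝ} (hab : a ≤ b)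
    (hP : IsClosed {t | t ∈ Icc a b ∧ P t}) (ha : ¬ P a) (hb : P b) :
    ∃ c, a < c ∧ c ≤ b ∧ P c ∧ ∀ t ∈ Ico a c, ¬ P t := by
  set A := {t | t ∈ Icc a b ∧ P t} with hA
  have hne : A.Nonempty := ⟨b, ⟨⟨hab, le_rfl⟩, hb⟩⟩
  have hbdd : BddBelow A := ⟨a, fun t ht ↦ ht.1.1⟩
  have hmem : sInf A ∈ A := hP.csInf_mem hne hbdd
  refine ⟨sInf A, ?_, hmem.1.2, hmem.2, fun t ht hPt ↦ ?_⟩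
  · rcases eq_or_lt_of_le hmem.1.1 with h | h
    · exact absurd (h ▸ hmem.2) ha
    · exact h
  · have : sInf A ≤ t := csInf_le hbdd ⟨⟨ht.1, ht.2.le.trans hmem.1.2⟩, hPt⟩
    linarith [ht.2]

/-! ### The crossing lemma and Cesàro convergence for `p > 1` -/

/-- **Crossing lemma.** On `[t₀, ∞)` let `s` be twice differentiable with `|s''| ≤ K t^{-p}`
(`p > 1`) WHEREVER `s ≥ α t` (`α > 0`). Then `s(t)/t` cannot be frequently below `α` and frequently
above `β > α`: between a first up-crossing of `β t` (where `s' ≥ β`) and the next down-crossing of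
`α t` (where `s' ≤ α`) the trajectory stays in the controlled region, in which `s' - (K/(p-1)) t^{1-p}`
is monotone, so the velocity drops by at most `(K/(p-1)) t^{1-p} → 0`. [folklore] -/
theorem no_crossing_of_abs_deriv2_le {s s' s'' : ℝ → ℝ} {t₀ α β K p : ℝ} (ht₀ : 0 < t₀)
    (hαβ : α < β) (hp : 1 < p) (hK : 0 ≤ K)
    (hs : ∀ t, t₀ ≤ t → HasDerivAt s (s' t) t) (hs' : ∀ t, t₀ ≤ t → HasDerivAt s' (s'' t) t)
    (hbound : ∀ t, t₀ ≤ t → α * t ≤ s t → |s'' t| ≤ K * t ^ (-p))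
    (hlo : ∃ᶠ t in atTop, s t < α * t) (hhi : ∃ᶠ t in atTop, β * t < s t) : False := by
  set c := K / (p - 1) with hc
  have hc0 : 0 ≤ c := div_nonneg hK (by linarith)
  -- late enough that the velocity drop `c t^{1-p}` is below `β - α`
  have hev : ∀ᶠ t in atTop, t₀ ≤ t ∧ c * t ^ (1 - p) < β - α := by
    refine (eventually_ge_atTop t₀).and ?_
    have h1 : Tendsto (fun t : ℝ ↦ c * t ^ (1 - p)) atTop (𝓝 (c * 0)) :=
      (tendsto_rpow_neg_atTop (by linarith : 0 < p - 1)).const_mul c |>.congr'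
        (by filter_upwards with t; congr 1; ring_nf)
    rw [mul_zero] at h1
    exact h1.eventually (gt_mem_nhds (by linarith))
  obtain ⟨ta, hsa, hta0, hta⟩ := (hlo.and_eventually hev).exists
  obtain ⟨tb, hsb, htab⟩ := (hhi.and_eventually (eventually_gt_atTop ta)).exists
  obtain ⟨td, hsd, htbd⟩ := (hlo.and_eventually (eventually_gt_atTop tb)).exists
  have hta_pos : 0 < ta := lt_of_lt_of_le ht₀ hta0
  -- continuity of `s` and `s'` after `t₀`
  have hscont : ∀ a b, t₀ ≤ a → ContinuousOn s (Icc a b) := fun a b ha t ht ↦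
    (hs t (ha.trans ht.1)).continuousAt.continuousWithinAt
  have hclosed : ∀ (a b μ : ℝ) (σ : ℝ), t₀ ≤ a →
      IsClosed {t | t ∈ Icc a b ∧ σ * (s t - μ * t) ≤ 0} := fun a b μ σ ha ↦ by
    have hcts : ContinuousOn (fun t ↦ σ * (s t - μ * t)) (Icc a b) :=
      continuousOn_const.mul ((hscont a b ha).sub (continuousOn_const.mul continuousOn_id))
    have := hcts.preimage_isClosed_of_isClosed isClosed_Icc (isClosed_Iic (a := (0 : ℝ)))
    convert this using 1
    ext t
    simp
  -- first up-crossing `tu ∈ (ta, tb]` of the level `β t`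
  obtain ⟨tu, htau, htub, hsu, hbefore_u⟩ := exists_first_hit (P := fun t ↦ (-1) * (s t - β * t) ≤ 0)
    htab.le (hclosed ta tb β (-1) hta0) (by nlinarith) (by nlinarith)
  have hsu' : β * tu ≤ s tu := by nlinarith
  have htu0 : t₀ ≤ tu := hta0.trans htau.le
  have htu_pos : 0 < tu := lt_of_lt_of_le hta_pos htau.le
  -- first down-crossing `tc ∈ (tu, td]` of the level `α t`
  have htud : tu < td := lt_of_le_of_lt htub htbd
  obtain ⟨tc, htuc, htcd, hsc, hbefore_c⟩ := exists_first_hit (P := fun t ↦ (1 : ℝ) * (s t - α * t) ≤ 0)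
    htud.le (hclosed tu td α 1 htu0) (by nlinarith) (by nlinarith)
  have hsc' : s tc ≤ α * tc := by nlinarith
  have htc0 : t₀ ≤ tc := htu0.trans htuc.le
  -- derivative signs at the two hitting times
  have hderiv_u : β ≤ s' tu := by
    have hd : HasDerivAt (fun t ↦ s t - β * t) (s' tu - β * 1) tu :=
      (hs tu htu0).sub ((hasDerivAt_id tu).const_mul β)
    have := deriv_nonneg_of_neg_on_Ico htau hd
      (fun t ht ↦ by have := hbefore_u t ht; push Not at this; nlinarith) (by nlinarith)
    linarith
  have hderiv_c : s' tc ≤ α := by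
    have hd : HasDerivAt (fun t ↦ s t - α * t) (s' tc - α * 1) tc :=
      (hs tc htc0).sub ((hasDerivAt_id tc).const_mul α)
    have := deriv_nonpos_of_pos_on_Ico htuc hd
      (fun t ht ↦ by have := hbefore_c t ht; push Not at this; nlinarith) (by linarith)
    linarith
  -- on `(tu, tc)` the trajectory is in the controlled region `s > α t`
  have hregion : ∀ t ∈ Ioo tu tc, α * t < s t := fun t ht ↦ by
    have := hbefore_c t ⟨ht.1.le, ht.2⟩; push Not at this; nlinarith
  -- `Ψ t := s' t - c t^{1-p}` is monotone on `[tu, tc]`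
  have hΓ : ∀ t, 0 < t → HasDerivAt (fun t : ℝ ↦ c * t ^ (1 - p)) (-(K * t ^ (-p))) t := by
    intro t ht
    have h1 := (Real.hasDerivAt_rpow_const (p := 1 - p) (Or.inl ht.ne')).const_mul c
    refine h1.congr_deriv ?_
    rw [show (1 - p - 1 : ℝ) = -p by ring, hc]
    have hp1 : p - 1 ≠ 0 := by linarith
    field_simp
    ring
  have hmono : MonotoneOn (fun t ↦ s' t - c * t ^ (1 - p)) (Icc tu tc) := by
    refine monotoneOn_of_hasDerivWithinAt_nonneg (convex_Icc tu tc) ?_ ?_ ?_ (f' := fun t ↦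
      s'' t + K * t ^ (-p))
    · intro t ht
      exact ((hs' t (htu0.trans ht.1)).sub (hΓ t (lt_of_lt_of_le htu_pos ht.1))).continuousAt
        |>.continuousWithinAt
    · intro t ht
      rw [interior_Icc] at ht
      exact (((hs' t (htu0.trans ht.1.le)).sub (hΓ t (lt_trans htu_pos ht.1))).congr_deriv
        (by ring)).hasDerivWithinAt
    · intro t ht
      rw [interior_Icc] at ht
      have hb := hbound t (htu0.trans ht.1.le) (hregion t ht).le
      linarith [neg_abs_le (s'' t)]
  have hkey := hmono (left_mem_Icc.mpr htuc.le) (right_mem_Icc.mpr htuc.le) htuc.le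
  simp only at hkey
  -- `c tc^{1-p} ≥ 0` and `c tu^{1-p} ≤ c ta^{1-p} < β - α`
  have h1 : 0 ≤ c * tc ^ (1 - p) := mul_nonneg hc0 (Real.rpow_nonneg (by linarith) _)
  have h2 : c * tu ^ (1 - p) ≤ c * ta ^ (1 - p) :=
    mul_le_mul_of_nonneg_left (Real.rpow_le_rpow_of_nonpos hta_pos htau.le (by linarith)) hc0
  linarith


/-- **Cesàro convergence from a force bound at large separation only** (`p > 1`). If
`|s''| ≤ K |s|^{-p}` wherever `s ≠ 0` on `[t₀, ∞)` and `|s'| ≤ v`, then `s(t)/t` converges.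
(No integrability of `s''` along the trajectory is assumed or implied.) [folklore] -/
theorem tendsto_div_of_abs_deriv2_le_rpow {s s' s'' : ℝ → ℝ} {t₀ K p v : ℝ} (ht₀ : 0 < t₀)
    (hp : 1 < p) (hK : 0 ≤ K)
    (hs : ∀ t, t₀ ≤ t → HasDerivAt s (s' t) t) (hs' : ∀ t, t₀ ≤ t → HasDerivAt s' (s'' t) t)
    (hv : ∀ t, t₀ ≤ t → |s' t| ≤ v)
    (hbound : ∀ t, t₀ ≤ t → s t ≠ 0 → |s'' t| ≤ K * |s t| ^ (-p)) :
    ∃ L, Tendsto (fun t ↦ s t / t) atTop (𝓝 L) := by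
  -- Step 1: no band `[α, β]` with `0 < α` is crossed infinitely often by `σ s / t`, `σ = ± 1`
  have cross : ∀ σ : ℝ, (σ = 1 ∨ σ = -1) → ∀ α β : ℝ, 0 < α → α < β →
      (∃ᶠ t in atTop, σ * s t < α * t) → (∃ᶠ t in atTop, β * t < σ * s t) → False := by
    intro σ hσ α β hα hαβ hlo hhi
    have hσabs : |σ| = 1 := by rcases hσ with h | h <;> simp [h]
    refine no_crossing_of_abs_deriv2_le (s := fun t ↦ σ * s t) (s' := fun t ↦ σ * s' t)
      (s'' := fun t ↦ σ * s'' t) (K := K * α ^ (-p)) ht₀ hαβ hp (by positivity)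
      (fun t ht ↦ (hs t ht).const_mul σ) (fun t ht ↦ (hs' t ht).const_mul σ) ?_ hlo hhi
    intro t ht hst
    have ht' : 0 < t := lt_of_lt_of_le ht₀ ht
    have hpos : 0 < σ * s t := lt_of_lt_of_le (by positivity) hst
    have hne : s t ≠ 0 := by
      rintro h
      rw [h, mul_zero] at hpos
      exact lt_irrefl _ hpos
    have h1 := hbound t ht hne
    rw [abs_mul, hσabs, one_mul]
    have habs : |s t| = σ * s t := by
      rcases hσ with h | h
      · subst h
        rw [one_mul] at hpos ⊢
        exact abs_of_pos hpos
      · subst h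
        have : s t < 0 := by linarith
        rw [abs_of_neg this]
        ring
    rw [habs] at h1
    calc |s'' t| ≤ K * (σ * s t) ^ (-p) := h1
      _ ≤ K * (α * t) ^ (-p) := mul_le_mul_of_nonneg_left
          (Real.rpow_le_rpow_of_nonpos (by positivity) hst (by linarith)) hK
      _ = K * α ^ (-p) * t ^ (-p) := by rw [Real.mul_rpow hα.le ht'.le]; ring
  -- Step 2: `f t := s t / t` is bounded after `t₀`
  set f : ℝ → ℝ := fun t ↦ s t / t with hf
  set B := |s t₀| / t₀ + |v| with hB
  have hbd : ∀ t, t₀ ≤ t → |f t| ≤ B := by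
    intro t ht
    have ht' : 0 < t := lt_of_lt_of_le ht₀ ht
    have hmv : ‖s t - s t₀‖ ≤ |v| * (t - t₀) := by
      refine norm_image_sub_le_of_norm_deriv_le_segment' (f := s) (f' := s')
        (fun x hx ↦ (hs x hx.1).hasDerivWithinAt) (fun x hx ↦ ?_) t (right_mem_Icc.mpr ht)
      rw [Real.norm_eq_abs]
      exact (hv x hx.1).trans (le_abs_self v)
    rw [Real.norm_eq_abs] at hmv
    simp only [hf, hB]
    rw [abs_div, abs_of_pos ht', div_le_iff₀ ht']
    have h1 : |s t| ≤ |s t₀| + |v| * (t - t₀) := by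
      have := abs_sub_abs_le_abs_sub (s t) (s t₀)
      linarith
    have h2 : |s t₀| ≤ |s t₀| / t₀ * t := by
      rw [div_mul_eq_mul_div, le_div_iff₀ ht₀]
      exact mul_le_mul_of_nonneg_left ht (abs_nonneg _)
    nlinarith [abs_nonneg v, abs_nonneg (s t₀)]
  -- Step 3: a cluster point `c` of `f` (Bolzano–Weierstrass on `f (t₀ + n)`)
  obtain ⟨c, -, φ, hφ, hcφ⟩ := tendsto_subseq_of_bounded (Metric.isBounded_Icc (-B) B)
    (x := fun n : ℕ ↦ f (t₀ + n)) (fun n ↦ by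
      have := hbd (t₀ + n) (by simp)
      rw [abs_le] at this
      exact ⟨this.1, this.2⟩)
  have hseq : Tendsto (fun n : ℕ ↦ t₀ + (φ n : ℝ)) atTop atTop :=
    tendsto_atTop_add_const_left _ _ (tendsto_natCast_atTop_atTop.comp hφ.tendsto_atTop)
  have hcluster : ∀ δ > 0, ∃ᶠ t in atTop, |f t - c| < δ := fun δ hδ ↦ by
    have hev : ∀ᶠ n in atTop, |f (t₀ + φ n) - c| < δ := by
      have := (Metric.tendsto_nhds.mp hcφ) δ hδ
      simpa [Real.dist_eq, Function.comp] using this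
    exact hseq.frequently hev.frequently
  -- Step 4: if `f` does not tend to `c`, some band free of `0` is crossed infinitely often
  refine ⟨c, ?_⟩
  by_contra hnot
  obtain ⟨ε, hε, hfreq⟩ : ∃ ε > 0, ∃ᶠ t in atTop, ε ≤ |f t - c| := by
    rw [Metric.tendsto_nhds] at hnot
    push Not at hnot
    obtain ⟨ε, hε, h⟩ := hnot
    refine ⟨ε, hε, ?_⟩
    simpa [Filter.not_eventually, not_lt, Real.dist_eq] using h
  have hsplit : (∃ᶠ t in atTop, c + ε ≤ f t) ∨ ∃ᶠ t in atTop, f t ≤ c - ε := by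
    rw [← frequently_or_distrib]
    refine hfreq.mono fun t ht ↦ ?_
    rcases le_abs'.mp ht with h | h
    · right; linarith
    · left; linarith
  have hft : ∀ {t μ : ℝ}, 0 < t → (f t < μ ↔ s t < μ * t) := fun {t μ} ht ↦ by
    simp only [hf]
    rw [div_lt_iff₀ ht]
  have hft' : ∀ {t μ : ℝ}, 0 < t → (μ < f t ↔ μ * t < s t) := fun {t μ} ht ↦ by
    simp only [hf]
    rw [lt_div_iff₀ ht]
  rcases hsplit with hup | hdown
  · by_cases hc0 : 0 < c + ε / 2
    · -- positive band `(c + ε/2, c + 3ε/4)` for `s`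
      refine cross 1 (Or.inl rfl) (c + ε / 2) (c + 3 * ε / 4) hc0 (by linarith) ?_ ?_
      · refine ((hcluster (ε / 2) (by positivity)).and_eventually (eventually_gt_atTop 0)).mono ?_
        rintro t ⟨ht, ht0⟩
        have : s t < (c + ε / 2) * t := (hft ht0).mp (by have := (abs_lt.mp ht).2; linarith)
        linarith
      · refine (hup.and_eventually (eventually_gt_atTop 0)).mono ?_
        rintro t ⟨ht, ht0⟩
        have : (c + 3 * ε / 4) * t < s t := (hft' ht0).mp (by linarith)
        linarith
    · -- negative band for `-s`: levels `-(c + 3ε/8) < -(c + ε/4)`, both positive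
      push Not at hc0
      refine cross (-1) (Or.inr rfl) (-(c + 3 * ε / 8)) (-(c + ε / 4)) (by linarith) (by linarith)
        ?_ ?_
      · refine (hup.and_eventually (eventually_gt_atTop 0)).mono ?_
        rintro t ⟨ht, ht0⟩
        have : (c + 3 * ε / 8) * t < s t := (hft' ht0).mp (by linarith)
        linarith
      · refine ((hcluster (ε / 4) (by positivity)).and_eventually (eventually_gt_atTop 0)).mono ?_
        rintro t ⟨ht, ht0⟩
        have : s t < (c + ε / 4) * t := (hft ht0).mp (by have := (abs_lt.mp ht).2; linarith)
        linarith
  · by_cases hc0 : c - ε / 2 < 0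
    · -- positive band for `-s`: levels `-c + ε/2 < -c + 3ε/4`
      refine cross (-1) (Or.inr rfl) (-c + ε / 2) (-c + 3 * ε / 4) (by linarith) (by linarith)
        ?_ ?_
      · refine ((hcluster (ε / 2) (by positivity)).and_eventually (eventually_gt_atTop 0)).mono ?_
        rintro t ⟨ht, ht0⟩
        have : (c - ε / 2) * t < s t := (hft' ht0).mp (by have := (abs_lt.mp ht).1; linarith)
        linarith
      · refine (hdown.and_eventually (eventually_gt_atTop 0)).mono ?_
        rintro t ⟨ht, ht0⟩
        have : s t < (c - 3 * ε / 4) * t := (hft ht0).mp (by linarith)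
        linarith
    · -- positive band `(c - 3ε/8, c - ε/4)` for `s`
      push Not at hc0
      refine cross 1 (Or.inl rfl) (c - 3 * ε / 8) (c - ε / 4) (by linarith) (by linarith) ?_ ?_
      · refine (hdown.and_eventually (eventually_gt_atTop 0)).mono ?_
        rintro t ⟨ht, ht0⟩
        have : s t < (c - 3 * ε / 8) * t := (hft ht0).mp (by linarith)
        linarith
      · refine ((hcluster (ε / 4) (by positivity)).and_eventually (eventually_gt_atTop 0)).mono ?_
        rintro t ⟨ht, ht0⟩
        have : (c - ε / 4) * t < s t := (hft' ht0).mp (by have := (abs_lt.mp ht).1; linarith)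
        linarith

/-- In crux units: a cone weight `d^w` on `|∂h|` gives clean-sphere fluxes `ε² d^{2 - 2w}`, i.e. the
toy exponent `p = 2w - 2`; the mechanism above needs `p > 1`, i.e. exactly `w > 3/2` (the typed crux has
`w = 7/4`). [folklore] -/
theorem cesaro_exponent_window (w : ℝ) : 1 < 2 * w - 2 ↔ 3 / 2 < w := by
  constructor <;> intro h <;> linarith

end CleanScale

section Sharpness

/-! ### Sharpness: at `p = 1` the Cesàro mean may wander forever -/

/-- The `p = 1` witness `s t = t (2 + sin (log (log t)))`. [folklore] -/
def slowWitness (t : ℝ) : ℝ := t * (2 + Real.sin (Real.log (Real.log t)))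

/-- Its velocity `2 + sin u + cos u / log t`, `u = log (log t)`. [folklore] -/
def slowWitnessD1 (t : ℝ) : ℝ :=
  2 + Real.sin (Real.log (Real.log t)) + Real.cos (Real.log (Real.log t)) * (Real.log t)⁻¹

/-- Its acceleration `(cos u - sin u / log t - cos u / log t) / (t log t)`. [folklore] -/
def slowWitnessD2 (t : ℝ) : ℝ :=
  (Real.cos (Real.log (Real.log t)) - Real.sin (Real.log (Real.log t)) * (Real.log t)⁻¹ -
    Real.cos (Real.log (Real.log t)) * (Real.log t)⁻¹) * (t * Real.log t)⁻¹

/-- `(log ∘ log)' = 1 / (t log t)` for `t > 1`. [folklore] -/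
lemma hasDerivAt_loglog {t : ℝ} (ht : 1 < t) :
    HasDerivAt (fun t ↦ Real.log (Real.log t)) ((Real.log t)⁻¹ * t⁻¹) t := by
  have h1 : HasDerivAt Real.log t⁻¹ t := Real.hasDerivAt_log (by linarith)
  have hlog : Real.log t ≠ 0 := (Real.log_pos ht).ne'
  exact (Real.hasDerivAt_log hlog).comp t h1

/-- `slowWitness' = slowWitnessD1` on `(1, ∞)`. [folklore] -/
lemma hasDerivAt_slowWitness {t : ℝ} (ht : 1 < t) : HasDerivAt slowWitness (slowWitnessD1 t) t := by
  have hu := hasDerivAt_loglog ht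
  have h2 : HasDerivAt (fun t ↦ 2 + Real.sin (Real.log (Real.log t)))
      (Real.cos (Real.log (Real.log t)) * ((Real.log t)⁻¹ * t⁻¹)) t := by
    simpa using hu.sin.const_add 2
  have h3 := (hasDerivAt_id t).mul h2
  refine h3.congr_deriv ?_
  unfold slowWitnessD1
  simp only [id]
  have ht0 : t ≠ 0 := by linarith
  field_simp

/-- `slowWitnessD1' = slowWitnessD2` on `(1, ∞)`. [folklore] -/
lemma hasDerivAt_slowWitnessD1 {t : ℝ} (ht : 1 < t) :
    HasDerivAt slowWitnessD1 (slowWitnessD2 t) t := by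
  have hu := hasDerivAt_loglog ht
  have hlog : Real.log t ≠ 0 := (Real.log_pos ht).ne'
  have ht0 : t ≠ 0 := by linarith
  have hl : HasDerivAt Real.log t⁻¹ t := Real.hasDerivAt_log ht0
  have hlinv : HasDerivAt (fun t ↦ (Real.log t)⁻¹) (-(t⁻¹) / (Real.log t) ^ 2) t := hl.inv hlog
  have h : HasDerivAt slowWitnessD1 (Real.cos (Real.log (Real.log t)) * ((Real.log t)⁻¹ * t⁻¹) +
      (-Real.sin (Real.log (Real.log t)) * ((Real.log t)⁻¹ * t⁻¹) * (Real.log t)⁻¹ +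
        Real.cos (Real.log (Real.log t)) * (-(t⁻¹) / (Real.log t) ^ 2))) t := by
    unfold slowWitnessD1
    exact (hu.sin.const_add 2).add (hu.cos.mul hlinv)
  refine h.congr_deriv ?_
  unfold slowWitnessD2
  field_simp
  ring

/-- `log t ≥ 1` for `t ≥ 3` (`e < 3`). [folklore] -/
lemma one_le_log_of_three_le {t : ℝ} (ht : 3 ≤ t) : 1 ≤ Real.log t := by
  rw [Real.le_log_iff_exp_le (by linarith)]
  have := Real.exp_one_lt_d9
  linarith

/-- Bounded velocity: `|slowWitnessD1| ≤ 4` on `[3, ∞)`. [folklore] -/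
lemma abs_slowWitnessD1_le {t : ℝ} (ht : 3 ≤ t) : |slowWitnessD1 t| ≤ 4 := by
  have hl := one_le_log_of_three_le ht
  have hlinv : 0 ≤ (Real.log t)⁻¹ := inv_nonneg.mpr (by linarith)
  have hlinv1 : (Real.log t)⁻¹ ≤ 1 := inv_le_one_of_one_le₀ hl
  unfold slowWitnessD1
  have hs := Real.abs_sin_le_one (Real.log (Real.log t))
  have hc := Real.abs_cos_le_one (Real.log (Real.log t))
  rw [abs_le] at hs hc ⊢
  have : |Real.cos (Real.log (Real.log t)) * (Real.log t)⁻¹| ≤ 1 := by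
    rw [abs_mul, abs_of_nonneg hlinv]
    nlinarith [abs_nonneg (Real.cos (Real.log (Real.log t))), Real.abs_cos_le_one (Real.log (Real.log t))]
  rw [abs_le] at this
  constructor <;> linarith

/-- `slowWitness > 0` on `(0, ∞)`. [folklore] -/
lemma slowWitness_pos {t : ℝ} (ht : 0 < t) : 0 < slowWitness t := by
  unfold slowWitness
  have := Real.neg_one_le_sin (Real.log (Real.log t))
  exact mul_pos ht (by linarith)

/-- `slowWitness t ≤ 3 t` on `(0, ∞)`. [folklore] -/
lemma slowWitness_le {t : ℝ} (ht : 0 < t) : slowWitness t ≤ 3 * t := by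
  unfold slowWitness
  have := Real.sin_le_one (Real.log (Real.log t))
  nlinarith

/-- The force bound at exponent ONE: `|s''| ≤ 9 |s|^{-1}` for `t ≥ 3`. [folklore] -/
lemma abs_slowWitnessD2_le {t : ℝ} (ht : 3 ≤ t) :
    |slowWitnessD2 t| ≤ 9 * |slowWitness t| ^ (-1 : ℝ) := by
  have ht0 : 0 < t := by linarith
  have hl := one_le_log_of_three_le ht
  have hl0 : 0 < Real.log t := by linarith
  have hlinv : 0 ≤ (Real.log t)⁻¹ := inv_nonneg.mpr hl0.le
  have hlinv1 : (Real.log t)⁻¹ ≤ 1 := inv_le_one_of_one_le₀ hl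
  -- numerator bounded by 3
  have hnum : |Real.cos (Real.log (Real.log t)) - Real.sin (Real.log (Real.log t)) * (Real.log t)⁻¹ -
      Real.cos (Real.log (Real.log t)) * (Real.log t)⁻¹| ≤ 3 := by
    have hs := Real.abs_sin_le_one (Real.log (Real.log t))
    have hc := Real.abs_cos_le_one (Real.log (Real.log t))
    have h1 : |Real.sin (Real.log (Real.log t)) * (Real.log t)⁻¹| ≤ 1 := by
      rw [abs_mul, abs_of_nonneg hlinv]; nlinarith [abs_nonneg (Real.sin (Real.log (Real.log t)))]
    have h2 : |Real.cos (Real.log (Real.log t)) * (Real.log t)⁻¹| ≤ 1 := by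
      rw [abs_mul, abs_of_nonneg hlinv]; nlinarith [abs_nonneg (Real.cos (Real.log (Real.log t)))]
    calc _ ≤ |Real.cos (Real.log (Real.log t)) - Real.sin (Real.log (Real.log t)) * (Real.log t)⁻¹| +
          |Real.cos (Real.log (Real.log t)) * (Real.log t)⁻¹| := abs_sub _ _
      _ ≤ (|Real.cos (Real.log (Real.log t))| + |Real.sin (Real.log (Real.log t)) * (Real.log t)⁻¹|) +
          |Real.cos (Real.log (Real.log t)) * (Real.log t)⁻¹| := by gcongr; exact abs_sub _ _
      _ ≤ (1 + 1) + 1 := by gcongr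
      _ = 3 := by norm_num
  -- `|s''| ≤ 3 / (t log t) ≤ 3 / t`
  have hD2 : |slowWitnessD2 t| ≤ 3 * t⁻¹ := by
    unfold slowWitnessD2
    rw [abs_mul, abs_inv, abs_of_pos (by positivity : 0 < t * Real.log t), mul_inv]
    calc _ ≤ 3 * (t⁻¹ * (Real.log t)⁻¹) := by gcongr
      _ ≤ 3 * (t⁻¹ * 1) := by gcongr
      _ = 3 * t⁻¹ := by ring
  -- `9 |s|^{-1} ≥ 9 / (3 t) = 3 / t`
  have hspos := slowWitness_pos ht0
  rw [abs_of_pos hspos, Real.rpow_neg_one]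
  have h3 : 3 * t⁻¹ ≤ 9 * (slowWitness t)⁻¹ := by
    rw [show (9 : ℝ) * (slowWitness t)⁻¹ = 9 / slowWitness t by ring,
      show (3 : ℝ) * t⁻¹ = 3 / t by ring, div_le_div_iff₀ ht0 hspos]
    nlinarith [slowWitness_le ht0]
  exact hD2.trans h3

/-- `sin (log (log t)) = 1` arbitrarily late. [folklore] -/
lemma frequently_sin_loglog_eq_one : ∃ᶠ t in atTop, Real.sin (Real.log (Real.log t)) = 1 := by
  rw [frequently_atTop]
  intro a
  obtain ⟨n, hn⟩ := exists_nat_ge a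
  refine ⟨Real.exp (Real.exp (Real.pi / 2 + n * (2 * Real.pi))), ?_, ?_⟩
  · have h1 : (n : ℝ) ≤ Real.pi / 2 + n * (2 * Real.pi) := by
      nlinarith [Real.pi_gt_three, (Nat.cast_nonneg n : (0 : ℝ) ≤ n)]
    have h2 := Real.add_one_le_exp (Real.pi / 2 + n * (2 * Real.pi))
    have h3 := Real.add_one_le_exp (Real.exp (Real.pi / 2 + n * (2 * Real.pi)))
    linarith
  · rw [Real.log_exp, Real.log_exp, Real.sin_add_nat_mul_two_pi, Real.sin_pi_div_two]

/-- `sin (log (log t)) = -1` arbitrarily late. [folklore] -/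
lemma frequently_sin_loglog_eq_neg_one : ∃ᶠ t in atTop, Real.sin (Real.log (Real.log t)) = -1 := by
  rw [frequently_atTop]
  intro a
  obtain ⟨n, hn⟩ := exists_nat_ge a
  refine ⟨Real.exp (Real.exp (-(Real.pi / 2) + n * (2 * Real.pi))), ?_, ?_⟩
  · have h1 : (n : ℝ) ≤ -(Real.pi / 2) + n * (2 * Real.pi) + 1 + 1 := by
      nlinarith [Real.pi_gt_three, Real.pi_lt_four, (Nat.cast_nonneg n : (0 : ℝ) ≤ n)]
    have h2 := Real.add_one_le_exp (-(Real.pi / 2) + n * (2 * Real.pi))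
    have h3 := Real.add_one_le_exp (Real.exp (-(Real.pi / 2) + n * (2 * Real.pi)))
    linarith
  · rw [Real.log_exp, Real.log_exp, Real.sin_add_nat_mul_two_pi, Real.sin_neg, Real.sin_pi_div_two]

/-- `slowWitness t / t = 2 + sin (log (log t))` has no limit. [folklore] -/
theorem not_tendsto_slowWitness_div :
    ¬ ∃ L : ℝ, Tendsto (fun t ↦ slowWitness t / t) atTop (𝓝 L) := by
  rintro ⟨L, hL⟩
  have h : Tendsto (fun t ↦ 2 + Real.sin (Real.log (Real.log t))) atTop (𝓝 L) := by
    refine hL.congr' ?_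
    filter_upwards [eventually_gt_atTop 0] with t ht
    unfold slowWitness
    field_simp
  have e1 : L = 3 := tendsto_nhds_unique_of_frequently_eq h tendsto_const_nhds
    (frequently_sin_loglog_eq_one.mono fun t ht ↦ by rw [ht]; norm_num)
  have e2 : L = 1 := tendsto_nhds_unique_of_frequently_eq h tendsto_const_nhds
    (frequently_sin_loglog_eq_neg_one.mono fun t ht ↦ by rw [ht]; norm_num)
  linarith

/-- **Sharpness of the exponent.** At `p = 1` every hypothesis of `tendsto_div_of_abs_deriv2_le_rpow`
holds (`t₀ = 3`, `K = 9`, `v = 4`) for `s t = t (2 + sin (log (log t)))`, yet `s(t)/t` does not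
converge: a force `K/d` at separation `d` (cone weight `w = 3/2`) can make the Cesàro mean wander
forever, `log log`-slowly. [folklore] -/
theorem not_tendsto_div_at_exponent_one :
    ∃ (s s' s'' : ℝ → ℝ) (t₀ K v : ℝ), 0 < t₀ ∧ 0 ≤ K ∧
      (∀ t, t₀ ≤ t → HasDerivAt s (s' t) t) ∧ (∀ t, t₀ ≤ t → HasDerivAt s' (s'' t) t) ∧
      (∀ t, t₀ ≤ t → |s' t| ≤ v) ∧
      (∀ t, t₀ ≤ t → s t ≠ 0 → |s'' t| ≤ K * |s t| ^ (-(1 : ℝ))) ∧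
      ¬ ∃ L : ℝ, Tendsto (fun t ↦ s t / t) atTop (𝓝 L) :=
  ⟨slowWitness, slowWitnessD1, slowWitnessD2, 3, 9, 4, by norm_num, by norm_num,
    fun _ ht ↦ hasDerivAt_slowWitness (by linarith), fun _ ht ↦ hasDerivAt_slowWitnessD1 (by linarith),
    fun _ ht ↦ abs_slowWitnessD1_le ht, fun _ ht _ ↦ abs_slowWitnessD2_le ht,
    not_tendsto_slowWitness_div⟩

end Sharpness

/-! ### The two-body toy is settled (landed as `Negative/CleanScaleTwoBody.lean`): bounded speeds,
relative acceleration `≤ K‖ξ₁ - ξ₂‖^{-p}` (`p > 1`), convergent total momentum ⇒ both `ξᵢ(t)/t`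
converge — no separation hypothesis, no energy, no individual velocity convergence -/

section TwoBody

/-- Coordinatewise Cesàro convergence in `ℝⁿ` (sup norm) from the scalar statements. [folklore] -/
lemma tendsto_inv_smul_of_coord {n : ℕ} {w : ℝ → (Fin n → ℝ)} {L : Fin n → ℝ}
    (h : ∀ k, Tendsto (fun t ↦ w t k / t) atTop (𝓝 (L k))) :
    Tendsto (fun t ↦ t⁻¹ • w t) atTop (𝓝 L) := by
  rw [tendsto_pi_nhds]
  intro k
  refine (h k).congr fun t ↦ ?_
  simp [div_eq_inv_mul]

/-- **The two-body clean-scale toy.** Bounded speeds, relative acceleration `≤ K ‖ξ₁ - ξ₂‖^{-p}` with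
`p > 1` wherever the bodies do not coincide, and convergent total momentum imply that both `ξᵢ(t)/t`
converge. [folklore] -/
theorem toy_two_body_cesaro {n : ℕ} {ξ₁ ξ₂ v₁ v₂ a₁ a₂ : ℝ → (Fin n → ℝ)}
    {t₀ K p vmax m₁ m₂ : ℝ} {P : Fin n → ℝ}
    (ht₀ : 0 < t₀) (hp : 1 < p) (hK : 0 ≤ K) (hm₁ : 0 < m₁) (hm₂ : 0 < m₂)
    (h₁ : ∀ t, HasDerivAt ξ₁ (v₁ t) t) (h₁' : ∀ t, HasDerivAt v₁ (a₁ t) t)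
    (h₂ : ∀ t, HasDerivAt ξ₂ (v₂ t) t) (h₂' : ∀ t, HasDerivAt v₂ (a₂ t) t)
    (hv : ∀ t, t₀ ≤ t → ‖v₁ t‖ ≤ vmax ∧ ‖v₂ t‖ ≤ vmax)
    (hrel : ∀ t, t₀ ≤ t → ξ₁ t ≠ ξ₂ t → ‖a₁ t - a₂ t‖ ≤ K * ‖ξ₁ t - ξ₂ t‖ ^ (-p))
    (hP : Tendsto (fun t ↦ m₁ • v₁ t + m₂ • v₂ t) atTop (𝓝 P)) :
    (∃ V₁, Tendsto (fun t ↦ t⁻¹ • ξ₁ t) atTop (𝓝 V₁)) ∧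
      ∃ V₂, Tendsto (fun t ↦ t⁻¹ • ξ₂ t) atTop (𝓝 V₂) := by
  -- (1) the relative coordinate `w = ξ₁ - ξ₂` has a Cesàro limit, coordinate by coordinate
  have hw : ∀ k, ∃ Lk, Tendsto (fun t ↦ (ξ₁ t - ξ₂ t) k / t) atTop (𝓝 Lk) := by
    intro k
    refine tendsto_div_of_abs_deriv2_le_rpow (s := fun t ↦ (ξ₁ t - ξ₂ t) k)
      (s' := fun t ↦ (v₁ t - v₂ t) k) (s'' := fun t ↦ (a₁ t - a₂ t) k) (v := vmax + vmax) ht₀ hp hK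
      (fun t _ ↦ hasDerivAt_pi.mp ((h₁ t).sub (h₂ t)) k)
      (fun t _ ↦ hasDerivAt_pi.mp ((h₁' t).sub (h₂' t)) k) (fun t ht ↦ ?_) (fun t ht hne ↦ ?_)
    · have hk : |(v₁ t - v₂ t) k| ≤ ‖v₁ t - v₂ t‖ := by
        simpa using norm_le_pi_norm (v₁ t - v₂ t) k
      exact hk.trans ((norm_sub_le _ _).trans (add_le_add (hv t ht).1 (hv t ht).2))
    · have hne' : ξ₁ t ≠ ξ₂ t := by
        intro h
        apply hne
        simp [h]
      have hk : |(ξ₁ t - ξ₂ t) k| ≤ ‖ξ₁ t - ξ₂ t‖ := by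
        simpa using norm_le_pi_norm (ξ₁ t - ξ₂ t) k
      have hk'' : |(a₁ t - a₂ t) k| ≤ ‖a₁ t - a₂ t‖ := by
        simpa using norm_le_pi_norm (a₁ t - a₂ t) k
      have hpos : 0 < |(ξ₁ t - ξ₂ t) k| := abs_pos.mpr hne
      calc |(a₁ t - a₂ t) k| ≤ ‖a₁ t - a₂ t‖ := hk''
        _ ≤ K * ‖ξ₁ t - ξ₂ t‖ ^ (-p) := hrel t ht hne'
        _ ≤ K * |(ξ₁ t - ξ₂ t) k| ^ (-p) :=
            mul_le_mul_of_nonneg_left (Real.rpow_le_rpow_of_nonpos hpos hk (by linarith)) hK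
  choose L hL using hw
  have hwlim : Tendsto (fun t ↦ t⁻¹ • (ξ₁ t - ξ₂ t)) atTop (𝓝 L) := tendsto_inv_smul_of_coord hL
  -- (2) the total momentum coordinate `X = m₁ ξ₁ + m₂ ξ₂` has a Cesàro limit (frozen ⇒ Cesàro)
  have hX : Tendsto (fun t ↦ t⁻¹ • (m₁ • ξ₁ t + m₂ • ξ₂ t)) atTop (𝓝 P) := by
    refine tendsto_inv_smul_of_coord fun k ↦ ?_
    have hd : ∀ t, HasDerivAt (fun t ↦ (m₁ • ξ₁ t + m₂ • ξ₂ t) k) ((m₁ • v₁ t + m₂ • v₂ t) k) t :=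
      fun t ↦ hasDerivAt_pi.mp (((h₁ t).const_smul m₁).add ((h₂ t).const_smul m₂)) k
    exact tendsto_div_of_tendsto_deriv hd ((continuous_apply k).tendsto P |>.comp hP)
  -- (3) recombine: `ξ₁ = (X + m₂ w)/(m₁ + m₂)`, `ξ₂ = (X - m₁ w)/(m₁ + m₂)`
  have hM : m₁ + m₂ ≠ 0 := by positivity
  refine ⟨⟨(m₁ + m₂)⁻¹ • (P + m₂ • L), ?_⟩, ⟨(m₁ + m₂)⁻¹ • (P - m₁ • L), ?_⟩⟩
  · have := (hX.add (hwlim.const_smul m₂)).const_smul (m₁ + m₂)⁻¹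
    refine this.congr fun t ↦ ?_
    ext k
    simp only [Pi.smul_apply, Pi.add_apply, Pi.sub_apply, smul_eq_mul]
    field_simp
    ring
  · have := (hX.sub (hwlim.const_smul m₁)).const_smul (m₁ + m₂)⁻¹
    refine this.congr fun t ↦ ?_
    ext k
    simp only [Pi.smul_apply, Pi.add_apply, Pi.sub_apply, smul_eq_mul]
    field_simp
    ring

end TwoBody

/-! ### Tauberian upgrade (landed as `Negative/CesaroTauberian.lean`): Cesàro velocity + one-sided
acceleration bound `-B/t` ⇒ frozen velocity (Landau–Hardy; Saari 2005 Thm. 4.11). With the clean-sphere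
force `K d_min^{-3/2}` the condition holds iff `d_min ≳ t^{2/3}`, the parabolic scale. -/

section Tauberian

/-- Window inequality: if `f' + B log` is non-decreasing on `[t₀, ∞)` then for `t₀ ≤ t` and `0 < ε`,
`ε t (f' t - B log (1 + ε)) ≤ f ((1 + ε) t) - f t ≤ ε t (f' ((1 + ε) t) + B log (1 + ε))`. [folklore] -/
lemma window_bounds {f f' : ℝ → ℝ} {t₀ B t ε : ℝ} (ht₀ : 0 < t₀) (hB : 0 ≤ B)
    (hf : ∀ s, t₀ ≤ s → HasDerivAt f (f' s) s)
    (hmono : MonotoneOn (fun s ↦ f' s + B * Real.log s) (Ici t₀)) (ht : t₀ ≤ t) (hε : 0 < ε) :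
    ε * t * (f' t - B * Real.log (1 + ε)) ≤ f ((1 + ε) * t) - f t ∧
      f ((1 + ε) * t) - f t ≤ ε * t * (f' ((1 + ε) * t) + B * Real.log (1 + ε)) := by
  have ht' : 0 < t := lt_of_lt_of_le ht₀ ht
  have hT : t ≤ (1 + ε) * t := by nlinarith
  -- on the window, `f' t - B log(1+ε) ≤ f' s ≤ f' ((1+ε)t) + B log(1+ε)`
  have hlog : ∀ s ∈ Icc t ((1 + ε) * t), Real.log s - Real.log t ≤ Real.log (1 + ε) ∧
      Real.log ((1 + ε) * t) - Real.log s ≤ Real.log (1 + ε) := by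
    intro s hs
    have hs0 : 0 < s := lt_of_lt_of_le ht' hs.1
    constructor
    · rw [← Real.log_div hs0.ne' ht'.ne']
      exact Real.log_le_log (by positivity) (by rw [div_le_iff₀ ht']; linarith [hs.2])
    · rw [← Real.log_div (by positivity) hs0.ne']
      exact Real.log_le_log (by positivity) (by rw [div_le_iff₀ hs0]; nlinarith [hs.1, hs.2])
  have hlow : ∀ s ∈ Icc t ((1 + ε) * t), f' t - B * Real.log (1 + ε) ≤ f' s := by
    intro s hs
    have := hmono (show t ∈ Ici t₀ from ht) (show s ∈ Ici t₀ from ht.trans hs.1) hs.1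
    simp only at this
    nlinarith [(hlog s hs).1]
  have hhigh : ∀ s ∈ Icc t ((1 + ε) * t), f' s ≤ f' ((1 + ε) * t) + B * Real.log (1 + ε) := by
    intro s hs
    have := hmono (show s ∈ Ici t₀ from ht.trans hs.1) (show (1 + ε) * t ∈ Ici t₀ from ht.trans hT)
      hs.2
    simp only at this
    nlinarith [(hlog s hs).2]
  have hcont : ContinuousOn f (Icc t ((1 + ε) * t)) := fun s hs ↦
    (hf s (ht.trans hs.1)).continuousAt.continuousWithinAt
  constructor
  · -- `s ↦ f s - (f' t - B log(1+ε)) s` is monotone on the window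
    have hm : MonotoneOn (fun s ↦ f s - (f' t - B * Real.log (1 + ε)) * s) (Icc t ((1 + ε) * t)) := by
      refine monotoneOn_of_hasDerivWithinAt_nonneg (convex_Icc _ _)
        (f' := fun s ↦ f' s - (f' t - B * Real.log (1 + ε)))
        (hcont.sub (continuousOn_const.mul continuousOn_id))
        (fun s hs ↦ (((hf s (ht.trans (interior_subset hs).1)).sub
          ((hasDerivAt_id s).const_mul _)).congr_deriv (by simp)).hasDerivWithinAt) ?_
      intro s hs
      have := hlow s (interior_subset hs)
      linarith
    have := hm (left_mem_Icc.mpr hT) (right_mem_Icc.mpr hT) hT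
    simp only at this
    nlinarith
  · have hm : AntitoneOn (fun s ↦ f s - (f' ((1 + ε) * t) + B * Real.log (1 + ε)) * s)
        (Icc t ((1 + ε) * t)) := by
      refine antitoneOn_of_hasDerivWithinAt_nonpos (convex_Icc _ _)
        (f' := fun s ↦ f' s - (f' ((1 + ε) * t) + B * Real.log (1 + ε)))
        (hcont.sub (continuousOn_const.mul continuousOn_id))
        (fun s hs ↦ (((hf s (ht.trans (interior_subset hs).1)).sub
          ((hasDerivAt_id s).const_mul _)).congr_deriv (by simp)).hasDerivWithinAt) ?_
      intro s hs
      have := hhigh s (interior_subset hs)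
      linarith
    have := hm (left_mem_Icc.mpr hT) (right_mem_Icc.mpr hT) hT
    simp only at this
    nlinarith

/-- **Landau–Hardy Tauberian theorem** (Saari 2005, Thm. 4.11, `α = 1`): a Cesàro velocity plus a
one-sided acceleration bound `f'' ≥ -B/t` is a frozen velocity. [cite: Saari2005, Thm. 4.11] -/
theorem tendsto_deriv_of_tendsto_div_of_deriv2_ge {f f' f'' : ℝ → ℝ} {t₀ A B : ℝ} (ht₀ : 0 < t₀)
    (hB : 0 ≤ B) (hf : ∀ t, t₀ ≤ t → HasDerivAt f (f' t) t)
    (hf' : ∀ t, t₀ ≤ t → HasDerivAt f' (f'' t) t) (hlow : ∀ t, t₀ ≤ t → -B * t⁻¹ ≤ f'' t)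
    (hA : Tendsto (fun t ↦ f t / t) atTop (𝓝 A)) : Tendsto f' atTop (𝓝 A) := by
  -- `f' + B log` is non-decreasing on `[t₀, ∞)`
  have hmono : MonotoneOn (fun s ↦ f' s + B * Real.log s) (Ici t₀) := by
    refine monotoneOn_of_hasDerivWithinAt_nonneg (convex_Ici t₀)
      (fun s hs ↦ ((hf' s hs).add ((Real.hasDerivAt_log (lt_of_lt_of_le ht₀ hs).ne').const_mul B))
        |>.continuousAt.continuousWithinAt)
      (fun s hs ↦ ((hf' s (interior_subset hs)).add ((Real.hasDerivAt_log
        (lt_of_lt_of_le ht₀ (interior_subset hs)).ne').const_mul B)).hasDerivWithinAt) ?_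
    intro s hs
    have hs' : t₀ ≤ s := interior_subset hs
    have := hlow s hs'
    linarith
  -- the two difference quotients and their limits
  have hquot : ∀ ε : ℝ, 0 < ε →
      Tendsto (fun t ↦ (f ((1 + ε) * t) - f t) / (ε * t)) atTop (𝓝 A) := by
    intro ε hε
    have h1 : Tendsto (fun t ↦ f ((1 + ε) * t) / ((1 + ε) * t)) atTop (𝓝 A) :=
      hA.comp (Tendsto.const_mul_atTop (by linarith) tendsto_id)
    have h2 : Tendsto (fun t ↦ (1 + ε) / ε * (f ((1 + ε) * t) / ((1 + ε) * t)) - ε⁻¹ * (f t / t))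
        atTop (𝓝 ((1 + ε) / ε * A - ε⁻¹ * A)) := (h1.const_mul _).sub (hA.const_mul _)
    have hlim : (1 + ε) / ε * A - ε⁻¹ * A = A := by field_simp; ring
    rw [hlim] at h2
    refine h2.congr' ?_
    filter_upwards [eventually_gt_atTop 0] with t ht
    field_simp
  rw [tendsto_order]
  constructor
  · -- lower bounds: `f' ((1+ε)t) ≥ quotient - B log(1+ε)` eventually
    intro a ha
    obtain ⟨ε, hε, hεlog⟩ : ∃ ε > 0, B * Real.log (1 + ε) < (A - a) / 2 := by
      refine ⟨min 1 ((A - a) / (4 * (B + 1))), by positivity, ?_⟩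
      have hle : Real.log (1 + min 1 ((A - a) / (4 * (B + 1)))) ≤ min 1 ((A - a) / (4 * (B + 1))) := by
        have := Real.log_le_sub_one_of_pos (show 0 < 1 + min 1 ((A - a) / (4 * (B + 1))) by positivity)
        linarith
      have hmin : min 1 ((A - a) / (4 * (B + 1))) ≤ (A - a) / (4 * (B + 1)) := min_le_right _ _
      have hB1 : 0 < B + 1 := by linarith
      calc B * Real.log (1 + min 1 ((A - a) / (4 * (B + 1))))
          ≤ B * ((A - a) / (4 * (B + 1))) := mul_le_mul_of_nonneg_left (hle.trans hmin) hB
        _ ≤ (B + 1) * ((A - a) / (4 * (B + 1))) :=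
            mul_le_mul_of_nonneg_right (by linarith) (by positivity)
        _ = (A - a) / 4 := by field_simp
        _ < (A - a) / 2 := by linarith
    have hev : ∀ᶠ t in atTop, t₀ ≤ t ∧ (A - (A - a) / 2) < (f ((1 + ε) * t) - f t) / (ε * t) :=
      (eventually_ge_atTop t₀).and ((hquot ε hε).eventually (lt_mem_nhds (by linarith)))
    -- transport along `t ↦ (1+ε) t`
    have htrans : Tendsto (fun τ ↦ τ / (1 + ε)) atTop atTop :=
      Tendsto.atTop_div_const (by linarith) tendsto_id
    filter_upwards [htrans.eventually hev] with τ hτ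
    obtain ⟨hτ0, hq⟩ := hτ
    have hτeq : (1 + ε) * (τ / (1 + ε)) = τ := by field_simp
    rw [hτeq] at hq
    have hw := (window_bounds ht₀ hB hf hmono hτ0 hε).2
    rw [hτeq] at hw
    have hpos : 0 < ε * (τ / (1 + ε)) := by
      have : 0 < τ / (1 + ε) := lt_of_lt_of_le ht₀ hτ0
      positivity
    rw [lt_div_iff₀ hpos] at hq
    nlinarith
  · -- upper bounds: `f' t ≤ quotient + B log(1+ε)` eventually
    intro b hb
    obtain ⟨ε, hε, hεlog⟩ : ∃ ε > 0, B * Real.log (1 + ε) < (b - A) / 2 := by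
      refine ⟨min 1 ((b - A) / (4 * (B + 1))), by positivity, ?_⟩
      have hle : Real.log (1 + min 1 ((b - A) / (4 * (B + 1)))) ≤ min 1 ((b - A) / (4 * (B + 1))) := by
        have := Real.log_le_sub_one_of_pos (show 0 < 1 + min 1 ((b - A) / (4 * (B + 1))) by positivity)
        linarith
      have hmin : min 1 ((b - A) / (4 * (B + 1))) ≤ (b - A) / (4 * (B + 1)) := min_le_right _ _
      have hB1 : 0 < B + 1 := by linarith
      calc B * Real.log (1 + min 1 ((b - A) / (4 * (B + 1))))
          ≤ B * ((b - A) / (4 * (B + 1))) := mul_le_mul_of_nonneg_left (hle.trans hmin) hB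
        _ ≤ (B + 1) * ((b - A) / (4 * (B + 1))) :=
            mul_le_mul_of_nonneg_right (by linarith) (by positivity)
        _ = (b - A) / 4 := by field_simp
        _ < (b - A) / 2 := by linarith
    have hev : ∀ᶠ t in atTop, t₀ ≤ t ∧ (f ((1 + ε) * t) - f t) / (ε * t) < A + (b - A) / 2 :=
      (eventually_ge_atTop t₀).and ((hquot ε hε).eventually (gt_mem_nhds (by linarith)))
    filter_upwards [hev] with t ht
    obtain ⟨ht0, hq⟩ := ht
    have hw := (window_bounds ht₀ hB hf hmono ht0 hε).1
    have hpos : 0 < ε * t := by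
      have : 0 < t := lt_of_lt_of_le ht₀ ht0
      positivity
    rw [div_lt_iff₀ hpos] at hq
    nlinarith

end Tauberian

/-! ### Encounter lemmas for the `N ≥ 3` cluster induction (landed as
`Negative/CleanScaleEncounters.lean`): confinement costs force, turnaround costs speed, and the
one-line obstruction to a "momentum shuttle" -/

section Encounters

/-- **Confinement costs force.** In a normed space, if `‖w t‖ ≤ D` and `‖w'' t‖ ≤ A` on `[a, a + T]`
(`T > 0`), then `‖w' a‖ ≤ 2 D / T + A T`. [folklore] -/
theorem norm_deriv_le_of_confined {E : Type*} [NormedAddCommGroup E] [NormedSpace ℝ E]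
    {w w' w'' : ℝ → E} {a T D A : ℝ} (hT : 0 < T)
    (hw : ∀ t ∈ Icc a (a + T), HasDerivAt w (w' t) t)
    (hw' : ∀ t ∈ Icc a (a + T), HasDerivAt w' (w'' t) t)
    (hD : ∀ t ∈ Icc a (a + T), ‖w t‖ ≤ D) (hA : ∀ t ∈ Icc a (a + T), ‖w'' t‖ ≤ A) :
    ‖w' a‖ ≤ 2 * D / T + A * T := by
  have haT : a ≤ a + T := by linarith
  -- first-order control of `w'`: `‖w' t - w' a‖ ≤ A (t - a) ≤ A T`
  have h1 : ∀ t ∈ Icc a (a + T), ‖w' t - w' a‖ ≤ A * T := by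
    intro t ht
    have := norm_image_sub_le_of_norm_deriv_le_segment' (f := w') (f' := w'')
      (fun s hs ↦ (hw' s hs).hasDerivWithinAt) (fun s hs ↦ hA s (Ico_subset_Icc_self hs)) t ht
    refine this.trans ?_
    have hA0 : 0 ≤ A := (norm_nonneg _).trans (hA a (left_mem_Icc.mpr haT))
    exact mul_le_mul_of_nonneg_left (by linarith [ht.2]) hA0
  -- second-order Taylor remainder: `g t = w t - w a - (t - a) • w' a`, `‖g'‖ ≤ A T`
  have h2 : ‖(w (a + T) - w a - ((a + T) - a) • w' a) - (w a - w a - (a - a) • w' a)‖ ≤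
      A * T * ((a + T) - a) := by
    refine norm_image_sub_le_of_norm_deriv_le_segment' (f := fun t ↦ w t - w a - (t - a) • w' a)
      (f' := fun t ↦ w' t - w' a) (fun s hs ↦ ?_) (fun s hs ↦ h1 s (Ico_subset_Icc_self hs)) _
      (right_mem_Icc.mpr haT)
    have hd : HasDerivAt (fun t ↦ w t - w a - (t - a) • w' a) (w' s - 0 - (1 : ℝ) • w' a) s :=
      ((hw s hs).sub (hasDerivAt_const s (w a))).sub (((hasDerivAt_id s).sub_const a).smul_const _)
    simpa using hd.hasDerivWithinAt
  simp only [sub_self, zero_smul, sub_zero, add_sub_cancel_left] at h2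
  -- `T • w' a = (w (a+T) - w a) - g (a+T)`
  have hnorm : ‖T • w' a‖ ≤ 2 * D + A * T * T := by
    have heq : T • w' a = (w (a + T) - w a) - (w (a + T) - w a - T • w' a) := by abel
    rw [heq]
    refine (norm_sub_le _ _).trans ?_
    have hwa : ‖w (a + T) - w a‖ ≤ 2 * D := by
      refine (norm_sub_le _ _).trans ?_
      have := hD (a + T) (right_mem_Icc.mpr haT)
      have := hD a (left_mem_Icc.mpr haT)
      linarith
    linarith
  rw [norm_smul, Real.norm_eq_abs, abs_of_pos hT] at hnorm
  rw [div_add' _ _ _ hT.ne', le_div_iff₀ hT]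
  linarith

/-- **Turnaround costs speed** (one space dimension). If on `[t₁, t₂]` the distance `r` stays `≥ d > 0`,
`|r''| ≤ K r^{-p}` with `p > 1`, the body is approaching at `t₁` (`r'(t₁) ≤ 0`) and no longer
approaching at `t₂` (`r'(t₂) ≥ 0`), then `r'(t₁)² ≤ 2K d^{1-p}/(p-1)`: the quantity
`r'²/2 + K r^{1-p}/(p-1)` is non-decreasing while `r' < 0`. [folklore] -/
theorem speed_sq_le_of_turnaround {r r' r'' : ℝ → ℝ} {t₁ t₂ K p d : ℝ} (ht : t₁ ≤ t₂)
    (hp : 1 < p) (hK : 0 ≤ K) (hd : 0 < d)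
    (hr : ∀ t ∈ Icc t₁ t₂, HasDerivAt r (r' t) t) (hr' : ∀ t ∈ Icc t₁ t₂, HasDerivAt r' (r'' t) t)
    (hbound : ∀ t ∈ Icc t₁ t₂, |r'' t| ≤ K * (r t) ^ (-p)) (hfar : ∀ t ∈ Icc t₁ t₂, d ≤ r t)
    (h₁ : r' t₁ ≤ 0) (h₂ : 0 ≤ r' t₂) :
    (r' t₁) ^ 2 ≤ 2 * K / (p - 1) * d ^ (1 - p) := by
  set c := K / (p - 1) with hc
  have hp1 : 0 < p - 1 := by linarith
  have hc0 : 0 ≤ c := div_nonneg hK hp1.le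
  rcases eq_or_lt_of_le h₁ with h0 | hneg
  · rw [h0]
    simp only [ne_eq, OfNat.ofNat_ne_zero, not_false_eq_true, zero_pow]
    have : 0 ≤ d ^ (1 - p) := Real.rpow_nonneg hd.le _
    positivity
  -- first time `ts ∈ (t₁, t₂]` with `r' ≥ 0`; before it `r' < 0`
  have hcont' : ContinuousOn r' (Icc t₁ t₂) := fun t ht ↦ (hr' t ht).continuousAt.continuousWithinAt
  have hclosed : IsClosed {t | t ∈ Icc t₁ t₂ ∧ 0 ≤ r' t} := by
    have := hcont'.preimage_isClosed_of_isClosed isClosed_Icc (isClosed_Ici (a := (0 : ℝ)))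
    convert this using 1
    ext t
    simp
  obtain ⟨ts, h1s, hs2, hsP, hbefore⟩ := exists_first_hit (P := fun t ↦ 0 ≤ r' t) ht hclosed
    (not_le.mpr hneg) h₂
  have hsub : Icc t₁ ts ⊆ Icc t₁ t₂ := Icc_subset_Icc le_rfl hs2
  -- the energy-like quantity `H t = r'² / 2 + c r^{1-p}` is monotone on `[t₁, ts]`
  have hpos : ∀ t ∈ Icc t₁ t₂, 0 < r t := fun t ht ↦ lt_of_lt_of_le hd (hfar t ht)
  have hH : ∀ t ∈ Icc t₁ t₂, HasDerivAt (fun t ↦ r' t ^ 2 / 2 + c * r t ^ (1 - p))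
      (r' t * r'' t + c * ((1 - p) * r t ^ (1 - p - 1) * r' t)) t := by
    intro t ht
    have hd1 : HasDerivAt (fun t ↦ r' t ^ 2 / 2) (r' t * r'' t) t := by
      have := ((hr' t ht).pow 2).div_const 2
      refine this.congr_deriv ?_
      simp only [Nat.cast_ofNat]
      ring
    have hd2 : HasDerivAt (fun t ↦ c * r t ^ (1 - p)) (c * ((1 - p) * r t ^ (1 - p - 1) * r' t)) t :=
      ((hr t ht).rpow_const (p := 1 - p) (Or.inl (hpos t ht).ne')).const_mul c |>.congr_deriv
        (by ring)
    exact hd1.add hd2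
  have hmono : MonotoneOn (fun t ↦ r' t ^ 2 / 2 + c * r t ^ (1 - p)) (Icc t₁ ts) := by
    refine monotoneOn_of_hasDerivWithinAt_nonneg (convex_Icc t₁ ts)
      (fun t ht ↦ (hH t (hsub ht)).continuousAt.continuousWithinAt)
      (fun t ht ↦ (hH t (hsub (interior_subset ht))).hasDerivWithinAt) ?_
    intro t ht
    rw [interior_Icc] at ht
    have ht' : t ∈ Icc t₁ t₂ := hsub ⟨ht.1.le, ht.2.le⟩
    have hneg_t : r' t < 0 := not_le.mp (hbefore t ⟨ht.1.le, ht.2⟩)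
    have hrt := hpos t ht'
    -- derivative = r' (r'' - K r^{-p}) ≥ 0
    have key : r' t * r'' t + c * ((1 - p) * r t ^ (1 - p - 1) * r' t) =
        r' t * (r'' t - K * r t ^ (-p)) := by
      rw [show (1 - p - 1 : ℝ) = -p by ring, hc]
      field_simp
      ring
    rw [key]
    have hb := hbound t ht'
    have : r'' t - K * r t ^ (-p) ≤ 0 := by linarith [le_abs_self (r'' t)]
    nlinarith
  have hle := hmono (left_mem_Icc.mpr h1s.le) (right_mem_Icc.mpr h1s.le) h1s.le
  simp only at hle
  -- at `ts`: `r' ts = 0` is not needed, only `r'² ≥ 0`; bound the potential terms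
  have hts : ts ∈ Icc t₁ t₂ := ⟨h1s.le, hs2⟩
  have hpow_ts : r ts ^ (1 - p) ≤ d ^ (1 - p) :=
    Real.rpow_le_rpow_of_nonpos hd (hfar ts hts) (by linarith)
  have hpow_t1 : 0 ≤ r t₁ ^ (1 - p) := Real.rpow_nonneg (hpos t₁ (left_mem_Icc.mpr ht)).le _
  -- `r' ts = 0`: it is the first time with `r' ≥ 0`, and `r'` is continuous
  have hrs : r' ts = 0 := by
    refine le_antisymm ?_ hsP
    -- limit from the left of negative values
    have hcts : ContinuousWithinAt r' (Iio ts) ts :=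
      ((hr' ts hts).continuousAt.continuousWithinAt)
    refine le_of_tendsto hcts.tendsto ?_
    filter_upwards [Ico_mem_nhdsLT h1s] with t ht'
    exact (not_le.mp (hbefore t ht')).le
  rw [hrs] at hle
  simp only [ne_eq, OfNat.ofNat_ne_zero, not_false_eq_true, zero_pow, zero_div, zero_add] at hle
  have : r' t₁ ^ 2 / 2 ≤ c * d ^ (1 - p) := by nlinarith [mul_le_mul_of_nonneg_left hpow_ts hc0]
  rw [hc] at this
  have h' : r' t₁ ^ 2 ≤ 2 * (K / (p - 1) * d ^ (1 - p)) := by linarith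
  calc r' t₁ ^ 2 ≤ 2 * (K / (p - 1) * d ^ (1 - p)) := h'
    _ = 2 * K / (p - 1) * d ^ (1 - p) := by ring

/-- The shuttle obstruction in one line: a body with velocity `u` cannot be slow relative to both of two
bodies with velocities `v₁`, `v₃`. [folklore] -/
theorem shuttle_triangle (u v₁ v₃ : ℝ) : |v₃ - v₁| ≤ |u - v₁| + |u - v₃| := by
  have := abs_sub_le v₃ u v₁
  rw [abs_sub_comm v₃ u] at this
  linarith

end Encounters

/-! ## §I (cycle 3) Separation FREEZES instantaneous velocities in the toy — correction of §E's
Tauberian remark, and the honest `N`-body target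

Cycle 2 (§E, TAUBERIAN bullet) said that below the parabolic scale a persistent partner "can keep an
instantaneous velocity wandering, harmlessly for the typed conclusion". In the toy this is FALSE, and the
correction matters for the crux chain: lead-b's endgame `stub_expandingChargeKinematics`
(`Lines/old-light-leaves-the-cone.lean`, S4) asserts INSTANTANEOUS limits `vᵢ → Vᵢ` from window charges,
and a sub-parabolic wandering pair would have been an unconditional Lean refutation of that stub. There is
none for `N ≤ 2`: with the crux's own separation clause h₄ (`‖ξᵢ - ξⱼ‖ → ∞`) the sign-less bound
`K d^{-p}`, `p > 1`, freezes instantaneous velocities with NO rate, by two energy arguments that never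
integrate the force along the trajectory (landed as `Negative/CleanScaleFrozen.lean` and
`Negative/CleanScaleFrozenTwoBody.lean`):

* one dimension (`tendsto_deriv_of_abs_deriv2_le_rpow_of_tendsto_atTop`): `|s''| ≤ K s^{-p}` (`s > 0`),
  `s → ∞` ⇒ `s'` converges. DESCENT at speed `A` from beyond `d` (with `2K d^{1-p}/(p-1) < A²/4`) can
  neither be turned around (`speed_sq_le_of_turnaround`) nor last forever (`s → ∞`); ASCENT at speed `A`
  persists above `A/2` forever (`ascent_persists`: `s'²/2 - (K/(p-1)) s^{1-p}` is monotone while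
  `s' > 0`), whence `s ≳ t` and an integrable force. So `s'` is eventually inside every `(-A, A)` or it
  converges by integrability — no Tauberian condition, no parabolic threshold;
* the pair in `ℝⁿ` (`toy_two_body_frozen`): the hypotheses of `toy_two_body_cesaro` PLUS h₄ give
  convergent instantaneous velocities `v₁, v₂`. Cesàro relative velocity `V ≠ 0` ⇒ integrable force;
  `V = 0` ⇒ a late relative speed `A` in the sup-norm coordinate `k` would persist (`escape_of_deriv_ge`,
  the escape potential `∫₀^u K2^p (m + |x|)^{-p} dx` being bounded by `K2^p m^{1-p}/(p-1) → 0` in the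
  guaranteed separation `m`) and force linear escape, contradicting `V = 0`.

So the HONEST `N`-body target behind both leads' endgames is the FROZEN statement
`ToyCleanScaleFrozenMotion` below (it implies the Cesàro one, `toyCleanScaleFinalMotion_of_frozen`), and
the only remaining toy obstruction is the `N ≥ 3` cluster induction (see `regimes_note`). -/

section Frozen

/-! ### Energy monotonicity during an ascent and the persistence of fast ascents -/

/-- **Energy gain during an ascent.** If `φ' > 0` on `[t₁, t₂)` and `φ'' ≥ -g(φ)` on `[t₁, t₂]`, where
`Ψ` is an antiderivative of `g` along the range, then `φ'²/2 + Ψ(φ)` does not decrease from `t₁` to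
`t₂`. [folklore] -/
theorem energy_ascent {φ φ' φ'' g Ψ : ℝ → ℝ} {t₁ t₂ : ℝ} (ht : t₁ ≤ t₂)
    (hφ : ∀ t ∈ Icc t₁ t₂, HasDerivAt φ (φ' t) t) (hφ' : ∀ t ∈ Icc t₁ t₂, HasDerivAt φ' (φ'' t) t)
    (hΨ : ∀ t ∈ Icc t₁ t₂, HasDerivAt Ψ (g (φ t)) (φ t))
    (hacc : ∀ t ∈ Icc t₁ t₂, -g (φ t) ≤ φ'' t) (hpos : ∀ t ∈ Ico t₁ t₂, 0 < φ' t) :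
    φ' t₁ ^ 2 / 2 + Ψ (φ t₁) ≤ φ' t₂ ^ 2 / 2 + Ψ (φ t₂) := by
  have hE : ∀ t ∈ Icc t₁ t₂, HasDerivAt (fun t ↦ φ' t ^ 2 / 2 + Ψ (φ t))
      (φ' t * φ'' t + g (φ t) * φ' t) t := by
    intro t ht'
    have hd1 : HasDerivAt (fun t ↦ φ' t ^ 2 / 2) (φ' t * φ'' t) t := by
      have := ((hφ' t ht').pow 2).div_const 2
      refine this.congr_deriv ?_
      simp only [Nat.cast_ofNat]
      ring
    have hd2 : HasDerivAt (fun t ↦ Ψ (φ t)) (g (φ t) * φ' t) t := (hΨ t ht').comp t (hφ t ht')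
    exact hd1.add hd2
  have hmono : MonotoneOn (fun t ↦ φ' t ^ 2 / 2 + Ψ (φ t)) (Icc t₁ t₂) := by
    refine monotoneOn_of_hasDerivWithinAt_nonneg (convex_Icc t₁ t₂)
      (fun t ht' ↦ (hE t ht').continuousAt.continuousWithinAt)
      (fun t ht' ↦ (hE t (interior_subset ht')).hasDerivWithinAt) ?_
    intro t ht'
    rw [interior_Icc] at ht'
    have h1 := hacc t ⟨ht'.1.le, ht'.2.le⟩
    have h2 := hpos t ⟨ht'.1.le, ht'.2⟩
    have : φ' t * φ'' t + g (φ t) * φ' t = φ' t * (φ'' t + g (φ t)) := by ring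
    rw [this]
    exact mul_nonneg h2.le (by linarith)
  exact hmono (left_mem_Icc.mpr ht) (right_mem_Icc.mpr ht) ht

/-- **Fast ascents persist.** In the setting of `energy_ascent` on `[t₁, t₂]`, if the potential `Ψ(φ)`
can drop by at most `B ≤ A²/4` along the interval and `φ'(t₁) ≥ A > 0`, then `φ' > A/2` on the whole
interval: at a first time with `φ' = A/2` the energy inequality would give `φ'² ≥ A² - 2B ≥ A²/2`.
[folklore] -/
theorem ascent_persists {φ φ' φ'' g Ψ : ℝ → ℝ} {t₁ t₂ A B : ℝ} (ht : t₁ ≤ t₂) (hA : 0 < A)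
    (hφ : ∀ t ∈ Icc t₁ t₂, HasDerivAt φ (φ' t) t) (hφ' : ∀ t ∈ Icc t₁ t₂, HasDerivAt φ' (φ'' t) t)
    (hΨ : ∀ t ∈ Icc t₁ t₂, HasDerivAt Ψ (g (φ t)) (φ t))
    (hacc : ∀ t ∈ Icc t₁ t₂, -g (φ t) ≤ φ'' t)
    (hdrop : ∀ t ∈ Icc t₁ t₂, ∀ t' ∈ Icc t₁ t₂, Ψ (φ t) - Ψ (φ t') ≤ B) (hB : B ≤ A ^ 2 / 4)
    (h₁ : A ≤ φ' t₁) : ∀ t ∈ Icc t₁ t₂, A / 2 < φ' t := by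
  by_contra hcon
  push Not at hcon
  obtain ⟨tb, htb, hle⟩ := hcon
  -- first time in `[t₁, tb]` with `φ' ≤ A / 2`
  have hcont' : ContinuousOn φ' (Icc t₁ t₂) := fun t ht' ↦ (hφ' t ht').continuousAt.continuousWithinAt
  have hsub0 : Icc t₁ tb ⊆ Icc t₁ t₂ := Icc_subset_Icc le_rfl htb.2
  have hclosed : IsClosed {t | t ∈ Icc t₁ tb ∧ φ' t ≤ A / 2} := by
    have := (hcont'.mono hsub0).preimage_isClosed_of_isClosed isClosed_Icc
      (isClosed_Iic (a := A / 2))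
    convert this using 1
    ext t
    simp
  have hnot : ¬ φ' t₁ ≤ A / 2 := by push Not; linarith
  obtain ⟨ts, h1s, hs2, hsP, hbefore⟩ := exists_first_hit (P := fun t ↦ φ' t ≤ A / 2) htb.1 hclosed
    hnot hle
  have hts : ts ∈ Icc t₁ t₂ := ⟨h1s.le, hs2.trans htb.2⟩
  have hsub : Icc t₁ ts ⊆ Icc t₁ t₂ := Icc_subset_Icc le_rfl hts.2
  -- energy inequality on `[t₁, ts]`
  have hen := energy_ascent h1s.le (fun t ht' ↦ hφ t (hsub ht')) (fun t ht' ↦ hφ' t (hsub ht'))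
    (fun t ht' ↦ hΨ t (hsub ht')) (fun t ht' ↦ hacc t (hsub ht'))
    (fun t ht' ↦ by have := not_le.mp (hbefore t ht'); linarith)
  -- `φ' ts = A / 2` by continuity from the left
  have heq : φ' ts = A / 2 := by
    refine le_antisymm hsP ?_
    have hcts : ContinuousWithinAt φ' (Iio ts) ts := (hφ' ts hts).continuousAt.continuousWithinAt
    refine ge_of_tendsto hcts.tendsto ?_
    filter_upwards [Ico_mem_nhdsLT h1s] with t ht'
    exact (not_le.mp (hbefore t ht')).le
  have hd := hdrop ts hts t₁ (left_mem_Icc.mpr ht)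
  rw [heq] at hen
  have hA2 : 0 < A ^ 2 := by positivity
  nlinarith

/-! ### One dimension: separation freezes the velocity -/

/-- **Separation freezes the velocity (one dimension).** On `[t₀, ∞)` let `s` be twice differentiable
with `|s''| ≤ K s^{-p}` wherever `s > 0` (`p > 1`, `K ≥ 0`), and suppose `s(t) → ∞`. Then `s'`
CONVERGES. (No bound on `s'` and no integrability of `s''` along the trajectory are assumed; compare
`tendsto_div_of_abs_deriv2_le_rpow`, which gets only the Cesàro mean but needs no separation, and
`CleanScaleSharpness.lean`: at `p = 1` even the Cesàro mean wanders although `s → ∞`.) [folklore] -/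
theorem tendsto_deriv_of_abs_deriv2_le_rpow_of_tendsto_atTop {s s' s'' : ℝ → ℝ} {t₀ K p : ℝ}
    (hp : 1 < p) (hK : 0 ≤ K)
    (hs : ∀ t, t₀ ≤ t → HasDerivAt s (s' t) t) (hs' : ∀ t, t₀ ≤ t → HasDerivAt s' (s'' t) t)
    (hbound : ∀ t, t₀ ≤ t → 0 < s t → |s'' t| ≤ K * s t ^ (-p))
    (hsep : Tendsto s atTop atTop) : ∃ L, Tendsto s' atTop (𝓝 L) := by
  set c := K / (p - 1) with hc
  have hp1 : 0 < p - 1 := by linarith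
  have hc0 : 0 ≤ c := div_nonneg hK hp1.le
  -- for every `A > 0`: a distance `d` beyond which turnarounds / slow-downs of size `A` are impossible,
  -- and a time after which the trajectory stays beyond `d`
  have prep : ∀ A : ℝ, 0 < A → ∃ d a : ℝ, 0 < d ∧ 2 * K / (p - 1) * d ^ (1 - p) < A ^ 2 / 4 ∧
      ∀ t, a ≤ t → t₀ ≤ t ∧ d ≤ s t := by
    intro A hA
    have h1 : Tendsto (fun d : ℝ ↦ 2 * K / (p - 1) * d ^ (-(p - 1))) atTop (𝓝 (2 * K / (p - 1) * 0)) :=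
      (tendsto_rpow_neg_atTop hp1).const_mul _
    rw [mul_zero] at h1
    have h2 : ∀ᶠ d : ℝ in atTop, 2 * K / (p - 1) * d ^ (-(p - 1)) < A ^ 2 / 4 :=
      h1.eventually (gt_mem_nhds (by positivity))
    obtain ⟨d, hd1, hd2⟩ := (h2.and (eventually_ge_atTop 1)).exists
    have hev : ∀ᶠ t in atTop, t₀ ≤ t ∧ d ≤ s t :=
      (eventually_ge_atTop t₀).and (hsep.eventually (eventually_ge_atTop d))
    obtain ⟨a, ha⟩ := hev.exists_forall_of_atTop
    refine ⟨d, a, by linarith, ?_, ha⟩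
    convert hd1 using 3
    ring
  -- Step A: no late descent at speed `A`
  have stepA : ∀ A : ℝ, 0 < A → ∀ᶠ t in atTop, -A < s' t := by
    intro A hA
    obtain ⟨d, a, hd, hdA, ha⟩ := prep A hA
    refine eventually_atTop.mpr ⟨a, fun t₁ ht₁ ↦ ?_⟩
    by_contra hcon
    push Not at hcon
    by_cases hturn : ∃ t₂, t₁ ≤ t₂ ∧ 0 ≤ s' t₂
    · obtain ⟨t₂, h12, h2⟩ := hturn
      have key := speed_sq_le_of_turnaround (r := s) (r' := s') (r'' := s'') h12 hp hK hd
        (fun t ht' ↦ hs t (ha t (ht₁.trans ht'.1)).1) (fun t ht' ↦ hs' t (ha t (ht₁.trans ht'.1)).1)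
        (fun t ht' ↦ hbound t (ha t (ht₁.trans ht'.1)).1 (hd.trans_le (ha t (ht₁.trans ht'.1)).2))
        (fun t ht' ↦ (ha t (ht₁.trans ht'.1)).2) (by linarith) h2
      have : A ^ 2 ≤ s' t₁ ^ 2 := by nlinarith
      have hA2 : 0 < A ^ 2 := by positivity
      linarith
    · push Not at hturn
      -- `s' < 0` on `[t₁, ∞)`: `s` is antitone there, contradicting `s → ∞`
      have hanti : AntitoneOn s (Ici t₁) := by
        refine antitoneOn_of_hasDerivWithinAt_nonpos (convex_Ici t₁)
          (fun t ht' ↦ (hs t (ha t (ht₁.trans ht')).1).continuousAt.continuousWithinAt)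
          (fun t ht' ↦ (hs t (ha t (ht₁.trans (interior_subset ht'))).1).hasDerivWithinAt) ?_
        intro t ht'
        rw [interior_Ici] at ht'
        exact (hturn t (le_of_lt ht')).le
      have hev : ∀ᶠ t in atTop, s t₁ + 1 ≤ s t := hsep.eventually (eventually_ge_atTop _)
      obtain ⟨t, ht1, ht2⟩ := (hev.and (eventually_ge_atTop t₁)).exists
      have := hanti (self_mem_Ici) ht2 ht2
      linarith
  -- Step B: a late ascent at speed `A` persists at speed `A / 2`
  have stepB : ∀ A : ℝ, 0 < A → (∃ᶠ t in atTop, A ≤ s' t) → ∃ a', t₀ ≤ a' ∧ ∀ t, a' ≤ t → A / 2 < s' t := by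
    intro A hA hfreq
    obtain ⟨d, a, hd, hdA, ha⟩ := prep A hA
    obtain ⟨t₁, h1, ht₁⟩ := (hfreq.and_eventually (eventually_ge_atTop a)).exists
    refine ⟨t₁, (ha t₁ ht₁).1, fun t₂ ht₂ ↦ ?_⟩
    have hI : ∀ t ∈ Icc t₁ t₂, t₀ ≤ t ∧ d ≤ s t := fun t ht' ↦ ha t (ht₁.trans ht'.1)
    have hpos : ∀ t ∈ Icc t₁ t₂, 0 < s t := fun t ht' ↦ hd.trans_le (hI t ht').2
    refine ascent_persists (φ := s) (φ' := s') (φ'' := s'') (g := fun u ↦ K * u ^ (-p))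
      (Ψ := fun u ↦ -c * u ^ (1 - p)) (B := c * d ^ (1 - p)) ht₂ hA (fun t ht' ↦ hs t (hI t ht').1)
      (fun t ht' ↦ hs' t (hI t ht').1) ?_ ?_ ?_ ?_ h1 t₂ (right_mem_Icc.mpr ht₂)
    · intro t ht'
      have hst := hpos t ht'
      have := ((hasDerivAt_id (s t)).rpow_const (p := 1 - p) (Or.inl hst.ne')).const_mul (-c)
      refine this.congr_deriv ?_
      rw [hc, show (1 - p - 1 : ℝ) = -p by ring]
      simp only [id_eq, one_mul]
      field_simp
      ring
    · intro t ht'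
      have := hbound t (hI t ht').1 (hpos t ht')
      linarith [neg_abs_le (s'' t)]
    · intro t ht' t' ht''
      have h1' : d ^ (1 - p) ≥ s t' ^ (1 - p) :=
        Real.rpow_le_rpow_of_nonpos hd (hI t' ht'').2 (by linarith)
      have h2' : 0 ≤ s t ^ (1 - p) := Real.rpow_nonneg (hpos t ht').le _
      nlinarith
    · have : c * d ^ (1 - p) = (2 * K / (p - 1) * d ^ (1 - p)) / 2 := by rw [hc]; ring
      rw [this]
      have hA2 : 0 ≤ A ^ 2 := sq_nonneg A
      linarith
  -- Step C: either some speed level `A > 0` is reached frequently (then linear escape and an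
  -- integrable force), or `s' → 0`
  by_cases h : ∃ A : ℝ, 0 < A ∧ ∃ᶠ t in atTop, A ≤ s' t
  · obtain ⟨A, hA, hfreq⟩ := h
    obtain ⟨a', ha'₀, ha'⟩ := stepB A hA hfreq
    -- linear growth: `s t - (A/2) t` is monotone on `[a', ∞)`
    have hderiv : ∀ t, a' ≤ t → HasDerivAt (fun x ↦ s x - A / 2 * x) (s' t - A / 2) t := by
      intro t ht'
      have h2 : HasDerivAt (fun x : ℝ ↦ A / 2 * x) (A / 2) t := by
        simpa using (hasDerivAt_id t).const_mul (A / 2)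
      exact (hs t (ha'₀.trans ht')).sub h2
    have hmono : MonotoneOn (fun t ↦ s t - A / 2 * t) (Ici a') := by
      refine monotoneOn_of_hasDerivWithinAt_nonneg (convex_Ici a') (f' := fun t ↦ s' t - A / 2)
        (fun t ht' ↦ (hderiv t ht').continuousAt.continuousWithinAt)
        (fun t ht' ↦ (hderiv t (interior_subset ht')).hasDerivWithinAt) ?_
      intro t ht'
      rw [interior_Ici] at ht'
      have := ha' t (le_of_lt ht')
      linarith
    set T₁ : ℝ := max a' (max 1 (2 * a' - 4 * s a' / A)) with hT₁
    have hT₁a : a' ≤ T₁ := le_max_left _ _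
    have hT₁1 : (1 : ℝ) ≤ T₁ := (le_max_left _ _).trans (le_max_right _ _)
    have hlin : ∀ t, T₁ ≤ t → A / 4 * t ≤ s t := by
      intro t ht'
      have h1 := hmono (self_mem_Ici) (hT₁a.trans ht') (hT₁a.trans ht')
      simp only at h1
      have h2 : 2 * a' - 4 * s a' / A ≤ t := ((le_max_right _ _).trans (le_max_right _ _)).trans ht'
      have h3 : A / 4 * (2 * a' - 4 * s a' / A) = A / 2 * a' - s a' := by
        field_simp
        ring
      nlinarith
    have hpos : ∀ t, T₁ ≤ t → 0 < s t := fun t ht' ↦ by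
      have ht0 : 0 < t := by linarith
      exact lt_of_lt_of_le (by positivity : (0 : ℝ) < A / 4 * t) (hlin t ht')
    -- the force is dominated by an integrable power
    have hdom : ∀ t, T₁ ≤ t → |s'' t| ≤ K * (A / 4) ^ (-p) * t ^ (-p) := by
      intro t ht'
      have ht0 : 0 < t := by linarith
      refine (hbound t (ha'₀.trans (hT₁a.trans ht')) (hpos t ht')).trans ?_
      rw [mul_assoc, ← Real.mul_rpow (by positivity) ht0.le]
      exact mul_le_mul_of_nonneg_left
        (Real.rpow_le_rpow_of_nonpos (by positivity) (hlin t ht') (by linarith)) hK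
    have hint : IntegrableOn s'' (Ioi T₁) := by
      have hg : IntegrableOn (fun t : ℝ ↦ K * (A / 4) ^ (-p) * t ^ (-p)) (Ioi T₁) :=
        ((integrableOn_Ioi_rpow_of_lt (by linarith) (by linarith)).const_mul _)
      have hderiv : IntegrableOn (deriv s') (Ioi T₁) := by
        refine hg.mono' (measurable_deriv s').aestronglyMeasurable ?_
        rw [ae_restrict_iff' measurableSet_Ioi]
        filter_upwards with t ht'
        rw [(hs' t (ha'₀.trans (hT₁a.trans (le_of_lt ht')))).deriv, Real.norm_eq_abs]
        exact hdom t (le_of_lt ht')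
      exact hderiv.congr_fun (fun t ht' ↦ (hs' t (ha'₀.trans (hT₁a.trans (le_of_lt ht')))).deriv)
        measurableSet_Ioi
    exact ⟨_, tendsto_of_integrableOn_deriv (fun t ht' ↦ hs' t (ha'₀.trans (hT₁a.trans ht'))) hint⟩
  · push Not at h
    refine ⟨0, tendsto_order.2 ⟨fun A hA ↦ ?_, fun A hA ↦ ?_⟩⟩
    · have := stepA (-A) (by linarith)
      simpa using this
    · exact (h A hA)

/-! ### The two-body toy in `ℝⁿ`: separation freezes both instantaneous velocities -/

/-- The escape potential `Ψ_m(u) = ∫₀^u K (m + |x|)^{-p} dx` is bounded by `K m^{1-p}/(p-1)` in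
absolute value (`p > 1`, `m > 0`, `K ≥ 0`). [folklore] -/
lemma abs_escapePotential_le {K m p : ℝ} (hK : 0 ≤ K) (hm : 0 < m) (hp : 1 < p) (u : ℝ) :
    |∫ x in (0 : ℝ)..u, K * (m + |x|) ^ (-p)| ≤ K / (p - 1) * m ^ (1 - p) := by
  have hp1 : 0 < p - 1 := by linarith
  have hcont : Continuous fun x : ℝ ↦ K * (m + |x|) ^ (-p) :=
    continuous_const.mul ((continuous_const.add continuous_abs).rpow_const
      fun x ↦ Or.inl (add_pos_of_pos_of_nonneg hm (abs_nonneg x)).ne')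
  rcases le_total 0 u with hu | hu
  · -- `u ≥ 0`: antiderivative `G x = -K/(p-1) (m + x)^{1-p}`
    have hG : ∀ x ∈ uIcc 0 u, HasDerivAt (fun x ↦ -(K / (p - 1)) * (m + x) ^ (1 - p))
        (K * (m + |x|) ^ (-p)) x := by
      intro x hx
      rw [uIcc_of_le hu] at hx
      have hmx : 0 < m + x := by linarith [hx.1]
      have := (((hasDerivAt_id x).const_add m).rpow_const (p := 1 - p) (Or.inl hmx.ne')).const_mul
        (-(K / (p - 1)))
      refine this.congr_deriv ?_
      rw [abs_of_nonneg hx.1, show (1 - p - 1 : ℝ) = -p by ring]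
      simp only [id_eq]
      field_simp
      ring
    rw [integral_eq_sub_of_hasDerivAt hG (hcont.intervalIntegrable _ _)]
    have h1 : (m + u) ^ (1 - p) ≤ m ^ (1 - p) :=
      Real.rpow_le_rpow_of_nonpos hm (by linarith) (by linarith)
    have h2 : 0 ≤ (m + u) ^ (1 - p) := Real.rpow_nonneg (by linarith) _
    have h3 : 0 ≤ K / (p - 1) := div_nonneg hK hp1.le
    rw [add_zero, abs_le]
    constructor <;> nlinarith
  · -- `u ≤ 0`: antiderivative `G x = K/(p-1) (m - x)^{1-p}`
    have hG : ∀ x ∈ uIcc 0 u, HasDerivAt (fun x ↦ (K / (p - 1)) * (m - x) ^ (1 - p))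
        (K * (m + |x|) ^ (-p)) x := by
      intro x hx
      rw [uIcc_of_ge hu] at hx
      have hmx : 0 < m - x := by linarith [hx.2]
      have := (((hasDerivAt_id x).const_sub m).rpow_const (p := 1 - p) (Or.inl hmx.ne')).const_mul
        (K / (p - 1))
      refine this.congr_deriv ?_
      rw [abs_of_nonpos hx.2, show (1 - p - 1 : ℝ) = -p by ring, ← sub_eq_add_neg]
      simp only [id_eq]
      field_simp
      ring
    rw [integral_eq_sub_of_hasDerivAt hG (hcont.intervalIntegrable _ _)]
    have h1 : (m - u) ^ (1 - p) ≤ m ^ (1 - p) :=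
      Real.rpow_le_rpow_of_nonpos hm (by linarith) (by linarith)
    have h2 : 0 ≤ (m - u) ^ (1 - p) := Real.rpow_nonneg (by linarith) _
    have h3 : 0 ≤ K / (p - 1) := div_nonneg hK hp1.le
    rw [sub_zero, abs_le]
    constructor <;> nlinarith

/-- **Escape lemma** (one coordinate of a relative motion). On `[a, ∞)` let `φ` be twice differentiable
with `|φ''| ≤ K (m + |φ|)^{-p}` (`p > 1`, `m > 0`) and `8K m^{1-p}/(p-1) ≤ A²` for some `A > 0`. If
`φ'(a) ≥ A` then `φ' > A/2` on `[a, ∞)`. [folklore] -/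
theorem escape_of_deriv_ge {φ φ' φ'' : ℝ → ℝ} {a K m p A : ℝ} (hp : 1 < p) (hK : 0 ≤ K)
    (hm : 0 < m) (hA : 0 < A)
    (hφ : ∀ t, a ≤ t → HasDerivAt φ (φ' t) t) (hφ' : ∀ t, a ≤ t → HasDerivAt φ' (φ'' t) t)
    (hbound : ∀ t, a ≤ t → |φ'' t| ≤ K * (m + |φ t|) ^ (-p))
    (hsmall : 8 * K / (p - 1) * m ^ (1 - p) ≤ A ^ 2) (ha : A ≤ φ' a) :
    ∀ t, a ≤ t → A / 2 < φ' t := by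
  intro t₂ ht₂
  have hcont : Continuous fun x : ℝ ↦ K * (m + |x|) ^ (-p) :=
    continuous_const.mul ((continuous_const.add continuous_abs).rpow_const
      fun x ↦ Or.inl (add_pos_of_pos_of_nonneg hm (abs_nonneg x)).ne')
  refine ascent_persists (g := fun u ↦ K * (m + |u|) ^ (-p))
    (Ψ := fun u ↦ ∫ x in (0 : ℝ)..u, K * (m + |x|) ^ (-p)) (B := 2 * (K / (p - 1) * m ^ (1 - p)))
    ht₂ hA (fun t ht' ↦ hφ t ht'.1) (fun t ht' ↦ hφ' t ht'.1)
    (fun t _ ↦ (hcont.integral_hasStrictDerivAt 0 (φ t)).hasDerivAt)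
    (fun t ht' ↦ by linarith [hbound t ht'.1, neg_abs_le (φ'' t)]) (fun t _ t' _ ↦ ?_) ?_ ha t₂
    (right_mem_Icc.mpr ht₂)
  · have h1 := abs_escapePotential_le hK hm hp (φ t)
    have h2 := abs_escapePotential_le hK hm hp (φ t')
    rw [abs_le] at h1 h2
    linarith [h1.2, h2.1]
  · have : 2 * (K / (p - 1) * m ^ (1 - p)) = (8 * K / (p - 1) * m ^ (1 - p)) / 4 := by ring
    rw [this]
    linarith

/-- A vector derivative with integrably bounded second derivative converges (coordinatewise
`tendsto_of_integrableOn_deriv` in `ℝⁿ`). [folklore] -/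
lemma tendsto_of_norm_deriv_le_integrable {n : ℕ} {w' w'' : ℝ → (Fin n → ℝ)} {g : ℝ → ℝ} {T : ℝ}
    (hw' : ∀ t, T ≤ t → HasDerivAt w' (w'' t) t) (hg : IntegrableOn g (Ioi T))
    (hle : ∀ t, T ≤ t → ‖w'' t‖ ≤ g t) : ∃ W, Tendsto w' atTop (𝓝 W) := by
  have hk : ∀ k : Fin n, ∃ L, Tendsto (fun t ↦ w' t k) atTop (𝓝 L) := by
    intro k
    have hd : ∀ t, T ≤ t → HasDerivAt (fun t ↦ w' t k) (w'' t k) t := fun t ht' ↦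
      (hasDerivAt_pi.mp (hw' t ht')) k
    have hint : IntegrableOn (fun t ↦ w'' t k) (Ioi T) := by
      have hderiv : IntegrableOn (deriv fun t ↦ w' t k) (Ioi T) := by
        refine hg.mono' (measurable_deriv _).aestronglyMeasurable ?_
        rw [ae_restrict_iff' measurableSet_Ioi]
        filter_upwards with t ht'
        rw [(hd t (le_of_lt ht')).deriv, Real.norm_eq_abs]
        exact ((norm_le_pi_norm (w'' t) k).trans (hle t (le_of_lt ht')))
      exact hderiv.congr_fun (fun t ht' ↦ (hd t (le_of_lt ht')).deriv) measurableSet_Ioi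
    exact ⟨_, tendsto_of_integrableOn_deriv hd hint⟩
  choose L hL using hk
  exact ⟨fun k ↦ L k, tendsto_pi_nhds.mpr hL⟩

/-- **The two-body clean-scale toy, frozen form.** Bounded speeds, relative acceleration
`≤ K ‖ξ₁ - ξ₂‖^{-p}` with `p > 1`, convergent total momentum AND separation `‖ξ₁ - ξ₂‖ → ∞` imply
that both INSTANTANEOUS velocities converge (not only the Cesàro means of `toy_two_body_cesaro`).
[folklore] -/
theorem toy_two_body_frozen {n : ℕ} {ξ₁ ξ₂ v₁ v₂ a₁ a₂ : ℝ → (Fin n → ℝ)}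
    {t₀ K p vmax m₁ m₂ : ℝ} {P : Fin n → ℝ}
    (ht₀ : 0 < t₀) (hp : 1 < p) (hK : 0 ≤ K) (hm₁ : 0 < m₁) (hm₂ : 0 < m₂)
    (h₁ : ∀ t, HasDerivAt ξ₁ (v₁ t) t) (h₁' : ∀ t, HasDerivAt v₁ (a₁ t) t)
    (h₂ : ∀ t, HasDerivAt ξ₂ (v₂ t) t) (h₂' : ∀ t, HasDerivAt v₂ (a₂ t) t)
    (hv : ∀ t, t₀ ≤ t → ‖v₁ t‖ ≤ vmax ∧ ‖v₂ t‖ ≤ vmax)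
    (hrel : ∀ t, t₀ ≤ t → ξ₁ t ≠ ξ₂ t → ‖a₁ t - a₂ t‖ ≤ K * ‖ξ₁ t - ξ₂ t‖ ^ (-p))
    (hP : Tendsto (fun t ↦ m₁ • v₁ t + m₂ • v₂ t) atTop (𝓝 P))
    (hsep : Tendsto (fun t ↦ ‖ξ₁ t - ξ₂ t‖) atTop atTop) :
    (∃ W₁, Tendsto v₁ atTop (𝓝 W₁)) ∧ ∃ W₂, Tendsto v₂ atTop (𝓝 W₂) := by
  obtain ⟨⟨V₁, hV₁⟩, ⟨V₂, hV₂⟩⟩ := toy_two_body_cesaro ht₀ hp hK hm₁ hm₂ h₁ h₁' h₂ h₂' hv hrel hP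
  set w : ℝ → (Fin n → ℝ) := fun t ↦ ξ₁ t - ξ₂ t with hw_def
  set w' : ℝ → (Fin n → ℝ) := fun t ↦ v₁ t - v₂ t with hw'_def
  set w'' : ℝ → (Fin n → ℝ) := fun t ↦ a₁ t - a₂ t with hw''_def
  have hw : ∀ t, HasDerivAt w (w' t) t := fun t ↦ (h₁ t).sub (h₂ t)
  have hw' : ∀ t, HasDerivAt w' (w'' t) t := fun t ↦ (h₁' t).sub (h₂' t)
  have hV : Tendsto (fun t ↦ t⁻¹ • w t) atTop (𝓝 (V₁ - V₂)) := by
    have := hV₁.sub hV₂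
    refine this.congr fun t ↦ ?_
    simp [hw_def, smul_sub]
  -- it suffices that the relative velocity converges
  suffices hw'lim : ∃ W, Tendsto w' atTop (𝓝 W) by
    obtain ⟨W, hW⟩ := hw'lim
    have hM : (m₁ + m₂) ≠ 0 := by positivity
    have hv₁ : Tendsto v₁ atTop (𝓝 ((m₁ + m₂)⁻¹ • (P + m₂ • W))) := by
      have := (hP.add (hW.const_smul m₂)).const_smul (m₁ + m₂)⁻¹
      refine this.congr fun t ↦ ?_
      simp only [hw'_def, smul_sub]
      rw [show m₁ • v₁ t + m₂ • v₂ t + (m₂ • v₁ t - m₂ • v₂ t) = (m₁ + m₂) • v₁ t by module,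
        smul_smul, inv_mul_cancel₀ hM, one_smul]
    have hv₂ : Tendsto v₂ atTop (𝓝 ((m₁ + m₂)⁻¹ • (P + m₂ • W) - W)) := by
      have := hv₁.sub hW
      refine this.congr fun t ↦ ?_
      simp [hw'_def]
    exact ⟨⟨_, hv₁⟩, ⟨_, hv₂⟩⟩
  by_cases hV0 : V₁ - V₂ ≠ 0
  · -- linear separation: the force is integrable
    set V := V₁ - V₂ with hVdef
    have hVpos : 0 < ‖V‖ := norm_pos_iff.mpr hV0
    have hev : ∀ᶠ t in atTop, ‖t⁻¹ • w t - V‖ < ‖V‖ / 2 :=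
      (tendsto_iff_norm_sub_tendsto_zero.mp hV).eventually (gt_mem_nhds (by positivity))
    obtain ⟨T, hT⟩ := ((hev.and (eventually_ge_atTop t₀)).and (eventually_gt_atTop 0))
      |>.exists_forall_of_atTop
    have hTpos : 0 < T := (hT T le_rfl).2
    have hfar : ∀ t, T ≤ t → ‖V‖ / 2 * t ≤ ‖w t‖ := by
      intro t ht'
      obtain ⟨⟨h1, -⟩, h3⟩ := hT t ht'
      have h4 : ‖V‖ - ‖t⁻¹ • w t‖ ≤ ‖t⁻¹ • w t - V‖ := by
        rw [← norm_neg (t⁻¹ • w t - V), neg_sub]; exact norm_sub_norm_le _ _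
      rw [norm_smul, norm_inv, Real.norm_eq_abs, abs_of_pos h3] at h4
      have h5 : ‖V‖ / 2 ≤ t⁻¹ * ‖w t‖ := by linarith
      rw [le_inv_mul_iff₀ h3] at h5
      linarith
    refine tendsto_of_norm_deriv_le_integrable (T := T) (fun t _ ↦ hw' t)
      (g := fun t ↦ K * (‖V‖ / 2) ^ (-p) * t ^ (-p))
      ((integrableOn_Ioi_rpow_of_lt (by linarith) hTpos).const_mul _) fun t ht' ↦ ?_
    obtain ⟨⟨-, h2⟩, h3⟩ := hT t ht'
    have hwpos : 0 < ‖w t‖ := lt_of_lt_of_le (by positivity) (hfar t ht')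
    have hne : ξ₁ t ≠ ξ₂ t := sub_ne_zero.mp (norm_pos_iff.mp hwpos)
    refine (hrel t h2 hne).trans ?_
    rw [mul_assoc, ← Real.mul_rpow (by positivity) h3.le]
    exact mul_le_mul_of_nonneg_left
      (Real.rpow_le_rpow_of_nonpos (by positivity) (hfar t ht') (by linarith)) hK
  · -- Cesàro relative velocity zero: the relative velocity tends to zero
    push Not at hV0
    rw [hV0] at hV
    refine ⟨0, ?_⟩
    by_contra hnot
    obtain ⟨ε, hε, hfreq⟩ : ∃ ε, 0 < ε ∧ ∃ᶠ t in atTop, ε ≤ ‖w' t‖ := by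
      rw [Metric.tendsto_nhds] at hnot
      push Not at hnot
      obtain ⟨ε, hε, h⟩ := hnot
      exact ⟨ε, hε, h.mono fun t ht ↦ by simpa [dist_zero_right] using ht⟩
    set A := ε with hAdef
    have hA : 0 < A := hε
    have hp1 : 0 < p - 1 := by linarith
    set K' := K * 2 ^ p with hK'
    have hK'0 : 0 ≤ K' := by positivity
    -- a separation `m` beyond which an escape at speed `A` cannot be stopped
    obtain ⟨m, hm1, hmA⟩ : ∃ m : ℝ, 1 ≤ m ∧ 8 * K' / (p - 1) * m ^ (1 - p) ≤ A ^ 2 := by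
      have h1 : Tendsto (fun d : ℝ ↦ 8 * K' / (p - 1) * d ^ (-(p - 1))) atTop
          (𝓝 (8 * K' / (p - 1) * 0)) := (tendsto_rpow_neg_atTop hp1).const_mul _
      rw [mul_zero] at h1
      have h2 : ∀ᶠ d : ℝ in atTop, 8 * K' / (p - 1) * d ^ (-(p - 1)) < A ^ 2 :=
        h1.eventually (gt_mem_nhds (by positivity))
      obtain ⟨d, hd1, hd2⟩ := (h2.and (eventually_ge_atTop 1)).exists
      refine ⟨d, hd2, ?_⟩
      rw [show (1 - p : ℝ) = -(p - 1) by ring]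
      exact hd1.le
    have hm : 0 < m := by linarith
    -- late times: separation `≥ m`, `‖w‖ ≤ (A/4) t`, `t ≥ t₀`, `t ≥ 1`
    have hev : ∀ᶠ t in atTop, (m ≤ ‖w t‖ ∧ ‖t⁻¹ • w t‖ ≤ A / 4) ∧ (t₀ ≤ t ∧ 1 ≤ t) := by
      refine ((hsep.eventually (eventually_ge_atTop m)).and ?_).and
        ((eventually_ge_atTop t₀).and (eventually_ge_atTop 1))
      have := (tendsto_iff_norm_sub_tendsto_zero.mp hV).eventually
        (gt_mem_nhds (by positivity : (0 : ℝ) < A / 4))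
      exact this.mono fun t ht ↦ by simpa using ht.le
    obtain ⟨a₀, ha₀⟩ := hev.exists_forall_of_atTop
    obtain ⟨a, hεa, haa₀⟩ := (hfreq.and_eventually (eventually_ge_atTop a₀)).exists
    have hlate : ∀ t, a ≤ t → (m ≤ ‖w t‖ ∧ ‖t⁻¹ • w t‖ ≤ A / 4) ∧ (t₀ ≤ t ∧ 1 ≤ t) :=
      fun t ht' ↦ ha₀ t (haa₀.trans ht')
    -- a coordinate `k` carrying the sup norm of `w' a`
    obtain ⟨k, hk⟩ : ∃ k : Fin n, ‖w' a‖ ≤ |w' a k| := by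
      rcases isEmpty_or_nonempty (Fin n) with hn | hn
      · exfalso
        have : w' a = 0 := Subsingleton.elim _ _
        rw [this, norm_zero] at hεa
        linarith
      · obtain ⟨k, -, hk⟩ := Finset.exists_max_image Finset.univ (fun k ↦ |w' a k|) Finset.univ_nonempty
        refine ⟨k, (pi_norm_le_iff_of_nonneg (abs_nonneg _)).mpr fun i ↦ ?_⟩
        rw [Real.norm_eq_abs]
        exact hk i (Finset.mem_univ i)
    -- orient the coordinate so that the initial velocity is `≥ A`
    set σ : ℝ := if 0 ≤ w' a k then 1 else -1 with hσ
    have hσabs : ∀ x : ℝ, |σ * x| = |x| := fun x ↦ by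
      rw [abs_mul]; split_ifs at hσ <;> simp [hσ]
    have hσa : σ * w' a k = |w' a k| := by
      split_ifs at hσ with h
      · rw [hσ, one_mul, abs_of_nonneg h]
      · rw [hσ, neg_one_mul, abs_of_neg (not_le.mp h)]
    set φ : ℝ → ℝ := fun t ↦ σ * w t k with hφdef
    set φ' : ℝ → ℝ := fun t ↦ σ * w' t k with hφ'def
    set φ'' : ℝ → ℝ := fun t ↦ σ * w'' t k with hφ''def
    have hφ : ∀ t, HasDerivAt φ (φ' t) t := fun t ↦ ((hasDerivAt_pi.mp (hw t)) k).const_mul σ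
    have hφ' : ∀ t, HasDerivAt φ' (φ'' t) t := fun t ↦ ((hasDerivAt_pi.mp (hw' t)) k).const_mul σ
    have hφa : A ≤ φ' a := by
      show A ≤ σ * w' a k
      rw [hσa]; exact hεa.trans hk
    -- the coordinate force bound `|φ''| ≤ K 2^p (m + |φ|)^{-p}`
    have hbound : ∀ t, a ≤ t → |φ'' t| ≤ K' * (m + |φ t|) ^ (-p) := by
      intro t ht'
      obtain ⟨⟨hmw, -⟩, ht₀t, -⟩ := hlate t ht'
      have hwpos : 0 < ‖w t‖ := hm.trans_le hmw
      have hne : ξ₁ t ≠ ξ₂ t := sub_ne_zero.mp (norm_pos_iff.mp hwpos)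
      have h1 : |φ'' t| ≤ ‖w'' t‖ := by
        show |σ * w'' t k| ≤ ‖w'' t‖
        rw [hσabs]; exact norm_le_pi_norm (w'' t) k
      have h2 : |φ t| ≤ ‖w t‖ := by
        show |σ * w t k| ≤ ‖w t‖
        rw [hσabs]; exact norm_le_pi_norm (w t) k
      have h3 : (m + |φ t|) / 2 ≤ ‖w t‖ := by linarith
      have h4 : ‖w t‖ ^ (-p) ≤ ((m + |φ t|) / 2) ^ (-p) :=
        Real.rpow_le_rpow_of_nonpos (by positivity) h3 (by linarith)
      have h5 : ((m + |φ t|) / 2) ^ (-p) = (m + |φ t|) ^ (-p) * 2 ^ p := by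
        rw [Real.div_rpow (by positivity) (by norm_num), Real.rpow_neg (by norm_num : (0:ℝ) ≤ 2),
          div_eq_mul_inv, inv_inv]
      calc |φ'' t| ≤ ‖w'' t‖ := h1
        _ ≤ K * ‖w t‖ ^ (-p) := hrel t ht₀t hne
        _ ≤ K * ((m + |φ t|) / 2) ^ (-p) := mul_le_mul_of_nonneg_left h4 hK
        _ = K' * (m + |φ t|) ^ (-p) := by rw [h5, hK']; ring
    have hesc := escape_of_deriv_ge hp hK'0 hm hA (fun t _ ↦ hφ t) (fun t _ ↦ hφ' t) hbound hmA hφa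
    -- linear growth of `φ`, contradicting `‖w t‖ ≤ (A/4) t`
    have hderiv : ∀ t, HasDerivAt (fun x ↦ φ x - A / 2 * x) (φ' t - A / 2) t := by
      intro t
      have h2 : HasDerivAt (fun x : ℝ ↦ A / 2 * x) (A / 2) t := by
        simpa using (hasDerivAt_id t).const_mul (A / 2)
      exact (hφ t).sub h2
    have hmono : MonotoneOn (fun t ↦ φ t - A / 2 * t) (Ici a) := by
      refine monotoneOn_of_hasDerivWithinAt_nonneg (convex_Ici a) (f' := fun t ↦ φ' t - A / 2)
        (fun t _ ↦ (hderiv t).continuousAt.continuousWithinAt)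
        (fun t _ ↦ (hderiv t).hasDerivWithinAt) ?_
      intro t ht'
      rw [interior_Ici] at ht'
      have := hesc t (le_of_lt ht')
      linarith
    set T₁ : ℝ := max a (2 * a + 4 * |φ a| / A + 1) with hT₁
    have hT₁a : a ≤ T₁ := le_max_left _ _
    have h1 := hmono (self_mem_Ici) hT₁a hT₁a
    simp only at h1
    obtain ⟨⟨-, hsmall⟩, -, hT1⟩ := hlate T₁ hT₁a
    have hT0 : 0 < T₁ := by linarith
    have h2 : |φ T₁| ≤ A / 4 * T₁ := by
      have : |φ T₁| ≤ ‖w T₁‖ := by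
        show |σ * w T₁ k| ≤ ‖w T₁‖
        rw [hσabs]; exact norm_le_pi_norm (w T₁) k
      refine this.trans ?_
      rw [norm_smul, norm_inv, Real.norm_eq_abs, abs_of_pos hT0, inv_mul_le_iff₀ hT0] at hsmall
      linarith
    have h3 : 2 * a + 4 * |φ a| / A + 1 ≤ T₁ := le_max_right _ _
    have h4 : A / 4 * (2 * a + 4 * |φ a| / A + 1) = A / 2 * a + |φ a| + A / 4 := by
      field_simp
      ring
    have h5 : φ T₁ ≤ |φ T₁| := le_abs_self _
    have h6 : -|φ a| ≤ φ a := neg_abs_le _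
    nlinarith

end Frozen

/-! ### The `N`-body clean-scale toy statements (OPEN targets, believed true — see §I and `regimes_note`) -/

section ToyStatement

/-- **The `N`-body clean-scale final-motion toy, Cesàro form** (the honest real-variable shadow of the
crux as typed, cycle 2): `N` world-lines in `ℝⁿ` (sup norm), `C²`, bounded speeds after `t₀`, pairwise
separating (h₄), and CLEAN-CLUSTER BALANCE at every scale `r ≤ t` — for every nonempty cluster `C`
isolated by distance `r` at time `t`, `‖Σ_{i∈C} mᵢ aᵢ(t)‖ ≤ K r^{-p}` (what the weighted clause gives on a
clean sphere of radius `≍ r`, `p = 3/2`; sign-less, potential-less, rate-less) — IMPLY that every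
`ξᵢ(t)/t` converges. `N = 2` is `toy_two_body_cesaro` (up to the `r ≤ t` bookkeeping); `p ≤ 1` is false
(`not_tendsto_div_at_exponent_one`); without h₄ it is false for `N ≥ 3` (momentum shuttle). Implied by
the frozen form (`toyCleanScaleFinalMotion_of_frozen`). -/
def ToyCleanScaleFinalMotion (N n : ℕ) (p : ℝ) : Prop :=
  ∀ (m : Fin N → ℝ) (ξ v a : Fin N → ℝ → (Fin n → ℝ)) (t₀ K vmax : ℝ), 0 < t₀ → 0 ≤ K →
    (∀ i, 0 < m i) → (∀ i t, HasDerivAt (ξ i) (v i t) t) → (∀ i t, HasDerivAt (v i) (a i t) t) →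
    (∀ i t, t₀ ≤ t → ‖v i t‖ ≤ vmax) →
    (∀ i j, i ≠ j → Tendsto (fun t ↦ ‖ξ i t - ξ j t‖) atTop atTop) →
    (∀ (C : Finset (Fin N)) (t r : ℝ), t₀ ≤ t → 0 < r → r ≤ t → C.Nonempty →
      (∀ i ∈ C, ∀ j ∉ C, r ≤ ‖ξ i t - ξ j t‖) → ‖∑ i ∈ C, m i • a i t‖ ≤ K * r ^ (-p)) →
    ∀ i, ∃ V : Fin n → ℝ, Tendsto (fun t ↦ t⁻¹ • ξ i t) atTop (𝓝 V)

/-- **The `N`-body clean-scale final-motion toy, FROZEN form** (cycle 3, §I: the honest target — under h₄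
the toy should freeze INSTANTANEOUS velocities): same hypotheses, and every `vᵢ(t)` converges. `N = 2` is
the theorem `toyCleanScaleFrozenMotion_two` below (`toy_two_body_frozen` plus the `r ≤ t` bookkeeping and
total-momentum convergence from the `C = univ` balance `‖Σ mᵢaᵢ‖ ≤ K t^{-p}`); without h₄ it is false
already for `N = 1` in the trivial way
(`s = sin t`: `|s''| ≤ 1 ≤ K|s|^{-p}`) and for the crux's kinematics (`KinematicShadow`). This is the real
content of lead-b's `stub_expandingChargeKinematics` and a strengthening of lead-0's `stub_cesaroEndgame`. -/
def ToyCleanScaleFrozenMotion (N n : ℕ) (p : ℝ) : Prop :=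
  ∀ (m : Fin N → ℝ) (ξ v a : Fin N → ℝ → (Fin n → ℝ)) (t₀ K vmax : ℝ), 0 < t₀ → 0 ≤ K →
    (∀ i, 0 < m i) → (∀ i t, HasDerivAt (ξ i) (v i t) t) → (∀ i t, HasDerivAt (v i) (a i t) t) →
    (∀ i t, t₀ ≤ t → ‖v i t‖ ≤ vmax) →
    (∀ i j, i ≠ j → Tendsto (fun t ↦ ‖ξ i t - ξ j t‖) atTop atTop) →
    (∀ (C : Finset (Fin N)) (t r : ℝ), t₀ ≤ t → 0 < r → r ≤ t → C.Nonempty →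
      (∀ i ∈ C, ∀ j ∉ C, r ≤ ‖ξ i t - ξ j t‖) → ‖∑ i ∈ C, m i • a i t‖ ≤ K * r ^ (-p)) →
    ∀ i, ∃ W : Fin n → ℝ, Tendsto (v i) atTop (𝓝 W)

/-- The frozen form implies the Cesàro form (coordinatewise `tendsto_div_of_tendsto_deriv`). [folklore] -/
theorem toyCleanScaleFinalMotion_of_frozen {N n : ℕ} {p : ℝ} (h : ToyCleanScaleFrozenMotion N n p) :
    ToyCleanScaleFinalMotion N n p := by
  intro m ξ v a t₀ K vmax ht₀ hK hm hξ hv hvb hsep hbal i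
  obtain ⟨W, hW⟩ := h m ξ v a t₀ K vmax ht₀ hK hm hξ hv hvb hsep hbal i
  refine ⟨W, tendsto_inv_smul_of_coord fun k ↦ ?_⟩
  exact tendsto_div_of_tendsto_deriv (fun t ↦ (hasDerivAt_pi.mp (hξ i t)) k) (tendsto_pi_nhds.mp hW k)

/-- A differentiable world-line with speed `≤ vmax` after `t₀` grows at most linearly. [folklore] -/
lemma norm_le_linear_of_speed_le {n : ℕ} {ξ v : ℝ → (Fin n → ℝ)} {t₀ vmax : ℝ}
    (hξ : ∀ t, HasDerivAt ξ (v t) t) (hv : ∀ t, t₀ ≤ t → ‖v t‖ ≤ vmax) {t : ℝ} (ht : t₀ ≤ t) :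
    ‖ξ t‖ ≤ ‖ξ t₀‖ + vmax * (t - t₀) := by
  have key := Convex.norm_image_sub_le_of_norm_hasDerivWithin_le (f := ξ) (f' := v) (s := Ici t₀)
    (fun x _ ↦ (hξ x).hasDerivWithinAt) (fun x hx ↦ hv x hx) (convex_Ici t₀) self_mem_Ici ht
  rw [Real.norm_eq_abs, abs_of_nonneg (sub_nonneg.mpr ht)] at key
  have := norm_le_norm_add_norm_sub' (ξ t) (ξ t₀)
  linarith [norm_sub_rev (ξ t) (ξ t₀)]

/-- **`N = 2` of the frozen toy is a theorem** (so is `N = 2` of the Cesàro toy, by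
`toyCleanScaleFinalMotion_of_frozen`): the clean-cluster balance with `C = {i}` at scale
`r = min(‖ξ₀ - ξ₁‖, t)` gives the relative force bound of `toy_two_body_frozen` (positions grow at most
linearly, so `min(d, t) ≥ d/C`), and with `C = univ` at scale `t` it gives an integrable total force, hence
convergent total momentum. This is exactly the bookkeeping the leads' endgames need for a pair. [folklore] -/
theorem toyCleanScaleFrozenMotion_two {n : ℕ} {p : ℝ} (hp : 1 < p) : ToyCleanScaleFrozenMotion 2 n p := by
  intro m ξ v a t₀ K vmax ht₀ hK hm hξ hv hvb hsep hbal
  have hvmax : 0 ≤ vmax := (norm_nonneg _).trans (hvb 0 t₀ le_rfl)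
  -- linear growth of the separation after `T := max t₀ 1`
  set T : ℝ := max t₀ 1 with hT
  have hTt₀ : t₀ ≤ T := le_max_left _ _
  have hT1 : (1 : ℝ) ≤ T := le_max_right _ _
  set C₁ : ℝ := ‖ξ 0 t₀‖ + ‖ξ 1 t₀‖ + 2 * vmax + 1 with hC₁
  have hC₁pos : 0 < C₁ := by positivity
  have hdist : ∀ t, T ≤ t → ‖ξ 0 t - ξ 1 t‖ ≤ C₁ * t := by
    intro t ht
    have ht₀t : t₀ ≤ t := hTt₀.trans ht
    have h0 := norm_le_linear_of_speed_le (hξ 0) (hvb 0) ht₀t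
    have h1 := norm_le_linear_of_speed_le (hξ 1) (hvb 1) ht₀t
    have h2 : ‖ξ 0 t - ξ 1 t‖ ≤ ‖ξ 0 t‖ + ‖ξ 1 t‖ := norm_sub_le _ _
    have h3 : (1 : ℝ) ≤ t := hT1.trans ht
    have h4 : 0 ≤ ‖ξ 0 t₀‖ := norm_nonneg _
    have h5 : 0 ≤ ‖ξ 1 t₀‖ := norm_nonneg _
    nlinarith
  -- relative force bound from the singleton balances
  have hsingle : ∀ (i j : Fin 2), i ≠ j → ∀ t, T ≤ t → ξ 0 t ≠ ξ 1 t →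
      ‖a i t‖ ≤ K / m i * C₁ ^ p * ‖ξ 0 t - ξ 1 t‖ ^ (-p) := by
    intro i j hij t ht hne
    have ht₀t : t₀ ≤ t := hTt₀.trans ht
    have htpos : 0 < t := lt_of_lt_of_le one_pos (hT1.trans ht)
    set d := ‖ξ 0 t - ξ 1 t‖ with hd
    have hdpos : 0 < d := norm_pos_iff.mpr (sub_ne_zero.mpr hne)
    set r := min d t with hr
    have hrpos : 0 < r := lt_min hdpos htpos
    have two : ∀ x y : Fin 2, x ≠ y → ‖ξ x t - ξ y t‖ = d := by
      refine Fin.forall_fin_two.mpr ⟨Fin.forall_fin_two.mpr ⟨fun h ↦ absurd rfl h, fun _ ↦ hd.symm⟩,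
        Fin.forall_fin_two.mpr ⟨fun _ ↦ (norm_sub_rev (ξ 1 t) (ξ 0 t)).trans hd.symm,
          fun h ↦ absurd rfl h⟩⟩
    have hbal' := hbal {i} t r ht₀t hrpos (min_le_right _ _) (Finset.singleton_nonempty i) (by
      intro i' hi' j' hj'
      rw [Finset.mem_singleton] at hi' hj'
      rw [two i' j' (by rintro rfl; exact hj' hi')]
      exact min_le_left _ _)
    rw [Finset.sum_singleton, norm_smul, Real.norm_eq_abs, abs_of_pos (hm i)] at hbal'
    -- `r ≥ d / C₁`
    have hrge : d / C₁ ≤ r := by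
      refine le_min ?_ ?_
      · rw [div_le_iff₀ hC₁pos]
        have : (1 : ℝ) ≤ C₁ := by
          have h4 : 0 ≤ ‖ξ 0 t₀‖ := norm_nonneg _
          have h5 : 0 ≤ ‖ξ 1 t₀‖ := norm_nonneg _
          linarith
        nlinarith
      · rw [div_le_iff₀ hC₁pos, mul_comm]
        exact hdist t ht
    have hrpow : r ^ (-p) ≤ (d / C₁) ^ (-p) :=
      Real.rpow_le_rpow_of_nonpos (by positivity) hrge (by linarith)
    have heq : (d / C₁) ^ (-p) = C₁ ^ p * d ^ (-p) := by
      rw [Real.div_rpow hdpos.le hC₁pos.le, Real.rpow_neg hC₁pos.le, div_eq_mul_inv, inv_inv, mul_comm]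
    have hmi := hm i
    calc ‖a i t‖ = (m i)⁻¹ * (m i * ‖a i t‖) := by field_simp
      _ ≤ (m i)⁻¹ * (K * r ^ (-p)) := mul_le_mul_of_nonneg_left hbal' (by positivity)
      _ ≤ (m i)⁻¹ * (K * (C₁ ^ p * d ^ (-p))) := by
          rw [← heq]; exact mul_le_mul_of_nonneg_left (mul_le_mul_of_nonneg_left hrpow hK) (by positivity)
      _ = K / m i * C₁ ^ p * d ^ (-p) := by ring
  have hrel : ∀ t, T ≤ t → ξ 0 t ≠ ξ 1 t →
      ‖a 0 t - a 1 t‖ ≤ (K / m 0 * C₁ ^ p + K / m 1 * C₁ ^ p) * ‖ξ 0 t - ξ 1 t‖ ^ (-p) := by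
    intro t ht hne
    have h0 := hsingle 0 1 (by decide) t ht hne
    have h1 := hsingle 1 0 (by decide) t ht hne
    calc ‖a 0 t - a 1 t‖ ≤ ‖a 0 t‖ + ‖a 1 t‖ := norm_sub_le _ _
      _ ≤ _ := by rw [add_mul]; exact add_le_add h0 h1
  -- total momentum converges (the `C = univ` balance at scale `t`)
  have hP : ∃ P, Tendsto (fun t ↦ m 0 • v 0 t + m 1 • v 1 t) atTop (𝓝 P) := by
    refine tendsto_of_norm_deriv_le_integrable (T := T) (w'' := fun t ↦ m 0 • a 0 t + m 1 • a 1 t)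
      (g := fun t ↦ K * t ^ (-p)) (fun t _ ↦ ((hv 0 t).const_smul (m 0)).add ((hv 1 t).const_smul (m 1)))
      ((integrableOn_Ioi_rpow_of_lt (by linarith) (by linarith)).const_mul K) fun t ht ↦ ?_
    have ht₀t : t₀ ≤ t := hTt₀.trans ht
    have htpos : 0 < t := lt_of_lt_of_le one_pos (hT1.trans ht)
    have := hbal Finset.univ t t ht₀t htpos le_rfl Finset.univ_nonempty
      (fun i _ j hj ↦ absurd (Finset.mem_univ j) hj)
    simpa [Fin.sum_univ_two] using this
  obtain ⟨P, hP⟩ := hP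
  have hTpos : 0 < T := lt_of_lt_of_le one_pos hT1
  have hm0 := hm 0
  have hm1 := hm 1
  have hK₂ : 0 ≤ K / m 0 * C₁ ^ p + K / m 1 * C₁ ^ p := by positivity
  have key := toy_two_body_frozen (t₀ := T) hTpos hp hK₂ (hm 0) (hm 1) (hξ 0) (hv 0) (hξ 1)
    (hv 1) (fun t ht ↦ ⟨hvb 0 t (hTt₀.trans ht), hvb 1 t (hTt₀.trans ht)⟩) hrel hP (hsep 0 1 (by decide))
  intro i
  fin_cases i
  · exact key.1
  · exact key.2

/-- CLOSED (cycle 1 on item 17403; was the ONE `sorry` of this work file in cycle 3): the FROZEN `N`-body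
toy at the crux's exponent `p = 3/2` is the lead's landed theorem
`SublinearIsFree.Toy.toy_frozen_three_halves` (…StubEndgameToyFrozen: all `N`, all `n`; slow-group
induction `Λ(n)` with the empty-band / cross-pair bootstrap — exactly the splitting lemma the cycle-3
near-miss docstring asked for: a persistent pigeonhole velocity gap between a fast and a slow group,
group momenta controlled by `Σ ∫ K max(m, A|t − t_fs|)^{-p}`, individual velocities inside a group not).
The general-`p > 1` statement is retired rather than kept as a `sorry`: only `p = 3/2` (weight `7/4`)
occurs in the crux and the landed proof is exponent-generic. CONSEQUENCE FOR THE DISPROOF: the charge /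
clean-scale toy has NO counterexample for any `N` — every adversarial schedule (momentum shuttle,
balanced double-gap pump, courier chains, breathing triples, partner migration; §E, drefute g3/g4) is
now excluded by a theorem, not by failed search. -/
theorem toyCleanScaleFrozenMotion_three_halves {N n : ℕ} : ToyCleanScaleFrozenMotion N n (3 / 2) :=
  Summit.FinalStateConjecture.FinalStateConjecture.Theorems.SublinearIsFree.Toy.toy_frozen_three_halves

/-- The Cesàro `N`-body toy at `p = 3/2` (from the frozen one). -/
theorem toyCleanScaleFinalMotion_three_halves {N n : ℕ} : ToyCleanScaleFinalMotion N n (3 / 2) :=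
  toyCleanScaleFinalMotion_of_frozen toyCleanScaleFrozenMotion_three_halves

end ToyStatement

/-! ## §J (cycle 1 on item 17403) The four appended antecedent clauses (T), (O), (R), (QS): junk values
at `N = 0`, and the RATED kinematic shadow

(T) eventual lab-time causality and (R) `RaysStayInClosure 𝒟 O` have NO kinematic shadow (they constrain
the chart `Φ` and the region `O`, not the moduli) and are consumed one-for-one by the two new conclusion
conjuncts (§B′: orientation from (T), rays verbatim with `O′ = O`). (O) is a sign convention on the painted
frames (vacuous at `N = 0`; for `N ≥ 1` the lead derives it from (T), `lorentz_apply_zero_pos_of_labTime`).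
(QS) is the only new clause about the moduli: for an isolated slaved hole it is the RATE
`t^{3/4}‖(Λᵢe₀)˙‖ → 0`, exponent `3/4 = 7/4 − 1` (cone weight `d^{7/4}` at `d ≍ t` against the frame-rotation
term `M|Λ̇|/d` of `∂₀G`). Below: at `N = 0` the weight is `1` and (QS) is automatic; and power rates `s < 1`
on `ξ''`, `ξ'''` do not give even Cesàro velocities (landed: `Negative/KinematicShadowRates.lean`, p133268), and the
borderline rate `s = 1` does not give frozen ones (`Negative/KinematicShadowBorderline.lean`, p133634: witness with
phase `log(1 + log(1+t²)/2)`, `|ξ''| ≤ κ²/(t(1 + log(1+t²)/2))`, `|ξ'''| ≤ 3κ²/t²`, `ξ' = ±κ²` frequently). -/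

section NewClauses

/-- JUNK VALUE at `N = 0`: the cone weight `1 + d^{7/4}`, `d = ⨅ᵢ ‖x̲ − ξᵢ(t)‖`, is `1` — an `iInf` over
`Fin 0` is `0` in `ℝ`. So at `N = 0` the weighted `C³` clause is the unweighted one restricted to the cone. -/
theorem coneWeight_eq_one (f : Fin 0 → ℝ) : ENNReal.ofReal (1 + √(√((⨅ i, f i) ^ 7))) = 1 := by
  simp [Real.iInf_of_isEmpty]

/-- JUNK VALUE at `N = 0`: the appended clause (QS) holds AUTOMATICALLY, for ANY painted field `G` and any
`ρ → ∞` — its constraint `ρ t ≤ ⨅ᵢ ‖x̲ − ξᵢ t‖ = 0` fails as soon as `ρ t > 0`, so the constraint set is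
eventually empty and the `iSup` is `0`. (At `N = 0` the crux's `G` is moreover the constant `η`, `∂₀G = 0`.)
Hence (QS) adds nothing to the `N = 0` instance, consistent with §B′. -/
theorem qsClause_of_noHoles (κ : ℝ) (ξ : Fin 0 → ℝ → E3) (G : E4 → E4 →L[ℝ] E4 →L[ℝ] ℝ) (ρ : ℝ → ℝ)
    (hρ : Tendsto ρ atTop atTop) :
    Tendsto (fun t : ℝ ↦ ⨆ x ∈ {x : E4 | x 0 = t ∧ E4.spatialNorm x ≤ κ * t ∧
      ρ t ≤ ⨅ i, ‖E4.spatial x - ξ i t‖}, ENNReal.ofReal (1 + √(√((⨅ i, ‖E4.spatial x - ξ i t‖) ^ 7))) *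
        ‖fderiv ℝ G x (E4.basisVector 0)‖ₑ) atTop (𝓝 0) := by
  apply tendsto_const_nhds.congr'
  filter_upwards [hρ.eventually (eventually_gt_atTop 0)] with t ht
  symm
  refine ENNReal.iSup_eq_zero.mpr fun x ↦ ENNReal.iSup_eq_zero.mpr fun hx ↦ ?_
  have h3 := hx.2.2
  rw [Real.iInf_of_isEmpty] at h3
  exact absurd h3 (not_le.mpr ht)

/-- The (QS) RATE EXPONENT: the cone weight exponent `7/4` minus the decay exponent `1` of the frame-rotation
term `M|Λ̇|/d` of `∂₀G` is `3/4`, and `t^{-3/4}` is NOT integrable at infinity — so (QS) bounds the painted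
accelerations by a non-summable rate. (Arithmetic record; the necessity theorem itself is the lead's
`…StubWeightedRatesNecessityQS`.) [folklore] -/
theorem qsRate_not_integrable : (7 / 4 : ℝ) - 1 = 3 / 4 ∧ ¬ IntegrableOn (fun t : ℝ ↦ t ^ (-(3 / 4 : ℝ))) (Ioi 1) := by
  refine ⟨by norm_num, fun h ↦ ?_⟩
  have := (integrableOn_Ioi_rpow_iff zero_lt_one).mp h
  norm_num at this

/-- The RATED KINEMATIC SHADOW of the restated crux for one centre along one axis: `KinematicShadow` with the
rate-free decay of `ξ''`, `ξ'''` UPGRADED to the power rates `t^s ξ''(t) → 0`, `t^s ξ⁽³⁾(t) → 0` for every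
`s < 1` (what (QS) plus slaving can give is `s = 3/4`). -/
def RatedKinematicShadow (κ : ℝ) (ξ : ℝ → ℝ) : Prop :=
  ContDiff ℝ ((⊤ : ℕ∞) : WithTop ℕ∞) ξ ∧ 0 < κ ∧ κ < 1 ∧ (∀ᶠ t in atTop, |ξ t| ≤ κ ^ 2 * t) ∧
    (∀ t, |deriv ξ t| ≤ κ ^ 2) ∧ (∀ s : ℝ, s < 1 → Tendsto (fun t ↦ t ^ s * deriv^[2] ξ t) atTop (𝓝 0)) ∧
      (∀ s : ℝ, s < 1 → Tendsto (fun t ↦ t ^ s * deriv^[3] ξ t) atTop (𝓝 0))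

/-- Rated ⇒ rate-free (`s = 0`): refuting the rated shadow is the STRONGER negative statement. [folklore] -/
theorem RatedKinematicShadow.kinematicShadow {κ : ℝ} {ξ : ℝ → ℝ} (h : RatedKinematicShadow κ ξ) :
    KinematicShadow κ ξ :=
  ⟨h.1, h.2.1, h.2.2.1, h.2.2.2.1, h.2.2.2.2.1, by simpa using h.2.2.2.2.2.1 0 zero_lt_one,
    by simpa using h.2.2.2.2.2.2 0 zero_lt_one⟩

/-- A function bounded by `C/t` after time `1` is `o(t^{-s})` for every `s < 1`. [folklore] -/
theorem tendsto_rpow_mul_of_abs_le_inv {f : ℝ → ℝ} {C : ℝ} (hf : ∀ t, 1 ≤ t → |f t| ≤ C * t⁻¹)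
    {s : ℝ} (hs : s < 1) : Tendsto (fun t ↦ t ^ s * f t) atTop (𝓝 0) := by
  have hlim : Tendsto (fun t : ℝ ↦ C * t ^ (s - 1)) atTop (𝓝 0) := by
    have h := (tendsto_rpow_neg_atTop (by linarith : 0 < 1 - s)).const_mul C
    rw [mul_zero] at h
    convert h using 2
    rw [neg_sub]
  refine squeeze_zero_norm' ?_ hlim
  filter_upwards [eventually_ge_atTop 1] with t ht
  have ht0 : 0 < t := by linarith
  rw [Real.norm_eq_abs, abs_mul, abs_of_nonneg (Real.rpow_nonneg ht0.le s)]
  calc t ^ s * |f t| ≤ t ^ s * (C * t⁻¹) := mul_le_mul_of_nonneg_left (hf t ht) (Real.rpow_nonneg ht0.le s)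
    _ = C * t ^ (s - 1) := by
        rw [Real.rpow_sub_one ht0.ne']; ring

/-- The witness satisfies the RATED shadow with `κ = 1/2`: `|ξ''| ≤ 1/(4t)` and `|ξ⁽³⁾| ≤ 1/(2t)` are
`o(t^{-s})` for every `s < 1`. [folklore] -/
theorem ratedKinematicShadow_centre : RatedKinematicShadow (1 / 2) (centre (1 / 4)) := by
  obtain ⟨h1, h2, h3, h4, h5, -, -⟩ := kinematicShadow_centre
  refine ⟨h1, h2, h3, h4, h5, fun s hs ↦ ?_, fun s hs ↦ ?_⟩
  · exact tendsto_rpow_mul_of_abs_le_inv (fun t ht ↦ abs_deriv2_centre_le (1 / 4) (by linarith)) hs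
  · refine tendsto_rpow_mul_of_abs_le_inv (C := 2 * |(1 / 4 : ℝ)|) (fun t ht ↦ ?_) hs
    rw [deriv3_centre, abs_mul]
    calc |(1 / 4 : ℝ)| * |jerk t| ≤ |(1 / 4 : ℝ)| * (2 * t⁻¹) :=
        mul_le_mul_of_nonneg_left (abs_jerk_le ht) (abs_nonneg _)
      _ = 2 * |(1 / 4 : ℝ)| * t⁻¹ := by ring

/-- **(QS)-type rates do not rescue the kinematic route**: the rated shadow does not give Cesàro velocities
(hence not frozen ones either). Same witness; landed as `Negative/KinematicShadowRates.lean`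
(`inertialRecession_false_without_fieldEquations_rated[_frozen]`, inline statements). So after the rev-6
restatement the load-bearing input is unchanged: an INTEGRABLE momentum balance from the field equations
(`tendsto_of_integrableOn_deriv`), which no power rate `s < 1` — in particular not (QS)'s `3/4` — supplies. -/
theorem inertialRecession_false_without_fieldEquations_rated :
    ¬ ∀ (κ : ℝ) (ξ : ℝ → ℝ), RatedKinematicShadow κ ξ → CesaroShadow ξ := fun h ↦
  not_tendsto_centre_div (by norm_num : (1 / 4 : ℝ) ≠ 0) (h _ _ ratedKinematicShadow_centre)

/-- Sanity: the rated refutation recovers §G (and hence §C). -/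
example : ¬ InertialRecessionWithoutFieldEquationsCesaro := fun h ↦
  inertialRecession_false_without_fieldEquations_rated fun κ ξ hr ↦ h κ ξ hr.kinematicShadow

end NewClauses

/-! ## §K (cycle 1 on item 17403) Why the RESTATED crux resists (documentation only) -/

section OneWay

variable {X : Type} [TopologicalSpace X] [ChartedSpace E3 X] [IsManifold (𝓡 3) ((⊤ : ℕ∞) : WithTop ℕ∞) X]
  [T2Space X] [SecondCountableTopology X] [ConnectedSpace X] {D : InitialDataSet (𝓡 3) X}

omit [T2Space X] [SecondCountableTopology X] in
/-- **ONE-WAY PAINTED HORIZONS** (§K item 3, a CONSEQUENCE of two antecedent clauses, recorded for the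
re-charting provers): under the exhaustion clause (`hexh`, verbatim) and eventual lab-time causality (T)
(`hT`, verbatim), with `Φ` injective on the late region (from the open-embedding clause) and
`rinᵢ < r₊ᵢ` (from the core clause), NO point of the chart at lab time `> max τ₀ τ₁` that lies in the
guaranteed region `{∀ i, rinᵢ < rᵢ}` but inside some painted horizon (`¬ ∀ i, r₊ᵢ < rᵢ`) belongs to `O`.
Since `O = J⁺(ιX) ∩ I⁻(Φ(late painted exterior))`, such a point (if in `J⁺(ιX)`) can never reach the
painted exterior along a future timelike curve: the painted balls `{rᵢ ≤ r₊ᵢ}` are one-way at all late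
lab times. For H′ this constrains the handoff chart (painted horizons must track the true event
horizon from INSIDE the black hole region); for E′ it is a gift (the true horizon cuts every late
painted near zone in `{rᵢ ≥ r₊ᵢ}`, where `HasExhaustiveCharts` (ii) wants the certified slabs to end).
Proof: exhaustion at any `t₁' ∈ (max τ₀ τ₁, x⁰)` puts `Φ x` in `J⁻(Φ y)` for some `y` with `y⁰ = t₁'`
in the painted exterior; (T) then gives `x⁰ ≤ y⁰ = t₁' < x⁰`. -/
theorem not_mem_exterior_of_paintedInterior (𝒟 : VacuumCauchyDevelopment D) {N : ℕ}
    (M a rin : Fin N → ℝ) (Λ : Fin N → ℝ → lorentzGroup) (ξ : Fin N → ℝ → E3) {τ₀ τ₁ : ℝ}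
    {U : Opens E4} {Φ : U → 𝒟.carrier} {O : Set 𝒟.carrier}
    (hinj : InjOn Φ {x : U | τ₀ < x.1 0})
    (hrin : ∀ i, rin i < Kerr.rPlus (M i) (a i))
    (hexh : ∀ t₁ : ℝ, τ₀ < t₁ → O \ Φ '' {x : U | t₁ < x.1 0 ∧ ∀ i, Kerr.rPlus (M i) (a i) <
      Kerr.radius (a i) (poincareInv (Λ i (x.1 0)) (E4.ofTimeSpace (x.1 0) (ξ i (x.1 0))) x.1)} ⊆
      𝒟.metric.causalPast 𝒟.timeOrientation (Φ '' {x : U | x.1 0 = t₁ ∧ ∀ i, Kerr.rPlus (M i) (a i) <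
      Kerr.radius (a i) (poincareInv (Λ i (x.1 0)) (E4.ofTimeSpace (x.1 0) (ξ i (x.1 0))) x.1)}))
    (hT : ∀ x y : U, (τ₁ < x.1 0 ∧ ∀ i, rin i < Kerr.radius (a i) (poincareInv (Λ i (x.1 0))
      (E4.ofTimeSpace (x.1 0) (ξ i (x.1 0))) x.1)) → (τ₁ < y.1 0 ∧ ∀ i, rin i < Kerr.radius (a i)
      (poincareInv (Λ i (y.1 0)) (E4.ofTimeSpace (y.1 0) (ξ i (y.1 0))) y.1)) →
      Φ y ∈ 𝒟.metric.causalFuture 𝒟.timeOrientation {Φ x} → x.1 0 ≤ y.1 0)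
    {x : U} (hx₀ : τ₀ < x.1 0) (hx₁ : τ₁ < x.1 0)
    (hxin : ∀ i, rin i < Kerr.radius (a i) (poincareInv (Λ i (x.1 0)) (E4.ofTimeSpace (x.1 0) (ξ i (x.1 0))) x.1))
    (hxnot : ¬ ∀ i, Kerr.rPlus (M i) (a i) <
      Kerr.radius (a i) (poincareInv (Λ i (x.1 0)) (E4.ofTimeSpace (x.1 0) (ξ i (x.1 0))) x.1)) :
    Φ x ∉ O := by
  intro hxO
  set t₁' : ℝ := (max τ₀ τ₁ + x.1 0) / 2 with ht₁'
  have hmax : max τ₀ τ₁ < x.1 0 := max_lt hx₀ hx₁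
  have hlo : max τ₀ τ₁ < t₁' := by rw [ht₁']; linarith
  have hhi : t₁' < x.1 0 := by rw [ht₁']; linarith
  have hτ₀ : τ₀ < t₁' := (le_max_left _ _).trans_lt hlo
  have hτ₁ : τ₁ < t₁' := (le_max_right _ _).trans_lt hlo
  -- `Φ x` is not in the late painted exterior after `t₁'` (injectivity on the late region)
  have hnotin : Φ x ∉ Φ '' {z : U | t₁' < z.1 0 ∧ ∀ i, Kerr.rPlus (M i) (a i) <
      Kerr.radius (a i) (poincareInv (Λ i (z.1 0)) (E4.ofTimeSpace (z.1 0) (ξ i (z.1 0))) z.1)} := by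
    rintro ⟨z, hz, hzx⟩
    have hz0 : τ₀ < z.1 0 := hτ₀.trans hz.1
    have : z = x := hinj hz0 hx₀ hzx
    subst this
    exact hxnot hz.2
  -- exhaustion at `t₁'`
  have hJ := hexh t₁' hτ₀ ⟨hxO, hnotin⟩
  have hJ' : ∃ q ∈ Φ '' {z : U | z.1 0 = t₁' ∧ ∀ i, Kerr.rPlus (M i) (a i) <
      Kerr.radius (a i) (poincareInv (Λ i (z.1 0)) (E4.ofTimeSpace (z.1 0) (ξ i (z.1 0))) z.1)},
      Φ x ∈ 𝒟.metric.causalPast 𝒟.timeOrientation {q} := by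
    unfold LorentzianMetric.causalPast at hJ ⊢
    rw [LorentzianMetric.causalFuture_eq_biUnion] at hJ
    simpa only [mem_iUnion, exists_prop] using hJ
  obtain ⟨q, ⟨y, hy, rfl⟩, hq⟩ := hJ'
  -- (T): lab time is monotone along the causal curve from `Φ x` to `Φ y`
  have hfut : Φ y ∈ 𝒟.metric.causalFuture 𝒟.timeOrientation {Φ x} :=
    LorentzianMetric.mem_causalPast_singleton_iff.mp hq
  have hle := hT x y ⟨hx₁, hxin⟩ ⟨by rw [hy.1]; exact hτ₁, fun i ↦ (hrin i).trans (hy.2 i)⟩ hfut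
  rw [hy.1] at hle
  linarith

omit [T2Space X] [SecondCountableTopology X] in
/-- Corollary (the membrane form): with `O = exteriorOf 𝒟 (Φ(late painted exterior))` verbatim, a late
guaranteed-region chart point inside a painted horizon that lies in `J⁺(ιX)` has NO point of the late
painted exterior in its chronological future — nothing timelike escapes the painted ball, at any late
lab time (not just asymptotically). In particular every painted-horizon tube point is such a point, so
the tubes bound the past set `I⁻(Φ(late painted exterior))` inside the chart exactly. -/
theorem not_mem_chronologicalPast_of_paintedInterior (𝒟 : VacuumCauchyDevelopment D) {N : ℕ}
    (M a rin : Fin N → ℝ) (Λ : Fin N → ℝ → lorentzGroup) (ξ : Fin N → ℝ → E3) {τ₀ τ₁ : ℝ}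
    {U : Opens E4} {Φ : U → 𝒟.carrier} {O : Set 𝒟.carrier}
    (hinj : InjOn Φ {x : U | τ₀ < x.1 0})
    (hrin : ∀ i, rin i < Kerr.rPlus (M i) (a i))
    (hO : O = Summit.FinalStateConjecture.exteriorOf 𝒟.toCauchyDevelopment (Φ '' {x : U | τ₀ < x.1 0 ∧
      ∀ i, Kerr.rPlus (M i) (a i) < Kerr.radius (a i) (poincareInv (Λ i (x.1 0))
      (E4.ofTimeSpace (x.1 0) (ξ i (x.1 0))) x.1)}))
    (hexh : ∀ t₁ : ℝ, τ₀ < t₁ → O \ Φ '' {x : U | t₁ < x.1 0 ∧ ∀ i, Kerr.rPlus (M i) (a i) <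
      Kerr.radius (a i) (poincareInv (Λ i (x.1 0)) (E4.ofTimeSpace (x.1 0) (ξ i (x.1 0))) x.1)} ⊆
      𝒟.metric.causalPast 𝒟.timeOrientation (Φ '' {x : U | x.1 0 = t₁ ∧ ∀ i, Kerr.rPlus (M i) (a i) <
      Kerr.radius (a i) (poincareInv (Λ i (x.1 0)) (E4.ofTimeSpace (x.1 0) (ξ i (x.1 0))) x.1)}))
    (hT : ∀ x y : U, (τ₁ < x.1 0 ∧ ∀ i, rin i < Kerr.radius (a i) (poincareInv (Λ i (x.1 0))
      (E4.ofTimeSpace (x.1 0) (ξ i (x.1 0))) x.1)) → (τ₁ < y.1 0 ∧ ∀ i, rin i < Kerr.radius (a i)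
      (poincareInv (Λ i (y.1 0)) (E4.ofTimeSpace (y.1 0) (ξ i (y.1 0))) y.1)) →
      Φ y ∈ 𝒟.metric.causalFuture 𝒟.timeOrientation {Φ x} → x.1 0 ≤ y.1 0)
    {x : U} (hx₀ : τ₀ < x.1 0) (hx₁ : τ₁ < x.1 0)
    (hxin : ∀ i, rin i < Kerr.radius (a i) (poincareInv (Λ i (x.1 0)) (E4.ofTimeSpace (x.1 0) (ξ i (x.1 0))) x.1))
    (hxnot : ¬ ∀ i, Kerr.rPlus (M i) (a i) <
      Kerr.radius (a i) (poincareInv (Λ i (x.1 0)) (E4.ofTimeSpace (x.1 0) (ξ i (x.1 0))) x.1))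
    (hJ : Φ x ∈ 𝒟.metric.causalFuture 𝒟.timeOrientation (range 𝒟.embed)) :
    Φ x ∉ 𝒟.metric.chronologicalPast 𝒟.timeOrientation (Φ '' {x : U | τ₀ < x.1 0 ∧
      ∀ i, Kerr.rPlus (M i) (a i) < Kerr.radius (a i) (poincareInv (Λ i (x.1 0))
      (E4.ofTimeSpace (x.1 0) (ξ i (x.1 0))) x.1)}) := fun h ↦
  not_mem_exterior_of_paintedInterior 𝒟 M a rin Λ ξ hinj hrin hexh hT hx₀ hx₁ hxin hxnot
    (hO ▸ ⟨hJ, h⟩)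

end OneWay


/-- WHY IT RESISTS after rev 6 — the adversary's census for item 17403 (2026-08-17).

1. WHAT CHANGED FOR THE ADVERSARY. The antecedent GREW by (T), (O), (R), (QS); the conclusion grew by
   `RaysStayInClosure 𝒟 O′`, honest radii in `HasExhaustiveCharts`, and `IsFutureOriented d`. Every earlier
   attack (§C–§I, drefute g2–g4) used only the twelve old clauses, so all earlier NEGATIVE results hold
   verbatim, and every earlier near-miss against the crux is WEAKER now (a counterexample must additionally
   certify (T), (O), (R), (QS)). The census' two inputs that were "underivable on E's side" — lab-time
   causality / orientation and the painted RATE (QS) — are now hypotheses: the two mechanisms by which an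
   honest MGHD could have met the old antecedent and dodged the conclusion (M2: a causal curve leaving the
   chart through its `x⁰ = ∞` end and re-entering earlier; N4/N5: jittering or slowly pumped painted frames)
   are excluded by fiat. They would now refute H′ (ModulatedKerrHandoff), not E′.
2. THE NEW CONCLUSION CONJUNCTS ARE PAID ONE-FOR-ONE (checked at `N = 0` in §B′ with the lead's lemmas,
   and definitionally for `N ≥ 1`): `RaysStayInClosure` ← (R) with `O′ = O` (the re-charting keeps the lab
   `O`; push-up `I⁻(J⁻S) = I⁻S` moves `τ₀`); `IsFutureOriented` (ii)/(iii) ← (T) via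
   `isFutureDirected_mfderiv_of_labTimeCausality` + `C⁰` closeness, using that the hole-chart domain is the
   boosted Kerr EXTERIOR `{r > max r₊ 0}` on which `g_{M,a}(V,V) = −1 − 2H ≤ −1`
   (`Kerr.bilin_timeVector_timeVector_neg`) — no sign trap in the Statement's `Kerr.timeVector`
   (`V = e₀ − 2Hℓ♯`, `g(V,·) = −dt*`); `IsFutureOriented` (i) ← (O); honest radii
   `max(r₊,0) + 1 ≤ Rᵢ(τ) → ∞` ← free, since the near-zone convergence must hold along SOME `Rᵢ → ∞` anyway
   and `R ↦ max(R, r₊ + 1)` preserves both clauses.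
3. JUNK / DEGENERATE INSTANCES. `N = 0`: a theorem (§B′). `M = 0` holes are excluded (`IsSubextremal`:
   `|a| < M`). Empty `X`: excluded upstream (admissible data are complete one-ended AF). Time-reversed lab
   chart: excluded twice — by `Φ(late) ⊆ O ⊆ J⁺(ιX)` (a past-asymptotically-isometric chart on `{x⁰ > τ₀}`
   cannot sit inside `J⁺(Σ)` of a globally hyperbolic development: finite Lorentzian distance from `Σ`) and
   now by (T) directly. Painted horizon OUTSIDE the true one: excluded by exhaustion + (T) (a point `Φx` with
   `rin < rᵢ(x) ≤ r₊ᵢ` at lab time `t₂` that still reaches the painted exterior lies in `O`, hence in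
   `J⁻(Φ(slab t₁))` for every `t₁ ∈ (τ₀, t₂)`, contradicting lab-time monotonicity) — so under the
   antecedent the painted balls `{rᵢ ≤ r₊ᵢ}` are ONE-WAY at all late lab times: a constraint on H′'s chart
   (horizon-tracking from inside), a gift to E′'s re-charting (the true event horizon cuts every late
   painted near zone at `r ≥ r₊`, exactly where `HasExhaustiveCharts` (ii) wants the certified slabs to end).
   SHARPER (for the H′ side; the antecedent text is shared verbatim): painted-exterior points are in
   `I⁻(Φ(late exterior))` trivially, so inside the late guaranteed region the boundary of the past set
   `I⁻(Φ(late exterior))` IS the union of the painted horizon tubes `{rᵢ = r₊ᵢ}` — EXACTLY, at every late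
   lab time, not asymptotically. Boundaries of past sets are achronal (O'Neill 1983, 14.27), so an honest
   handoff chart must paint each `r₊ᵢ`-sphere onto a `g`-ACHRONAL one-way membrane of the true metric (e.g.
   the true event horizon itself: horizon-normalised gauge), although the painted outgoing expansion at
   `r = r₊` is only marginally zero (no robustness margin under `h ≠ 0`). Stability theorems in print do
   deliver horizon-normalised gauges (double-null / `t*`-foliations adapted to `𝓗⁺`), so this is a demand
   on H′'s constructor, not an inconsistency; but a handoff painted in any NON-horizon-adapted gauge
   violates E′'s antecedent outright — worth a line in H′'s disproof file.
4. REGIMES. (a) Hyperbolic recession `D ≍ t`: EIH forces `≍ M²/t²`, integrable with room; (QS) holds with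
   rate `t^{-5/4}`; no obstruction. (b) Parabolic or slower clusters `D ≲ t^{3/4}`: the instantaneous
   superposed ansatz misses the cluster's binding/quadrupole far field `≍ MᵢMⱼ/(D d)` at `d ≍ t`, which the
   `m = 0` weighted clause tolerates only if `t^{3/4}MᵢMⱼ/D → 0` — such developments are OUTSIDE the
   antecedent (census §1(c); not formalised: it needs the far field of honest two-hole data vs the
   superposition, a CAS-sized symbolic check recorded as the cheapest falsifier of idea
   `slow-clusters-are-not-admissible`). Either way E′ is untouched: if the check fails, (QS) is false for
   slow clusters and the handoff cannot certify it — H′'s problem. (c) Intermediate `t^{3/4} ≪ D ≪ t`: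
   forces `M²/D² ≪ t^{-3/2}`, integrable; the charge toy's clean-scale balance `K d^{-3/2}` covers it and
   is a theorem for all `N` (`toyCleanScaleFrozenMotion_three_halves`).
5. PRINT. Newtonian final motions with `R = O(t)`: `rᵢ = Aᵢt + O(t^{2/3})` and velocities converge
   (Chazy 1922; Marchal–Saari 1976; Saari 1971) — no bounded-speed, all-distances-diverging family with a
   wandering `ξᵢ/t` exists there; super-hyperbolic and non-collision-singularity families (Xia, Gerver,
   arXiv:2302.12410) violate bounded speed / the cone. PN/EFT binary dynamics: unbound (scattering) orbits
   have asymptotic velocities by integrability of `1/r²` forces; bound ones merge or stay bounded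
   (excluded by h₄). Rigorous GR multi-hole spacetimes in print are constructive (Hintz's glued small holes
   along geodesics, arXiv:2306.07409 / 2408.06715; KS-type superpositions as initial data) and all recede
   inertially by construction. Nothing adversarial found.
6. WHAT IS LEFT (prover-side, no counterexample candidate for any of it): the general-`|S|` increment
   oracle (Mathlib-only), COER + slaving assembly, the `a ≠ 0` causal clauses of the re-charting, the
   `O′ = O` push-up lemma `I⁻(J⁻S) = I⁻S` for developments, and the common-`τ₁` exhaustion transfer across
   `γ`-dilated hole slabs. A disprover re-armed on a picked line should attack THOSE stubs' exact
   signatures (joint sufficiency, dropped hypotheses), not the crux. -/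
theorem regimes_note_rev6 : True := trivial


/-! ## §E Open regimes (documentation only) -/

/-- OPEN REGIMES / WHY IT RESISTS (no Lean content; a `True` carrier for the docstring; cycle 2 update, cycle 3 amendments).
* WHAT A COUNTEREXAMPLE WOULD HAVE TO DO (given §G: the conclusion needs only Cesàro velocities and
  adiabaticity): exhibit an MGHD, `C³`-asymptotic to a modulated multi-Kerr–Schild ansatz with all
  `‖ξᵢ - ξⱼ‖ → ∞` and `‖ξᵢ‖ ≤ κ²t`, in which some `ξᵢ(t)/t` does NOT converge — i.e. hole `i` changes its
  mean velocity by `O(1)` on every `e`-fold of time, forever. Momentum for that must come through clean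
  spheres: at scale `θt` the flux is `ε² (θt)^{-3/2}`, whose integral over `[t, ∞)` is `O(ε² t^{-1/2}) → 0`
  — so an ISOLATED hole (or an isolated cluster's centre of energy) is frozen to `o(1)` after time `t`
  WITHOUT any rate; a non-isolated hole has a partner at distance `d(t) = o(t)` and the pair's relative
  coordinate obeys `|w''| ≲ K d^{-3/2}`: §H's crossing lemma (`p = 3/2 > 1`) makes `w/t` converge. For
  `N ≥ 3` the missing piece is the cluster induction: (a) fast encounters are harmless — a fly-by at
  closest distance `D → ∞` (forced by h₄) with relative speed `v` transfers impulse
  `≲ ∫ K (D² + v²s²)^{-p/2} ds ≍ K D^{1-p}/v → 0`; (b) weak forces cannot hold fast relative motion at close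
  range (`v_rel² ≲ d · K d^{-p} = K d^{1-p} → 0`), so persistent partners share their Cesàro velocity;
  (c) memberships of `θt`-clusters can only change through (a) or (b). No toy trajectory violating the
  conclusion is known to this seat; a Lean proof of the `N`-body toy is real work (Marchal–Saari-type
  combinatorics) and is the natural next Negative-lane target if a lead wants the mechanism certified.
* NEAR-MISS OF CYCLE 2 — THE MOMENTUM SHUTTLE (the only toy mechanism found that is NOT excluded by
  momentum bookkeeping alone): heavy holes 1, 3 receding at relative speed `w ∈ {w_lo < α, w_hi > β}`
  alternately, a light hole 2 ferrying momentum between them in `≍ 1/u_k` round trips per switch with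
  relative speed `u_k → 0` and turnaround distance `d_k → ∞`; in log-time `ρ = d₁₃/t` obeys
  `dρ/dτ = w - ρ`, so HOLDING each `w` for a few `e`-folds swings `ρ` across `[α, β]` forever, and every
  clean-cluster balance inequality is satisfied (checked: singletons, pairs, the triple). It dies on
  kinematics: the shuttle must be turned around by BOTH heavy holes, i.e. be slow relative to both
  (`speed_sq_le_of_turnaround`: `u_rel² ≤ 2K d^{1-p}/(p-1) → 0`), impossible once `|v₃ - v₁| = w_hi > 0`
  (`shuttle_triangle`). Chains of intermediate-velocity holes fail the same way for fixed `N` (velocity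
  increments `w/N` are eventually above the turnaround budget). Persistent close partners cannot store
  `O(1)` momentum swings either (`norm_deriv_le_of_confined`: relative speed `≲ √(K D d^{-p}) → 0`, and
  the pair's centre is frozen). This is why the `N ≥ 3` toy is believed TRUE; the rigorous induction
  (pairwise `d_ij/t` converges ⇒ clusters ⇒ Cesàro) is planner/prover work.
* h₄ (pairwise separation `→ ∞`) IS LOAD-BEARING FOR THE `N ≥ 3` TOY (though §F argues it is implied
  inside the crux): with turnaround distances allowed to stay BOUNDED, the momentum shuttle above is a
  genuine toy counterexample (a force `K d_enc^{-p} = O(1)` at bounded `d_enc` does reverse `O(1)`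
  relative speeds), so any `N ≥ 3` proof must use `d_ij → ∞`; the two-body toy does not
  (`toy_two_body_cesaro` assumes no separation).
* TAUBERIAN UPGRADE (`tendsto_deriv_of_tendsto_div_of_deriv2_ge`, §H) — SUPERSEDED IN CYCLE 3 (§I): Cesàro PLUS
  a one-sided acceleration bound `ξ'' ≥ -B/t` gives back FROZEN velocities (Hardy–Littlewood; Saari 2005,
  Thm. 4.11, PDF p. 180), and with the clean-sphere force `K d_min^{-3/2}` that condition holds iff
  `d_min ≳ t^{2/3}`. Cycle 2 inferred that a sub-parabolic persistent partner "can keep an instantaneous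
  velocity wandering". WRONG for the toy: under h₄ the energy arguments of §I freeze instantaneous velocities
  at EVERY separation scale (descents cannot be turned around or last, ascents persist and become linear;
  confined pairs are slow by `norm_deriv_le_of_confined`, `u ≲ √(d · K d^{-p}) = √K d^{(1-p)/2} → 0`). What
  survives of the remark: without h₄ instantaneous velocities do wander (`s = sin t`), and the PARABOLIC scale
  `t^{1/p}` is still where individual impulses stop being integrable — it governs HOW a proof must argue
  (cluster momenta, not single-hole momenta), not WHAT is true.
* INSTANTANEOUS VS CESÀRO FOR THE LEADS (cycle 3): lead-0's `stub_cesaroEndgame` (Cesàro) and lead-b's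
  `stub_expandingChargeKinematics` (S4, instantaneous `vᵢ → Vᵢ`) are both Mathlib-only and, with the KINEMATIC
  charge `P(t,c,R) := Σ_{‖ξⱼ-c‖≤R} Mⱼγⱼ(1,vⱼ)` (which makes every identification clause exact and turns the
  window law into the toy's impulse bound, membership being frozen along δ-clear Lipschitz paths), any toy
  counterexample would be an UNCONDITIONAL Lean refutation of either stub. None exists for `N ≤ 2` (§H, §I:
  `toy_two_body_cesaro`, `toy_two_body_frozen`), and none was found for `N ≥ 3`. The slack terms do not help an
  adversary: `η(t₁)` is charged once per PATH and long admissible paths exist (`c = ξᵢ`, `R = min(dᵢ/3, cone)` are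
  2-Lipschitz because speeds are `≤ k < 1`), `ζ(t) → 0` and `C/R` are read at `R → ∞`; the law at bounded
  `R = R₀` is junk but never needed. The `∀ρ ∃C(ρ)` order in lead-0's window law is no loophole either (a
  time-growing `K(t)` is visible at every divergent scale). So the drefute verdict "stubs survive" stands
  from the cdisprove side, now INCLUDING the instantaneous strengthening.
* WHAT THE `N ≥ 3` INDUCTION NEEDS (cycle 3, sharpening the shuttle analysis): velocity DIFFERENCES inside an
  `o(t)`-cluster tend to `0` only hierarchically (a tight pair `d₁₂ ≍ t^{0.1}` inside a triple of size `t^{0.5}`: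
  `v₁ - v₂ ≲ t^{-0.025}` from the pair's own scale, `v₁₂ - v₃ ≲ t^{-0.125}` from the pair-COM scale; the direct
  estimate for `(1,3)` diverges because hole 1's force is governed by its NEAREST neighbour), so the induction
  must run on GROUP momenta: at a late time with velocity spread `≥ 2NA` in a coordinate, split at a pigeonhole
  gap `≥ 2A` into `G⁺`/`G⁻`; while the gap persists, cross distances are `≥ max(m, A|t - t_fs|)` and the cross
  impulse on each group is `≤ N²·2Kp m^{1-p}/((p-1)A) → 0` (`m` = guaranteed separation, h₄); the missing step
  is that the GAP ITSELF persists although individual fast holes may trade momentum inside `G⁺` — a nested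
  version of `escape_of_deriv_ge` for sub-cluster centres of mass (Marchal–Saari 1976 prove the Newtonian
  analogue by the same gap/shell device). A Lean proof is planner/prover work; no schedule tried (shuttle,
  velocity chains, breathing triples, partner migration between sub-clusters) breaks the conclusion.
* THE ONE-DIMENSIONAL CHAIN (cycle 3; the cleanest form of the `N ≥ 3` problem, offered to the leads). In one
  space dimension the toy is EXACTLY a tension chain: after the separation time the ORDER of the bodies is
  frozen (a pass would be a collision, `d_ij = 0 < m`), the gaps `g_k = x_(k+1) - x_(k) ≥ m → ∞`, and with the
  block tensions `T_k := Σ_{i ≤ k} m_(i) a_(i)` (`T_0 = 0`, `T_N` = total force, `|T_N| ≤ K t^{-p}`) the balance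
  for the left block `{(1..k)}` (isolated by `g_k`) reads `|T_k| ≤ K min(t, g_k)^{-p}`, while
  `m_(k) a_(k) = T_k - T_{k-1}` and `g̈ = -M T` with `M` the positive-definite tridiagonal mass matrix
  (`M_kk = 1/m_(k) + 1/m_(k+1)`, `M_{k,k±1} = -1/m`). Since `v_(k+1) - v_(k) = ġ_k` and `P` converges, the
  frozen toy in 1-D is EQUIVALENT to: every gap rate `ġ_k` converges. `N = 2` = §I. The natural induction:
  (Q_N) "no creation of relative speed" — on an interval with gaps `≥ m` and integrable end forcing,
  `sup |ġ_k| ≤ C_N (max_j |ġ_j(a)| + m^{(1-p)/2} + forcing)` (for one gap this is the pair energy bound: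
  `ġ² ≤ ġ(a)² + 2K'm^{1-p}/(p-1)` on the first monotone stretch and `≤ 2K'm^{1-p}/(p-1)` after any turning
  point); (E_N) "escape" — a gap with `ġ_k(a) ≥ 2A` late keeps `ġ_k ≥ A` (the neighbouring tight pairs act as
  rigid blocks by (Q)); then `limsup |ġ_k| = L > 0` forces `ġ_k ≥ L/3` eventually (descents collapse the gap
  below `m`), `g_k` linear, `T_k` integrable, and the chain splits into two shorter chains with integrable end
  forcing — induction; `limsup = 0` for all `k` is the frozen conclusion. NEAR-MISS tested on this model (the
  "balanced double-gap pump", `N = 3`): tensions `T₁ = F`, `T₂ = (1 + m₂/m₁)F` accelerate bodies 1 and 2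
  TOGETHER (`a₁ = a₂ = F/m₁`, so `g₁` is untouched and `|T₁| ≤ K g₁^{-p}` only asks `g₁ ≲ (K/F)^{1/p}`) and push
  body 3 the other way: a kick `Δv₁ = +A` costs `Δġ₂ = -κA`, `κ = 1 + (m₁ + m₂)/m₃`; alternating kicks `±A`
  would make `v₁` oscillate forever with every balance inequality satisfied — but a kicked gap approaching at
  speed `κA` from `g₂ ≍ t^q` collapses below `m` within time `≍ t^q/A`, while the restoring kick needs impulse
  `κA` at tension `≤ K t^{-pq}`, i.e. time `≍ A t^{pq}/K ≫ t^q` (`p > 1`): the turnaround lemma again. Keeping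
  `ġ₂ > 0` instead makes `g₂` linear and `T₂` integrable (no more kicks). Dead, like the shuttle.
* TIME ORIENTATION / ORTHOCHRONY (cycle 3, after prover seat 0): `lorentzGroup = O(1,3)` and nothing asks `Φ`
  to be time-orientation preserving, so an anti-orthochronous `Λᵢ` paints a WHITE-hole (outgoing) Kerr–Schild
  form, and a time-reversing `Φ` would read "late" as physically early. Neither gives this seat a witness: the
  late outgoing-KS region inside `r₊` runs off along the past horizon to `V → -∞` (not in the domain of
  dependence of one-ended data that are Schwarzschild there), and `Φ(late ext) ⊆ O ⊆ J⁺(ιX)` plus exhaustion for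
  every `t₁ > τ₀` leaves no room for infinitely many unit-lapse AF slabs stacked towards the past. Misstatement
  risk for PROVERS (they must exclude these paintings inside the proof), not a refutation; a planner may add
  `(Λᵢe₀)⁰ > 0` and an orientation clause for `Φ` at no cost.
* MUTATION SUMMARY (all antecedent clauses; cycles 1–3): h₁ sub-extremality + `rin ∈ (r₋, r₊)` —
  load-bearing TRIVIALLY (the conclusion demands sub-extremal holes `C²`-matched near the horizon; an
  extremal painted hole would falsify it) and `rin < r₊` is what lets a prover locate the true event
  horizon as a graph (the conclusion's hole charts must be EXACTLY horizon-normalised: image `⊆ O` and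
  covering `O` near `H⁺` for every chart time `> d.τ₀`); h₂ bounded Lorentz factor — kinematically
  load-bearing (§F note), physically a Bondi-mass consequence; h₃ smoothness — technical; h₄ separation —
  implied by the near-zone superposition defect (§F) yet USED by any `N ≥ 3` mechanism (shuttle) and by the freezing of instantaneous velocities (§I); h₅ cone
  `‖ξᵢ‖ ≤ κ²t` — given h₂ it only fixes the GAP between the holes' cone `κ²t` and the weighted zone `κt`,
  which is exactly where the scale-`t` clean spheres live (total-momentum balance); h₆ `U ⊇` painted
  region down to `rin` — proof convenience (horizon location), not truth; h₇ `C³` + weight `7/4` — the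
  weight is load-bearing down to `3/2` (§H), the third derivative feeds `Ric → 0` in `C¹` (slaving rates);
  h₈ exhaustion `∀ t₁ > τ₀` — pins `O` to the DOC-like exterior (painted exteriors cannot poke inside the
  true horizon: an interior pocket point would fail `J⁻` of late slabs) and needs push-up (§B).
* NEWTONIAN SUPPORT: Marchal–Saari (JDE 20 (1976) 150; paywalled here, acq-03258) and Saari 2005 (held:
  `book:saari2005-…`, doi:10.1090/cbms/104; PDF pp. 54–55: separating "galaxies" `ρⱼ ∼ Aⱼ t^β` force
  `β = 2/3` and a central-configuration equation; PDF p. 181, Thm. 4.12 after Pollard: `I = O(t²)` or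
  `I ∼ At²` ⇒ Cesàro means of `T`, `U` converge, via the Tauberian Thm. 4.11 fed by Lagrange–Jacobi
  `I'' = U + 2h`): `R = O(t) ⇒ rᵢ = Aᵢ t + O(t^{2/3})` — exactly CESÀRO velocities, clusters sharing `Aᵢ`;
  Pollard / Lagrange–Jacobi at zero energy (`Ï = U ≥ A I^{-1/2} ⇒ I ≳ t^{4/3}`) excludes sub-parabolic
  isolated clusters, so Newtonian near-forces are `O(t^{-4/3})`, integrable, and even instantaneous
  velocities converge there. The GR-specific danger was only ever the sign-less `ε²` field-momentum
  channel, which §H shows is tame at `p = 3/2` for the Cesàro question.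
* N = 1: "no self-acceleration" = integrability of the LL momentum flux through ONE buffer sphere for the
  frozen-velocity reading; for the typed conclusion only `ξ(t)/t → V` is needed and the sphere may be
  taken at radius `θt` (flux `ε² t^{-3/2}`, integrable with no rate): N = 1 is NOT a threat. [Prover seat 3
  has the at-rest terminal step, p74684.]
* REMAINING RISKS ARE BOOKKEEPING, not mechanism: (r1) every sup-norm flux identity around the MODULATED
  background carries painted `λ̇` terms (triage finding F2; KS-stabiliser twist, p74809) — the clean-sphere
  flux is `ε² d^{-3/2}` only after the ansatz's own `λ̇`-flux is identified as an exact derivative or shown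
  `o(d^{-3/4})`-small; (r2) the lab-slab / boosted-slab exhaustion transfer in `HasExhaustiveCharts`
  (push-up and a fixed time factor, §B); (r3) `|Λ̇ᵢ| → 0` from `Ric = 0` + `C³` closeness near the horizon
  (kit j005733 of ideator 1: the linearised Ricci of an accelerated KS ansatz is non-degenerate).
[folklore] -/
theorem regimes_note : True := trivial

end Summit.FinalStateConjecture.FinalStateConjecture.Cruxes.InertialRecession.Disproof

end
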